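import Literature.AlgebraicGeometry.Motives.HodgeThetaSubalgebraUnitaryOrthogonalChainPos
import Literature.AlgebraicGeometry.Motives.HodgeThetaSubalgebraUnitaryFortyOneFortyThreeGoodRankCores
import Literature.AlgebraicGeometry.Motives.HodgeThetaSubalgebraUnitaryEighteenFortyNineCorePart1
import Literature.AlgebraicGeometry.Motives.HodgeThetaSubalgebraUnitarySixteenTwentyFiveCore
import Literature.AlgebraicGeometry.Motives.HodgeThetaSubalgebraUnitaryThirtyFortyNineCorePart1
import Literature.AlgebraicGeometry.Motives.HodgeThetaSubalgebraUnitaryTwentyFourFortyNineCorePart1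
import Literature.AlgebraicGeometry.Motives.HodgeThetaSubalgebraUnitaryTwentySevenThirtyFourCorePart1
import Literature.AlgebraicGeometry.Motives.HodgeThetaSubalgebraUnitaryTwentyTwoFortyNineCorePart1
import Literature.AlgebraicGeometry.Motives.HodgeThetaSubalgebraUnitaryThirtyFourFortyNineCorePart2
import HarnessLib
import Literature.AlgebraicGeometry.Motives.HodgeThetaSubalgebraUnitaryConstantRankLeviThree
import Literature.AlgebraicGeometry.Motives.HodgeThetaSubalgebraUnitaryEightNineCore
import Literature.AlgebraicGeometry.Motives.HodgeThetaSubalgebraUnitaryEightTwentyOneCore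
import Literature.AlgebraicGeometry.Motives.HodgeThetaSubalgebraUnitaryFiveCoreAll
import Literature.AlgebraicGeometry.Motives.HodgeThetaSubalgebraUnitaryFourOddCore
import Literature.AlgebraicGeometry.Motives.HodgeThetaSubalgebraUnitaryLowerNonVanishing
import Literature.AlgebraicGeometry.Motives.HodgeThetaSubalgebraUnitaryNineElevenCore
import Literature.AlgebraicGeometry.Motives.HodgeThetaSubalgebraUnitaryNineTenCore
import Literature.AlgebraicGeometry.Motives.HodgeThetaSubalgebraUnitaryNineTwentyEightCore
import Literature.AlgebraicGeometry.Motives.HodgeThetaSubalgebraUnitaryRankOneRaise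
import Literature.AlgebraicGeometry.Motives.HodgeThetaSubalgebraUnitarySeventeenCore
import Literature.AlgebraicGeometry.Motives.HodgeThetaSubalgebraUnitarySixSevenCoreAll
import Literature.AlgebraicGeometry.Motives.HodgeThetaSubalgebraUnitaryTenTwentySevenCore
import Literature.AlgebraicGeometry.Motives.HodgeThetaSubalgebraUnitaryThreeCoprimeCore
import Literature.AlgebraicGeometry.Motives.HodgeThetaSubalgebraUnitaryTwelveThirteenCore
import Literature.AlgebraicGeometry.Motives.HodgeThetaSubalgebraUnitaryTwelveTwentyFiveCore
import Literature.AlgebraicGeometry.Motives.HodgeThetaSubalgebraUnitaryTwoOddCore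

/-!
# (Part 3 of 5 — lemmas) The `Θ`-subalgebra theorem for unitary multiplicities `(34, 49)` — a `p = 83` cell by minimal-rank base points
# and sub-Levi recursion (Ribet 1983 Thm. 3, Lie step; abelian 83-folds of type `(34, 49)`)

Family `hodge`, layer `Literature/AlgebraicGeometry/Motives` (pure linear algebra over `ℂ`; no geometry). Research
context: cell `pub-hodge-ring2` (HONEST FRAMING: research route conditional on HC_CM; not a corollary; Q11.4-sentence-2
already refuted in dim ≥ 3), Literature lane gen 89. UNCONDITIONAL; theorems only, no definition, no named fact
(D-0026), no `sorry`.

THE PRINT. K. A. Ribet, Amer. J. Math. 105 (1983), Thm. 3 = Gordon's survey Thm. 6.3 (3) [held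
`paper:arxiv-alg-geom_9709030` p. 18]. THE METHOD: `HodgeThetaSubalgebraUnitarySixteenTwentyOneCore` (a raising operator
`B` of MINIMAL non-zero rank `m`, the profile dichotomy `i + j ≤ m` or `i, j ≥ m`, tree cores making a Levi algebra full
or killing a Levi rank, lifts `UnitaryRaisingSpace.exists_raise_finrank_range_eq` + `UnitaryLeviSetup.exists_lift`, two
pencils `UnitaryGenericRank.exists_finrank_le_and_finrank_le`, the non-vanishing lemma
`UnitaryLeviFull.exists_raise_commute_apply_ne_zero`, TOOL C `UnitaryConstantRank.exists_raise_rank_ne_two`, TOOL F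
`UnitaryConstantRank.false_of_le_rank`), the full-rank chain `UnitaryConstantRank.dvd_of_rank_eq_finrank`
(`HodgeThetaSubalgebraUnitaryNineTwentyEightCore`) and TOOL G `UnitaryOrthogonalChain.false_of_constProfile`.

THIS PART FILE holds minimal-rank lemmas of the cell (the gate caps a proposal at 200 kB); the core theorem `UnitaryThirtyFourFortyNine.eq_top_of_smul` is assembled in `HodgeThetaSubalgebraUnitaryThirtyFourFortyNineCore`.

THE CELL `(34 | 49)`. Good ranks 1, 2, 3, 4, 5, 6, 11, 13 (Levi types `(1|48)`, `(2|47)`, `(3|46)`, `(4|45)`, `(5|44)`, `(6|43)`, `(11|38)`, `(13|36)` are tree cores); a proper `𝔊` has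
raising ranks in `{0, 7, 8, 9, 10, 12, 14, 15, 16, 17, 18, 19, 20, 21, 22, 23, 24, 25, 26, 27, 28, 29, 30, 31, 32, 33, 34}`; `m` minimal non-zero, `B` of rank `m`; a commuting raising `X` has profile
`(i, j)` (`i + j` a raising rank, `i + j ≤ m` or `i, j ≥ m`). SUB-LEVI RECURSION: when the non-zero profiles are constantly
`(i, j)`, the Levi algebra `L⁺` (resp. `L⁻`) is a `Θ`-algebra whose non-zero raising ranks are all `i` (resp. `j`), and the
same minimal-rank analysis applies to it (the `sub…` lemmas of §1).
* `m = 7` (`U⁺` of type `(27 | 7)`, `U⁻` of type `(7 | 42)`): `L⁺` of type `(27 | 7)` is full and a lift with `i = 2` has `j ∈ {5}`, killed in `L⁻` (type `(7 | 42)`).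
* `m = 8` (`U⁺` of type `(26 | 8)`, `U⁻` of type `(8 | 41)`): after the Levi kills every profile has `j = 0` (profiles [(0, 0), (8, 0)]), against the non-vanishing lemma on `U⁻`.
* `m = 9` (`U⁺` of type `(25 | 9)`, `U⁻` of type `(9 | 40)`): after the Levi kills the profiles are [(0, 0), (0, 9), (5, 4), (9, 0), (9, 9)], so `L⁺` (type `(25 | 9)`) is a `Θ`-algebra with non-zero raising ranks in `{5, 9}` — impossible by the sub-Levi lemmas.
* `m = 10` (`U⁺` of type `(24 | 10)`, `U⁻` of type `(10 | 39)`): after the Levi kills the profiles are [(0, 0), (0, 10), (2, 8), (4, 6), (10, 0), (10, 10)], so `L⁻` (type `(10 | 39)`) is a `Θ`-algebra with non-zero raising ranks in `{6, 8, 10}` — impossible by the sub-Levi lemmas.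
* `m = 12` (`U⁺` of type `(22 | 12)`, `U⁻` of type `(12 | 37)`): after the Levi kills every profile has `i = 0` (profiles [(0, 0)]), against the non-vanishing lemma.
* `m = 14` (`U⁺` of type `(20 | 14)`, `U⁻` of type `(14 | 35)`): after the Levi kills the profiles are [(0, 0), (0, 14), (2, 12), (4, 10), (5, 9), (6, 8), (14, 0), (14, 14)], so `L⁻` (type `(14 | 35)`) is a `Θ`-algebra with non-zero raising ranks in `{8, 9, 10, 12, 14}` — impossible by the sub-Levi lemmas.
* `m = 15` (`U⁺` of type `(19 | 15)`, `U⁻` of type `(15 | 34)`): after the Levi kills every profile has `i = 0` (profiles [(0, 0), (0, 15)]), against the non-vanishing lemma.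
* `m = 16` (`U⁺` of type `(18 | 16)`, `U⁻` of type `(16 | 33)`): the non-zero profiles [(2, 14), (4, 12), (6, 10), (8, 8), (10, 6), (16, 0)] are pairwise exclusive, so constant; `(2, 14)`: TOOL C on `L⁺`; `(4, 12)`: `L⁺` (type `(18 | 16)`) has constant rank `4`; `(6, 10)`: `L⁺` (type `(18 | 16)`) has constant rank `6`; `(8, 8)`: `L⁻` (type `(16 | 33)`) has constant rank `8`; `(10, 6)`: `L⁺` (type `(18 | 16)`) has constant rank `10`; `(16, 0)`: `L⁻` would kill `Q ∩ ker B`.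
* `m = 17` (`U⁺` of type `(17 | 17)`, `U⁻` of type `(17 | 32)`): the non-zero profiles [(1, 16), (3, 14), (5, 12), (7, 10), (8, 9), (9, 8), (11, 6), (13, 4), (15, 2), (17, 0)] are pairwise exclusive, so constant; `(1, 16)`: `L⁻` (type `(17 | 32)`) has constant rank `16`; `(3, 14)`: `L⁻` (type `(17 | 32)`) has constant rank `14`; `(5, 12)`: `L⁻` (type `(17 | 32)`) has constant rank `12`; `(7, 10)`: `L⁻` (type `(17 | 32)`) has constant rank `10`; `(8, 9)`: `L⁻` (type `(17 | 32)`) has constant rank `9`; `(9, 8)`: `L⁻` (type `(17 | 32)`) has constant rank `8`; `(11, 6)`: `L⁻` (type `(17 | 32)`) has constant rank `6`; `(13, 4)`: TOOL G; `(15, 2)`: TOOL C on `L⁻`; `(17, 0)`: `L⁻` would kill `Q ∩ ker B`.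
* `m = 18` (`U⁺` of type `(16 | 18)`, `U⁻` of type `(18 | 31)`): after the Levi kills every profile has `i = 0` (profiles [(0, 0)]), against the non-vanishing lemma.
* `m = 19` (`U⁺` of type `(15 | 19)`, `U⁻` of type `(19 | 30)`): after the Levi kills every profile has `i = 0` (profiles [(0, 0)]), against the non-vanishing lemma.
* `m = 20` (`U⁺` of type `(14 | 20)`, `U⁻` of type `(20 | 29)`): after the Levi kills every profile has `i = 0` (profiles [(0, 0)]), against the non-vanishing lemma.
* `m = 21` (`U⁺` of type `(13 | 21)`, `U⁻` of type `(21 | 28)`): `L⁺` of type `(13 | 21)` is full and a lift with `i = 4` has `j ∈ {17}`, killed in `L⁻` (type `(21 | 28)`).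
* `m = 22` (`U⁺` of type `(12 | 22)`, `U⁻` of type `(22 | 27)`): the non-zero profiles [(4, 18), (10, 12)] are pairwise exclusive, so constant; `(4, 18)`: `L⁺` (type `(12 | 22)`) has constant rank `4`; `(10, 12)`: TOOL G.
* `m = 23` (`U⁺` of type `(11 | 23)`, `U⁻` of type `(23 | 26)`): `L⁺` of type `(11 | 23)` is full and a lift with `i = 2` has `j ∈ {21}`, killed in `L⁻` (type `(23 | 26)`).
* `m = 24` (`U⁺` of type `(10 | 24)`, `U⁻` of type `(24 | 25)`): the non-zero profiles [(4, 20), (8, 16), (9, 15)] are pairwise exclusive, so constant; `(4, 20)`: `L⁺` (type `(10 | 24)`) has constant rank `4`; `(8, 16)`: `L⁺` (type `(10 | 24)`) has constant rank `8`; `(9, 15)`: TOOL G.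
* `m = 25` (`U⁺` of type `(9 | 25)`, `U⁻` of type `(25 | 24)`): the non-zero profiles [(5, 20), (9, 16)] are pairwise exclusive, so constant; `(5, 20)`: `L⁺` (type `(9 | 25)`) has constant rank `5`; `(9, 16)`: TOOL G.
* `m = 26` (`U⁺` of type `(8 | 26)`, `U⁻` of type `(26 | 23)`): the non-zero profiles [(4, 22), (6, 20)] are pairwise exclusive, so constant; `(4, 22)`: `L⁺` (type `(8 | 26)`) has constant rank `4`; `(6, 20)`: `L⁺` (type `(8 | 26)`) has constant rank `6`.
* `m = 27` (`U⁺` of type `(7 | 27)`, `U⁻` of type `(27 | 22)`): `L⁺` of type `(7 | 27)` is full and a lift with `i = 1` has no feasible `j`.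
* `m = 28` (`U⁺` of type `(6 | 28)`, `U⁻` of type `(28 | 21)`): after the Levi kills every profile has `i = 0` (profiles [(0, 0)]), against the non-vanishing lemma.
* `m = 29` (`U⁺` of type `(5 | 29)`, `U⁻` of type `(29 | 20)`): `L⁺` of type `(5 | 29)` is full and a lift with `i = 1` has no feasible `j`.
* `m = 30` (`U⁺` of type `(4 | 30)`, `U⁻` of type `(30 | 19)`): after the Levi kills every profile has `i = 0` (profiles [(0, 0)]), against the non-vanishing lemma.
* `m = 31` (`U⁺` of type `(3 | 31)`, `U⁻` of type `(31 | 18)`): `L⁺` of type `(3 | 31)` is full and a lift with `i = 1` has no feasible `j`.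
* `m = 32` (`U⁺` of type `(2 | 32)`, `U⁻` of type `(32 | 17)`): after the Levi kills every profile has `i = 0` (profiles [(0, 0)]), against the non-vanishing lemma.
* `m = 33` (`U⁺` of type `(1 | 33)`, `U⁻` of type `(33 | 16)`): `L⁺` of type `(1 | 33)` is full and a lift with `i = 1` has no feasible `j`.
* `m = 34 = dim P`: the full-rank chain would give `34 ∣ 49`.

## References
* [Ribet1983] K. A. Ribet, *Hodge classes on certain types of abelian varieties*, Amer. J. Math. 105 (1983), Thm. 3.
* [Gordon1997] B. B. Gordon, *A survey of the Hodge conjecture for abelian varieties*, Thm. 6.3 (3), pp. 18–19.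
* [Deligne1982HodgeCycles] P. Deligne, *Hodge cycles on abelian varieties*, LNM 900 (1982), I §3 Prop. 3.4, 3.6.
* [GoodmanWallachGTM255] R. Goodman, N. R. Wallach, GTM 255 (2009), §2.3.1, §4.1.1.
* [HoffmanKunze1971LinearAlgebra] K. Hoffman, R. Kunze, *Linear Algebra* (1971), §3.1 Thm. 2, §6.7, §8.5.
-/

noncomputable section

open Module

namespace Literature.AlgebraicGeometry.Motives

namespace HodgeStructure

universe u

variable {W : Type u} [AddCommGroup W] [Module ℂ W]

/-! ### §2 The minimal-rank lemmas -/

/-- `(34 | 49)`, minimal rank `12`: after the Levi kills every profile has `i = 0` (profiles [(0, 0)]), against the non-vanishing lemma. [cite: Ribet1983, Thm. 3] [cite: Gordon1997, Thm. 6.3 (3)]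
[cite: Deligne1982HodgeCycles, I §3 Prop. 3.4, 3.6] [cite: GoodmanWallachGTM255, §4.1.1] -/
theorem UnitaryThirtyFourFortyNine.no_minRank_12 [FiniteDimensional ℂ W] {𝔊 : Submodule ℂ (Module.End ℂ W)}
    (hbr : ∀ Y ∈ 𝔊, ∀ Z ∈ 𝔊, Y * Z - Z * Y ∈ 𝔊)
    (hirr : ∀ U : Submodule ℂ W, (∀ A ∈ 𝔊, ∀ u ∈ U, A u ∈ U) → U = ⊥ ∨ U = ⊤)
    {Θ : Module.End ℂ W} (hΘ : Θ ∈ 𝔊) (hΘΘ : Θ * Θ = 1)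
    {P Q : Submodule ℂ W} (hP : ∀ x, x ∈ P ↔ Θ x = x) (hQ : ∀ x, x ∈ Q ↔ Θ x = -x)
    (hP34 : Module.finrank ℂ P = 34) (hQ49 : Module.finrank ℂ Q = 49)
    {s : W → W → ℂ} (hadd : ∀ x y z, s (x + y) z = s x z + s y z)
    (hsmul : ∀ (c : ℂ) (x y : W), s (c • x) y = c * s x y) (hsymm : ∀ x y, s y x = starRingEnd ℂ (s x y))
    (hPQ : ∀ p ∈ P, ∀ q ∈ Q, s p q = 0) (hdefP : ∀ p ∈ P, s p p = 0 → p = 0) (hdefQ : ∀ q ∈ Q, s q q = 0 → q = 0)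
    (hadj : ∀ X ∈ 𝔊, ∃ Y ∈ 𝔊, ∀ x y, s (X x) y = s x (Y y))
    (hS : ∀ B' ∈ 𝔊, Θ * B' = B' → B' * Θ = -B' →
      Module.finrank ℂ (LinearMap.range B') = 0 ∨ Module.finrank ℂ (LinearMap.range B') = 12 ∨ Module.finrank ℂ (LinearMap.range B') = 14 ∨ Module.finrank ℂ (LinearMap.range B') = 15 ∨ Module.finrank ℂ (LinearMap.range B') = 16 ∨ Module.finrank ℂ (LinearMap.range B') = 17 ∨ Module.finrank ℂ (LinearMap.range B') = 18 ∨ Module.finrank ℂ (LinearMap.range B') = 19 ∨ Module.finrank ℂ (LinearMap.range B') = 20 ∨ Module.finrank ℂ (LinearMap.range B') = 21 ∨ Module.finrank ℂ (LinearMap.range B') = 22 ∨ Module.finrank ℂ (LinearMap.range B') = 23 ∨ Module.finrank ℂ (LinearMap.range B') = 24 ∨ Module.finrank ℂ (LinearMap.range B') = 25 ∨ Module.finrank ℂ (LinearMap.range B') = 26 ∨ Module.finrank ℂ (LinearMap.range B') = 27 ∨ Module.finrank ℂ (LinearMap.range B') = 28 ∨ Module.finrank ℂ (LinearMap.range B')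 = 29 ∨ Module.finrank ℂ (LinearMap.range B') = 30 ∨ Module.finrank ℂ (LinearMap.range B') = 31 ∨ Module.finrank ℂ (LinearMap.range B') = 32 ∨ Module.finrank ℂ (LinearMap.range B') = 33 ∨ Module.finrank ℂ (LinearMap.range B') = 34)
    {B : Module.End ℂ W} (hB : B ∈ 𝔊) (hΘB : Θ * B = B) (hBΘ : B * Θ = -B)
    (hr : Module.finrank ℂ (LinearMap.range B) = 12) : False := by
  classical
  have hsU : ∀ U : Submodule ℂ W, ∀ x y z : U, s ((x + y : U) : W) z = s (x : W) z + s (y : W) z :=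
    fun U x y z => by simp only [Submodule.coe_add, hadd]
  have hsmU : ∀ U : Submodule ℂ W, ∀ (c : ℂ) (x y : U), s ((c • x : U) : W) y = c * s (x : W) y :=
    fun U c x y => by simp only [Submodule.coe_smul, hsmul]
  have hno1 : ∀ B' ∈ 𝔊, Θ * B' = B' → B' * Θ = -B' → Module.finrank ℂ (LinearMap.range B') ≠ 1 := by
    intro B' hB' hΘB' hB'Θ h1
    rcases hS B' hB' hΘB' hB'Θ with h | h | h | h | h | h | h | h | h | h | h | h | h | h | h | h | h | h | h | h | h | h | h <;> omega
  have hmin : ∀ Y ∈ 𝔊, Θ * Y = Y → Y * Θ = -Y → Y ≠ 0 → 12 ≤ Module.finrank ℂ (LinearMap.range Y) := by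
    intro Y hY hΘY hYΘ hY0
    have h0 : Module.finrank ℂ (LinearMap.range Y) ≠ 0 := fun h =>
      hY0 (LinearMap.range_eq_bot.1 (Submodule.finrank_eq_zero.1 h))
    rcases hS Y hY hΘY hYΘ with h | h | h | h | h | h | h | h | h | h | h | h | h | h | h | h | h | h | h | h | h | h | h <;> omega
  have hmin' : ∀ Z ∈ 𝔊, Θ * Z = Z → Z * Θ = -Z → Z ≠ 0 → Module.finrank ℂ (LinearMap.range B) ≤ Module.finrank ℂ (LinearMap.range Z) := by
    rw [hr]; exact hmin
  obtain ⟨ι, Um, Up, PU, QU, Lm, ιm, Pm, Qm, Lp, ιp, Pp, Qp, hιmem, hιι, hιΘ, hιs, hUm, hUp, hfinUm, hfinUp,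
    hPM, hQM, hPU, hQU, hrangeP, hPUP, hQUQ, hfinQM, hfinPU, hfinQU, hLm, hLp,
    hιmapply, hPmmem, hQmmem, hbrLm, hirrLm, hιmmem, hιmιm, hPm, hQm, hfinPm, hfinQm, hPmQm, hdefPm, hdefQm, hadjLm,
    hιpapply, hPpmem, hQpmem, hbrLp, hirrLp, hιpmem, hιpιp, hPp, hQp, hfinPp, hfinQp, hPpQp, hdefPp, hdefQp, hadjLp,
    hsplit⟩ :=
    UnitaryLeviSetup.exists_levi_pair hbr hirr hΘ hΘΘ hP hQ hadd hsymm hPQ hdefP hdefQ hadj hB hΘB hBΘ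
  have hdich : ∀ X ∈ 𝔊, Θ * X = X → X * Θ = -X → X * ι = ι * X →
      Module.finrank ℂ (Up.map X) + Module.finrank ℂ (Um.map X) ≤ Module.finrank ℂ (LinearMap.range B) ∨
        (12 ≤ Module.finrank ℂ (Up.map X) ∧ 12 ≤ Module.finrank ℂ (Um.map X)) := fun X hX hΘX hXΘ hXc =>
    UnitaryLeviSetup.profile_dichotomy hbr hΘΘ hP hQ hadd hsymm hPQ hdefP hdefQ hadj hmin hB hΘB hBΘ hιι hιΘ hιs hUm hUp
      hPM hQM hQU hfinQU hrangeP hX hΘX hXΘ hXc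
  have hfinQU' := hfinQU
  rw [hr] at hfinQM hfinPU hfinQU hfinPm hfinQm hfinPp hfinQp hsplit hdich
  rw [hQ49] at hfinQM hfinQm hfinUm
  rw [hP34] at hfinPU hfinPp hfinUp
  have hcm : ∀ Z : Module.End ℂ W, Z * ι = ι * Z → ∀ x ∈ Um, Z x ∈ Um := fun Z hZ x hx =>
    (hUm _).2 (by rw [← Module.End.mul_apply, ← hZ, Module.End.mul_apply, (hUm x).1 hx, map_neg])
  have hcp : ∀ Z : Module.End ℂ W, Z * ι = ι * Z → ∀ x ∈ Up, Z x ∈ Up := fun Z hZ x hx =>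
    (hUp _).2 (by rw [← Module.End.mul_apply, ← hZ, Module.End.mul_apply, (hUp x).1 hx])
  have hfullm_of : Lm = ⊤ → False := fun h =>
    UnitaryLeviSetup.false_of_full_larger hbr hΘΘ hno1 hιι hιΘ hUm hUp (by omega) (by omega) hPM hQM (by omega)
      (by omega) hLm h
  have hkillm1 : ∀ X ∈ 𝔊, Θ * X = X → X * Θ = -X → X * ι = ι * X → Module.finrank ℂ (Um.map X) ≠ 1 := by
    intro X hX hΘX hXΘ hXc h1
    obtain ⟨hxmem, hιmx, hxιm, hxrk⟩ := UnitaryLeviSetup.restrict_mem hcm hLm hιmapply X hX hΘX hXΘ hXc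
    rw [h1] at hxrk
    exact hfullm_of (UnitaryRankOneRaise.eq_top_of_rankOne_raise hbrLm hirrLm hιmmem hιmιm hPm hQm
      (s := fun v w : Um => s (v : W) w) (hsU Um) (fun v w => hsymm v w) hPmQm hdefPm hdefQm hadjLm hxmem hιmx hxιm
      hxrk (by omega) (by omega) (by omega))
  have hkillm2 : ∀ X ∈ 𝔊, Θ * X = X → X * Θ = -X → X * ι = ι * X → Module.finrank ℂ (Um.map X) ≠ 2 := by
    intro X hX hΘX hXΘ hXc h2
    obtain ⟨hxmem, hιmx, hxιm, hxrk⟩ := UnitaryLeviSetup.restrict_mem hcm hLm hιmapply X hX hΘX hXΘ hXc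
    rw [h2] at hxrk
    refine hfullm_of (UnitaryDoubleLevi.eq_top_of_raise_of_core hbrLm hirrLm hιmmem hιmιm hPm hQm
      (s := fun v w : Um => s (v : W) w) (hsU Um) (fun v w => hsymm v w) hPmQm hdefPm hdefQm hadjLm hxmem hιmx hxιm
      (by rw [hxrk]; omega) (by omega) (by omega)
      fun U' 𝔩' ι' P' Q' hbr𝔩' hirr𝔩' hι' hι'ι' hP' hQ' hfinP' hfinQ' hP'Q' hdefP' hdefQ' hadj𝔩' => ?_)
    rw [hxrk] at hfinP' hfinQ'
    exact UnitaryTwoOdd.eq_top hbr𝔩' hirr𝔩' hι' hι'ι' hP' hQ' hfinP' ⟨17, by omega⟩ (s := fun x y : U' => s ((x : Um) : W) y) (fun x y z => by simp only [Submodule.coe_add, hadd]) (fun x y => hsymm _ _) hP'Q' hdefP' hdefQ' hadj𝔩'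
  have hkillm3 : ∀ X ∈ 𝔊, Θ * X = X → X * Θ = -X → X * ι = ι * X → Module.finrank ℂ (Um.map X) ≠ 3 := by
    intro X hX hΘX hXΘ hXc h3
    obtain ⟨hxmem, hιmx, hxιm, hxrk⟩ := UnitaryLeviSetup.restrict_mem hcm hLm hιmapply X hX hΘX hXΘ hXc
    rw [h3] at hxrk
    refine hfullm_of (UnitaryDoubleLevi.eq_top_of_raise_of_core hbrLm hirrLm hιmmem hιmιm hPm hQm
      (s := fun v w : Um => s (v : W) w) (hsU Um) (fun v w => hsymm v w) hPmQm hdefPm hdefQm hadjLm hxmem hιmx hxιm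
      (by rw [hxrk]; omega) (by omega) (by omega)
      fun U' 𝔩' ι' P' Q' hbr𝔩' hirr𝔩' hι' hι'ι' hP' hQ' hfinP' hfinQ' hP'Q' hdefP' hdefQ' hadj𝔩' => ?_)
    rw [hxrk] at hfinP' hfinQ'
    exact UnitaryThreeCoprime.eq_top hbr𝔩' hirr𝔩' hι' hι'ι' hP' hQ' hfinP' (by omega) (s := fun x y : U' => s ((x : Um) : W) y) (fun x y z => by simp only [Submodule.coe_add, hadd]) (fun x y => hsymm _ _) hP'Q' hdefP' hdefQ' hadj𝔩'
  have hkillm4 : ∀ X ∈ 𝔊, Θ * X = X → X * Θ = -X → X * ι = ι * X → Module.finrank ℂ (Um.map X) ≠ 4 := by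
    intro X hX hΘX hXΘ hXc h4
    obtain ⟨hxmem, hιmx, hxιm, hxrk⟩ := UnitaryLeviSetup.restrict_mem hcm hLm hιmapply X hX hΘX hXΘ hXc
    rw [h4] at hxrk
    refine hfullm_of (UnitaryDoubleLevi.eq_top_of_raise_of_core hbrLm hirrLm hιmmem hιmιm hPm hQm
      (s := fun v w : Um => s (v : W) w) (hsU Um) (fun v w => hsymm v w) hPmQm hdefPm hdefQm hadjLm hxmem hιmx hxιm
      (by rw [hxrk]; omega) (by omega) (by omega)
      fun U' 𝔩' ι' P' Q' hbr𝔩' hirr𝔩' hι' hι'ι' hP' hQ' hfinP' hfinQ' hP'Q' hdefP' hdefQ' hadj𝔩' => ?_)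
    rw [hxrk] at hfinP' hfinQ'
    exact UnitaryFourOdd.eq_top hbr𝔩' hirr𝔩' hι' hι'ι' hP' hQ' hfinP' ⟨16, by omega⟩ (s := fun x y : U' => s ((x : Um) : W) y) (fun x y z => by simp only [Submodule.coe_add, hadd]) (fun x y => hsymm _ _) hP'Q' hdefP' hdefQ' hadj𝔩'
  have hkillm5 : ∀ X ∈ 𝔊, Θ * X = X → X * Θ = -X → X * ι = ι * X → Module.finrank ℂ (Um.map X) ≠ 5 := by
    intro X hX hΘX hXΘ hXc h5
    obtain ⟨hxmem, hιmx, hxιm, hxrk⟩ := UnitaryLeviSetup.restrict_mem hcm hLm hιmapply X hX hΘX hXΘ hXc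
    rw [h5] at hxrk
    refine hfullm_of (UnitaryDoubleLevi.eq_top_of_raise_of_core hbrLm hirrLm hιmmem hιmιm hPm hQm
      (s := fun v w : Um => s (v : W) w) (hsU Um) (fun v w => hsymm v w) hPmQm hdefPm hdefQm hadjLm hxmem hιmx hxιm
      (by rw [hxrk]; omega) (by omega) (by omega)
      fun U' 𝔩' ι' P' Q' hbr𝔩' hirr𝔩' hι' hι'ι' hP' hQ' hfinP' hfinQ' hP'Q' hdefP' hdefQ' hadj𝔩' => ?_)
    rw [hxrk] at hfinP' hfinQ'
    exact UnitaryFive.eq_top_of_smul hbr𝔩' hirr𝔩' hι' hι'ι' hP' hQ' hfinP' (by omega) (s := fun x y : U' => s ((x : Um) : W) y) (fun x y z => by simp only [Submodule.coe_add, hadd]) (fun c x y => by simp only [Submodule.coe_smul, hsmul]) (fun x y => hsymm _ _) hP'Q' hdefP' hdefQ' hadj𝔩'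
  have hkillm6 : ∀ X ∈ 𝔊, Θ * X = X → X * Θ = -X → X * ι = ι * X → Module.finrank ℂ (Um.map X) ≠ 6 := by
    intro X hX hΘX hXΘ hXc h6
    obtain ⟨hxmem, hιmx, hxιm, hxrk⟩ := UnitaryLeviSetup.restrict_mem hcm hLm hιmapply X hX hΘX hXΘ hXc
    rw [h6] at hxrk
    refine hfullm_of (UnitaryDoubleLevi.eq_top_of_raise_of_core hbrLm hirrLm hιmmem hιmιm hPm hQm
      (s := fun v w : Um => s (v : W) w) (hsU Um) (fun v w => hsymm v w) hPmQm hdefPm hdefQm hadjLm hxmem hιmx hxιm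
      (by rw [hxrk]; omega) (by omega) (by omega)
      fun U' 𝔩' ι' P' Q' hbr𝔩' hirr𝔩' hι' hι'ι' hP' hQ' hfinP' hfinQ' hP'Q' hdefP' hdefQ' hadj𝔩' => ?_)
    rw [hxrk] at hfinP' hfinQ'
    exact UnitarySix.eq_top_of_smul hbr𝔩' hirr𝔩' hι' hι'ι' hP' hQ' hfinP' ⟨15, by omega⟩ (by omega) (s := fun x y : U' => s ((x : Um) : W) y) (fun x y z => by simp only [Submodule.coe_add, hadd]) (fun c x y => by simp only [Submodule.coe_smul, hsmul]) (fun x y => hsymm _ _) hP'Q' hdefP' hdefQ' hadj𝔩'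
  have hkillm7 : ∀ X ∈ 𝔊, Θ * X = X → X * Θ = -X → X * ι = ι * X → Module.finrank ℂ (Um.map X) ≠ 7 := by
    intro X hX hΘX hXΘ hXc h7
    obtain ⟨hxmem, hιmx, hxιm, hxrk⟩ := UnitaryLeviSetup.restrict_mem hcm hLm hιmapply X hX hΘX hXΘ hXc
    rw [h7] at hxrk
    refine hfullm_of (UnitaryDoubleLevi.eq_top_of_raise_of_core hbrLm hirrLm hιmmem hιmιm hPm hQm
      (s := fun v w : Um => s (v : W) w) (hsU Um) (fun v w => hsymm v w) hPmQm hdefPm hdefQm hadjLm hxmem hιmx hxιm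
      (by rw [hxrk]; omega) (by omega) (by omega)
      fun U' 𝔩' ι' P' Q' hbr𝔩' hirr𝔩' hι' hι'ι' hP' hQ' hfinP' hfinQ' hP'Q' hdefP' hdefQ' hadj𝔩' => ?_)
    rw [hxrk] at hfinP' hfinQ'
    exact UnitarySeven.eq_top_of_smul hbr𝔩' hirr𝔩' hι' hι'ι' hP' hQ' hfinP' (by omega) (s := fun x y : U' => s ((x : Um) : W) y) (fun x y z => by simp only [Submodule.coe_add, hadd]) (fun c x y => by simp only [Submodule.coe_smul, hsmul]) (fun x y => hsymm _ _) hP'Q' hdefP' hdefQ' hadj𝔩'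
  have hkillm8 : ∀ X ∈ 𝔊, Θ * X = X → X * Θ = -X → X * ι = ι * X → Module.finrank ℂ (Um.map X) ≠ 8 := by
    intro X hX hΘX hXΘ hXc h8
    obtain ⟨hxmem, hιmx, hxιm, hxrk⟩ := UnitaryLeviSetup.restrict_mem hcm hLm hιmapply X hX hΘX hXΘ hXc
    rw [h8] at hxrk
    refine hfullm_of (UnitaryDoubleLevi.eq_top_of_raise_of_core hbrLm hirrLm hιmmem hιmιm hPm hQm
      (s := fun v w : Um => s (v : W) w) (hsU Um) (fun v w => hsymm v w) hPmQm hdefPm hdefQm hadjLm hxmem hιmx hxιm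
      (by rw [hxrk]; omega) (by omega) (by omega)
      fun U' 𝔩' ι' P' Q' hbr𝔩' hirr𝔩' hι' hι'ι' hP' hQ' hfinP' hfinQ' hP'Q' hdefP' hdefQ' hadj𝔩' => ?_)
    rw [hxrk] at hfinP' hfinQ'
    exact UnitaryEight.eq_top_of_smul_twentynine hbr𝔩' hirr𝔩' hι' hι'ι' hP' hQ' hfinP' (by omega) (s := fun x y : U' => s ((x : Um) : W) y) (fun x y z => by simp only [Submodule.coe_add, hadd]) (fun c x y => by simp only [Submodule.coe_smul, hsmul]) (fun x y => hsymm _ _) hP'Q' hdefP' hdefQ' hadj𝔩'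
  have hkillm9 : ∀ X ∈ 𝔊, Θ * X = X → X * Θ = -X → X * ι = ι * X → Module.finrank ℂ (Um.map X) ≠ 9 := by
    intro X hX hΘX hXΘ hXc h9
    obtain ⟨hxmem, hιmx, hxιm, hxrk⟩ := UnitaryLeviSetup.restrict_mem hcm hLm hιmapply X hX hΘX hXΘ hXc
    rw [h9] at hxrk
    refine hfullm_of (UnitaryDoubleLevi.eq_top_of_raise_of_core hbrLm hirrLm hιmmem hιmιm hPm hQm
      (s := fun v w : Um => s (v : W) w) (hsU Um) (fun v w => hsymm v w) hPmQm hdefPm hdefQm hadjLm hxmem hιmx hxιm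
      (by rw [hxrk]; omega) (by omega) (by omega)
      fun U' 𝔩' ι' P' Q' hbr𝔩' hirr𝔩' hι' hι'ι' hP' hQ' hfinP' hfinQ' hP'Q' hdefP' hdefQ' hadj𝔩' => ?_)
    rw [hxrk] at hfinP' hfinQ'
    exact UnitaryNineTwentyEight.eq_top_of_smul hbr𝔩' hirr𝔩' hι' hι'ι' hP' hQ' hfinP' (by omega) (s := fun x y : U' => s ((x : Um) : W) y) (fun x y z => by simp only [Submodule.coe_add, hadd]) (fun c x y => by simp only [Submodule.coe_smul, hsmul]) (fun x y => hsymm _ _) hP'Q' hdefP' hdefQ' hadj𝔩'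
  have hkillm10 : ∀ X ∈ 𝔊, Θ * X = X → X * Θ = -X → X * ι = ι * X → Module.finrank ℂ (Um.map X) ≠ 10 := by
    intro X hX hΘX hXΘ hXc h10
    obtain ⟨hxmem, hιmx, hxιm, hxrk⟩ := UnitaryLeviSetup.restrict_mem hcm hLm hιmapply X hX hΘX hXΘ hXc
    rw [h10] at hxrk
    refine hfullm_of (UnitaryDoubleLevi.eq_top_of_raise_of_core hbrLm hirrLm hιmmem hιmιm hPm hQm
      (s := fun v w : Um => s (v : W) w) (hsU Um) (fun v w => hsymm v w) hPmQm hdefPm hdefQm hadjLm hxmem hιmx hxιm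
      (by rw [hxrk]; omega) (by omega) (by omega)
      fun U' 𝔩' ι' P' Q' hbr𝔩' hirr𝔩' hι' hι'ι' hP' hQ' hfinP' hfinQ' hP'Q' hdefP' hdefQ' hadj𝔩' => ?_)
    rw [hxrk] at hfinP' hfinQ'
    exact UnitaryTenTwentySeven.eq_top_of_smul hbr𝔩' hirr𝔩' hι' hι'ι' hP' hQ' hfinP' (by omega) (s := fun x y : U' => s ((x : Um) : W) y) (fun x y z => by simp only [Submodule.coe_add, hadd]) (fun c x y => by simp only [Submodule.coe_smul, hsmul]) (fun x y => hsymm _ _) hP'Q' hdefP' hdefQ' hadj𝔩'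
  have hkillm11 : ∀ X ∈ 𝔊, Θ * X = X → X * Θ = -X → X * ι = ι * X → Module.finrank ℂ (Um.map X) ≠ 11 := by
    intro X hX hΘX hXΘ hXc h11
    obtain ⟨hxmem, hιmx, hxιm, hxrk⟩ := UnitaryLeviSetup.restrict_mem hcm hLm hιmapply X hX hΘX hXΘ hXc
    rw [h11] at hxrk
    refine hfullm_of (UnitaryDoubleLevi.eq_top_of_raise_of_core hbrLm hirrLm hιmmem hιmιm hPm hQm
      (s := fun v w : Um => s (v : W) w) (hsU Um) (fun v w => hsymm v w) hPmQm hdefPm hdefQm hadjLm hxmem hιmx hxιm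
      (by rw [hxrk]; omega) (by omega) (by omega)
      fun U' 𝔩' ι' P' Q' hbr𝔩' hirr𝔩' hι' hι'ι' hP' hQ' hfinP' hfinQ' hP'Q' hdefP' hdefQ' hadj𝔩' => ?_)
    rw [hxrk] at hfinP' hfinQ'
    exact UnitaryEleven.eq_top_of_smul hbr𝔩' hirr𝔩' hι' hι'ι' hP' hQ' hfinP' (by omega) (s := fun x y : U' => s ((x : Um) : W) y) (fun x y z => by simp only [Submodule.coe_add, hadd]) (fun c x y => by simp only [Submodule.coe_smul, hsmul]) (fun x y => hsymm _ _) hP'Q' hdefP' hdefQ' hadj𝔩'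
  have hkillm12 : ∀ X ∈ 𝔊, Θ * X = X → X * Θ = -X → X * ι = ι * X → Module.finrank ℂ (Um.map X) ≠ 12 := by
    intro X hX hΘX hXΘ hXc h12
    obtain ⟨hxmem, hιmx, hxιm, hxrk⟩ := UnitaryLeviSetup.restrict_mem hcm hLm hιmapply X hX hΘX hXΘ hXc
    rw [h12] at hxrk
    refine hfullm_of (UnitaryDoubleLevi.eq_top_of_raise_of_core hbrLm hirrLm hιmmem hιmιm hPm hQm
      (s := fun v w : Um => s (v : W) w) (hsU Um) (fun v w => hsymm v w) hPmQm hdefPm hdefQm hadjLm hxmem hιmx hxιm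
      (by rw [hxrk]; omega) (by omega) (by omega)
      fun U' 𝔩' ι' P' Q' hbr𝔩' hirr𝔩' hι' hι'ι' hP' hQ' hfinP' hfinQ' hP'Q' hdefP' hdefQ' hadj𝔩' => ?_)
    rw [hxrk] at hfinP' hfinQ'
    exact UnitaryTwelveTwentyFive.eq_top_of_smul hbr𝔩' hirr𝔩' hι' hι'ι' hP' hQ' hfinP' (by omega) (s := fun x y : U' => s ((x : Um) : W) y) (fun x y z => by simp only [Submodule.coe_add, hadd]) (fun c x y => by simp only [Submodule.coe_smul, hsmul]) (fun x y => hsymm _ _) hP'Q' hdefP' hdefQ' hadj𝔩'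
  have hfullp_of : Lp = ⊤ → False := by
    intro hLptop
    obtain ⟨T1, hιT1, hT1ι, hT1r⟩ := UnitaryRaisingSpace.exists_raise_finrank_range_eq hιpιp hPp hQp (k := 1)
      (by omega) (by omega)
    obtain ⟨X1, hX1, hΘX1, hX1Θ, hX1c, hX1Up⟩ := UnitaryLeviSetup.exists_lift hbr hΘ hΘΘ hcp hιΘ hLp hιpapply T1
      (by rw [hLptop]; exact Submodule.mem_top) hιT1 hT1ι
    rw [hT1r] at hX1Up
    obtain ⟨hs1, hi1, hi1', hj1, hj1'⟩ := hsplit X1 hΘX1 hX1Θ hX1c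
    have hrk1 := hS X1 hX1 hΘX1 hX1Θ
    have hd1 := hdich X1 hX1 hΘX1 hX1Θ hX1c
    rw [hs1] at hrk1
    rw [hX1Up] at hrk1 hd1
    have hk_hkillm11 := hkillm11 X1 hX1 hΘX1 hX1Θ hX1c
    omega
  have hprof0 : ∀ X ∈ 𝔊, Θ * X = X → X * Θ = -X → X * ι = ι * X →
      (Module.finrank ℂ (Up.map X) = 0 ∧ Module.finrank ℂ (Um.map X) = 0) ∨
        (Module.finrank ℂ (Up.map X) = 12 ∧ Module.finrank ℂ (Um.map X) = 0) := by
    intro X hX hΘX hXΘ hXc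
    obtain ⟨hs, hi, hi', hj, hj'⟩ := hsplit X hΘX hXΘ hXc
    have hkillm1' := hkillm1 X hX hΘX hXΘ hXc
    have hkillm2' := hkillm2 X hX hΘX hXΘ hXc
    have hkillm3' := hkillm3 X hX hΘX hXΘ hXc
    have hkillm4' := hkillm4 X hX hΘX hXΘ hXc
    have hkillm5' := hkillm5 X hX hΘX hXΘ hXc
    have hkillm6' := hkillm6 X hX hΘX hXΘ hXc
    have hkillm7' := hkillm7 X hX hΘX hXΘ hXc
    have hkillm8' := hkillm8 X hX hΘX hXΘ hXc
    have hkillm9' := hkillm9 X hX hΘX hXΘ hXc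
    have hkillm10' := hkillm10 X hX hΘX hXΘ hXc
    have hkillm11' := hkillm11 X hX hΘX hXΘ hXc
    have hkillm12' := hkillm12 X hX hΘX hXΘ hXc
    have hrk := hS X hX hΘX hXΘ
    have hd := hdich X hX hΘX hXΘ hXc
    rw [hs] at hrk
    generalize Module.finrank ℂ ↥(Submodule.map X Um) = jj at *
    have hjle : jj ≤ 12 := by omega
    interval_cases jj
    · rcases (show Module.finrank ℂ (Up.map X) = 0 ∨ Module.finrank ℂ (Up.map X) = 12 by omega) with h | h
      · exact Or.inl ⟨h, rfl⟩
      · exact Or.inr (⟨h, rfl⟩)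
    · exact (hkillm1' rfl).elim
    · exact (hkillm2' rfl).elim
    · exact (hkillm3' rfl).elim
    · exact (hkillm4' rfl).elim
    · exact (hkillm5' rfl).elim
    · exact (hkillm6' rfl).elim
    · exact (hkillm7' rfl).elim
    · exact (hkillm8' rfl).elim
    · exact (hkillm9' rfl).elim
    · exact (hkillm10' rfl).elim
    · exact (hkillm11' rfl).elim
    · exact (hkillm12' rfl).elim
  have hkillpF12 : ∀ X ∈ 𝔊, Θ * X = X → X * Θ = -X → X * ι = ι * X → Module.finrank ℂ (Up.map X) ≠ 12 := by
    intro X hX hΘX hXΘ hXc h12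
    obtain ⟨hymem, hιpy, hyιp, hyrk⟩ := UnitaryLeviSetup.restrict_mem hcp hLp hιpapply X hX hΘX hXΘ hXc
    rw [h12] at hyrk
    refine UnitaryConstantRank.false_of_le_rank hbrLp hirrLp hιpmem hιpιp hPp hQp (s := fun v w : Up => s (v : W) w)
      (hsU Up) (fun v w => hsymm v w) hPpQp hdefPp hdefQp hadjLp hymem hιpy hyιp
      (by rw [hyrk]; omega) (by rw [hyrk]; omega) fun A hA hιpA hAιp hAne => ?_
    obtain ⟨X', hX', hΘX', hX'Θ, hX'c, hX'Up⟩ :=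
      UnitaryLeviSetup.exists_lift hbr hΘ hΘΘ hcp hιΘ hLp hιpapply A hA hιpA hAιp
    have hA0 : Module.finrank ℂ (LinearMap.range A) ≠ 0 := fun h =>
      hAne (LinearMap.range_eq_bot.1 (Submodule.finrank_eq_zero.1 h))
    have hp := hprof0 X' hX' hΘX' hX'Θ hX'c
    rw [← hX'Up] at hA0
    rw [hyrk, ← hX'Up]
    omega
  have hprof : ∀ X ∈ 𝔊, Θ * X = X → X * Θ = -X → X * ι = ι * X →
      (Module.finrank ℂ (Up.map X) = 0 ∧ Module.finrank ℂ (Um.map X) = 0) := by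
    intro X hX hΘX hXΘ hXc
    have hp := hprof0 X hX hΘX hXΘ hXc
    have hkillpF12' := hkillpF12 X hX hΘX hXΘ hXc
    omega
  obtain ⟨⟨p, hp⟩, hp0⟩ := Module.finrank_pos_iff_exists_ne_zero.1 (show 0 < Module.finrank ℂ PU by omega)
  obtain ⟨⟨q, hq⟩, hq0⟩ := Module.finrank_pos_iff_exists_ne_zero.1 (show 0 < Module.finrank ℂ QU by omega)
  obtain ⟨X₀, hX₀, hΘX₀, hX₀Θ, hX₀c, c₀, hιc₀, -, hX₀c0⟩ :=
    UnitaryLeviFull.exists_raise_commute_apply_ne_zero hbr hirr hΘ hΘΘ hQ hιmem hιι hιΘ hUm hUp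
      ⟨p, fun h => hp0 (Subtype.ext h), ((hPU p).1 hp).1, ((hPU p).1 hp).2⟩
      ⟨q, fun h => hq0 (Subtype.ext h), ((hQU q).1 hq).1, ((hQU q).1 hq).2⟩
  have hX₀i : Module.finrank ℂ (Up.map X₀) ≠ 0 := fun h0 => by
    have hmem : X₀ c₀ ∈ Up.map X₀ := Submodule.mem_map_of_mem ((hUp c₀).2 hιc₀)
    rw [Submodule.finrank_eq_zero.1 h0, Submodule.mem_bot] at hmem
    exact hX₀c0 hmem
  have hp0 := hprof X₀ hX₀ hΘX₀ hX₀Θ hX₀c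
  omega

/-- `(34 | 49)`, minimal rank `14`: after the Levi kills the profiles are [(0, 0), (0, 14), (2, 12), (4, 10), (5, 9), (6, 8), (14, 0), (14, 14)], so `L⁻` (type `(14 | 35)`) is a `Θ`-algebra with non-zero raising ranks in `{8, 9, 10, 12, 14}` — impossible by the sub-Levi lemmas. [cite: Ribet1983, Thm. 3] [cite: Gordon1997, Thm. 6.3 (3)]
[cite: Deligne1982HodgeCycles, I §3 Prop. 3.4, 3.6] [cite: GoodmanWallachGTM255, §4.1.1] -/
theorem UnitaryThirtyFourFortyNine.no_minRank_14 [FiniteDimensional ℂ W] {𝔊 : Submodule ℂ (Module.End ℂ W)}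
    (hbr : ∀ Y ∈ 𝔊, ∀ Z ∈ 𝔊, Y * Z - Z * Y ∈ 𝔊)
    (hirr : ∀ U : Submodule ℂ W, (∀ A ∈ 𝔊, ∀ u ∈ U, A u ∈ U) → U = ⊥ ∨ U = ⊤)
    {Θ : Module.End ℂ W} (hΘ : Θ ∈ 𝔊) (hΘΘ : Θ * Θ = 1)
    {P Q : Submodule ℂ W} (hP : ∀ x, x ∈ P ↔ Θ x = x) (hQ : ∀ x, x ∈ Q ↔ Θ x = -x)
    (hP34 : Module.finrank ℂ P = 34) (hQ49 : Module.finrank ℂ Q = 49)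
    {s : W → W → ℂ} (hadd : ∀ x y z, s (x + y) z = s x z + s y z)
    (hsmul : ∀ (c : ℂ) (x y : W), s (c • x) y = c * s x y) (hsymm : ∀ x y, s y x = starRingEnd ℂ (s x y))
    (hPQ : ∀ p ∈ P, ∀ q ∈ Q, s p q = 0) (hdefP : ∀ p ∈ P, s p p = 0 → p = 0) (hdefQ : ∀ q ∈ Q, s q q = 0 → q = 0)
    (hadj : ∀ X ∈ 𝔊, ∃ Y ∈ 𝔊, ∀ x y, s (X x) y = s x (Y y))
    (hS : ∀ B' ∈ 𝔊, Θ * B' = B' → B' * Θ = -B' →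
      Module.finrank ℂ (LinearMap.range B') = 0 ∨ Module.finrank ℂ (LinearMap.range B') = 14 ∨ Module.finrank ℂ (LinearMap.range B') = 15 ∨ Module.finrank ℂ (LinearMap.range B') = 16 ∨ Module.finrank ℂ (LinearMap.range B') = 17 ∨ Module.finrank ℂ (LinearMap.range B') = 18 ∨ Module.finrank ℂ (LinearMap.range B') = 19 ∨ Module.finrank ℂ (LinearMap.range B') = 20 ∨ Module.finrank ℂ (LinearMap.range B') = 21 ∨ Module.finrank ℂ (LinearMap.range B') = 22 ∨ Module.finrank ℂ (LinearMap.range B') = 23 ∨ Module.finrank ℂ (LinearMap.range B') = 24 ∨ Module.finrank ℂ (LinearMap.range B') = 25 ∨ Module.finrank ℂ (LinearMap.range B') = 26 ∨ Module.finrank ℂ (LinearMap.range B') = 27 ∨ Module.finrank ℂ (LinearMap.range B') = 28 ∨ Module.finrank ℂ (LinearMap.range B') = 29 ∨ Module.finrank ℂ (LinearMap.range B') = 30 ∨ Module.finrank ℂ (LinearMap.range B') = 31 ∨ Module.finrank ℂ (LinearMap.range B') = 32 ∨ Module.finrank ℂ (LinearMap.range B') = 33 ∨ Module.finrank ℂ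 (LinearMap.range B') = 34)
    {B : Module.End ℂ W} (hB : B ∈ 𝔊) (hΘB : Θ * B = B) (hBΘ : B * Θ = -B)
    (hr : Module.finrank ℂ (LinearMap.range B) = 14) : False := by
  classical
  have hsU : ∀ U : Submodule ℂ W, ∀ x y z : U, s ((x + y : U) : W) z = s (x : W) z + s (y : W) z :=
    fun U x y z => by simp only [Submodule.coe_add, hadd]
  have hsmU : ∀ U : Submodule ℂ W, ∀ (c : ℂ) (x y : U), s ((c • x : U) : W) y = c * s (x : W) y :=
    fun U c x y => by simp only [Submodule.coe_smul, hsmul]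
  have hno1 : ∀ B' ∈ 𝔊, Θ * B' = B' → B' * Θ = -B' → Module.finrank ℂ (LinearMap.range B') ≠ 1 := by
    intro B' hB' hΘB' hB'Θ h1
    rcases hS B' hB' hΘB' hB'Θ with h | h | h | h | h | h | h | h | h | h | h | h | h | h | h | h | h | h | h | h | h | h <;> omega
  have hmin : ∀ Y ∈ 𝔊, Θ * Y = Y → Y * Θ = -Y → Y ≠ 0 → 14 ≤ Module.finrank ℂ (LinearMap.range Y) := by
    intro Y hY hΘY hYΘ hY0
    have h0 : Module.finrank ℂ (LinearMap.range Y) ≠ 0 := fun h =>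
      hY0 (LinearMap.range_eq_bot.1 (Submodule.finrank_eq_zero.1 h))
    rcases hS Y hY hΘY hYΘ with h | h | h | h | h | h | h | h | h | h | h | h | h | h | h | h | h | h | h | h | h | h <;> omega
  have hmin' : ∀ Z ∈ 𝔊, Θ * Z = Z → Z * Θ = -Z → Z ≠ 0 → Module.finrank ℂ (LinearMap.range B) ≤ Module.finrank ℂ (LinearMap.range Z) := by
    rw [hr]; exact hmin
  obtain ⟨ι, Um, Up, PU, QU, Lm, ιm, Pm, Qm, Lp, ιp, Pp, Qp, hιmem, hιι, hιΘ, hιs, hUm, hUp, hfinUm, hfinUp,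
    hPM, hQM, hPU, hQU, hrangeP, hPUP, hQUQ, hfinQM, hfinPU, hfinQU, hLm, hLp,
    hιmapply, hPmmem, hQmmem, hbrLm, hirrLm, hιmmem, hιmιm, hPm, hQm, hfinPm, hfinQm, hPmQm, hdefPm, hdefQm, hadjLm,
    hιpapply, hPpmem, hQpmem, hbrLp, hirrLp, hιpmem, hιpιp, hPp, hQp, hfinPp, hfinQp, hPpQp, hdefPp, hdefQp, hadjLp,
    hsplit⟩ :=
    UnitaryLeviSetup.exists_levi_pair hbr hirr hΘ hΘΘ hP hQ hadd hsymm hPQ hdefP hdefQ hadj hB hΘB hBΘ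
  have hdich : ∀ X ∈ 𝔊, Θ * X = X → X * Θ = -X → X * ι = ι * X →
      Module.finrank ℂ (Up.map X) + Module.finrank ℂ (Um.map X) ≤ Module.finrank ℂ (LinearMap.range B) ∨
        (14 ≤ Module.finrank ℂ (Up.map X) ∧ 14 ≤ Module.finrank ℂ (Um.map X)) := fun X hX hΘX hXΘ hXc =>
    UnitaryLeviSetup.profile_dichotomy hbr hΘΘ hP hQ hadd hsymm hPQ hdefP hdefQ hadj hmin hB hΘB hBΘ hιι hιΘ hιs hUm hUp
      hPM hQM hQU hfinQU hrangeP hX hΘX hXΘ hXc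
  have hfinQU' := hfinQU
  rw [hr] at hfinQM hfinPU hfinQU hfinPm hfinQm hfinPp hfinQp hsplit hdich
  rw [hQ49] at hfinQM hfinQm hfinUm
  rw [hP34] at hfinPU hfinPp hfinUp
  have hcm : ∀ Z : Module.End ℂ W, Z * ι = ι * Z → ∀ x ∈ Um, Z x ∈ Um := fun Z hZ x hx =>
    (hUm _).2 (by rw [← Module.End.mul_apply, ← hZ, Module.End.mul_apply, (hUm x).1 hx, map_neg])
  have hcp : ∀ Z : Module.End ℂ W, Z * ι = ι * Z → ∀ x ∈ Up, Z x ∈ Up := fun Z hZ x hx =>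
    (hUp _).2 (by rw [← Module.End.mul_apply, ← hZ, Module.End.mul_apply, (hUp x).1 hx])
  have hfullm_of : Lm = ⊤ → False := fun h =>
    UnitaryLeviSetup.false_of_full_larger hbr hΘΘ hno1 hιι hιΘ hUm hUp (by omega) (by omega) hPM hQM (by omega)
      (by omega) hLm h
  have hkillm1 : ∀ X ∈ 𝔊, Θ * X = X → X * Θ = -X → X * ι = ι * X → Module.finrank ℂ (Um.map X) ≠ 1 := by
    intro X hX hΘX hXΘ hXc h1
    obtain ⟨hxmem, hιmx, hxιm, hxrk⟩ := UnitaryLeviSetup.restrict_mem hcm hLm hιmapply X hX hΘX hXΘ hXc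
    rw [h1] at hxrk
    exact hfullm_of (UnitaryRankOneRaise.eq_top_of_rankOne_raise hbrLm hirrLm hιmmem hιmιm hPm hQm
      (s := fun v w : Um => s (v : W) w) (hsU Um) (fun v w => hsymm v w) hPmQm hdefPm hdefQm hadjLm hxmem hιmx hxιm
      hxrk (by omega) (by omega) (by omega))
  have hkillm2 : ∀ X ∈ 𝔊, Θ * X = X → X * Θ = -X → X * ι = ι * X → Module.finrank ℂ (Um.map X) ≠ 2 := by
    intro X hX hΘX hXΘ hXc h2
    obtain ⟨hxmem, hιmx, hxιm, hxrk⟩ := UnitaryLeviSetup.restrict_mem hcm hLm hιmapply X hX hΘX hXΘ hXc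
    rw [h2] at hxrk
    refine hfullm_of (UnitaryDoubleLevi.eq_top_of_raise_of_core hbrLm hirrLm hιmmem hιmιm hPm hQm
      (s := fun v w : Um => s (v : W) w) (hsU Um) (fun v w => hsymm v w) hPmQm hdefPm hdefQm hadjLm hxmem hιmx hxιm
      (by rw [hxrk]; omega) (by omega) (by omega)
      fun U' 𝔩' ι' P' Q' hbr𝔩' hirr𝔩' hι' hι'ι' hP' hQ' hfinP' hfinQ' hP'Q' hdefP' hdefQ' hadj𝔩' => ?_)
    rw [hxrk] at hfinP' hfinQ'
    exact UnitaryTwoOdd.eq_top hbr𝔩' hirr𝔩' hι' hι'ι' hP' hQ' hfinP' ⟨16, by omega⟩ (s := fun x y : U' => s ((x : Um) : W) y) (fun x y z => by simp only [Submodule.coe_add, hadd]) (fun x y => hsymm _ _) hP'Q' hdefP' hdefQ' hadj𝔩'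
  have hkillm3 : ∀ X ∈ 𝔊, Θ * X = X → X * Θ = -X → X * ι = ι * X → Module.finrank ℂ (Um.map X) ≠ 3 := by
    intro X hX hΘX hXΘ hXc h3
    obtain ⟨hxmem, hιmx, hxιm, hxrk⟩ := UnitaryLeviSetup.restrict_mem hcm hLm hιmapply X hX hΘX hXΘ hXc
    rw [h3] at hxrk
    refine hfullm_of (UnitaryDoubleLevi.eq_top_of_raise_of_core hbrLm hirrLm hιmmem hιmιm hPm hQm
      (s := fun v w : Um => s (v : W) w) (hsU Um) (fun v w => hsymm v w) hPmQm hdefPm hdefQm hadjLm hxmem hιmx hxιm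
      (by rw [hxrk]; omega) (by omega) (by omega)
      fun U' 𝔩' ι' P' Q' hbr𝔩' hirr𝔩' hι' hι'ι' hP' hQ' hfinP' hfinQ' hP'Q' hdefP' hdefQ' hadj𝔩' => ?_)
    rw [hxrk] at hfinP' hfinQ'
    exact UnitaryThreeCoprime.eq_top hbr𝔩' hirr𝔩' hι' hι'ι' hP' hQ' hfinP' (by omega) (s := fun x y : U' => s ((x : Um) : W) y) (fun x y z => by simp only [Submodule.coe_add, hadd]) (fun x y => hsymm _ _) hP'Q' hdefP' hdefQ' hadj𝔩'
  have hkillm4 : ∀ X ∈ 𝔊, Θ * X = X → X * Θ = -X → X * ι = ι * X → Module.finrank ℂ (Um.map X) ≠ 4 := by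
    intro X hX hΘX hXΘ hXc h4
    obtain ⟨hxmem, hιmx, hxιm, hxrk⟩ := UnitaryLeviSetup.restrict_mem hcm hLm hιmapply X hX hΘX hXΘ hXc
    rw [h4] at hxrk
    refine hfullm_of (UnitaryDoubleLevi.eq_top_of_raise_of_core hbrLm hirrLm hιmmem hιmιm hPm hQm
      (s := fun v w : Um => s (v : W) w) (hsU Um) (fun v w => hsymm v w) hPmQm hdefPm hdefQm hadjLm hxmem hιmx hxιm
      (by rw [hxrk]; omega) (by omega) (by omega)
      fun U' 𝔩' ι' P' Q' hbr𝔩' hirr𝔩' hι' hι'ι' hP' hQ' hfinP' hfinQ' hP'Q' hdefP' hdefQ' hadj𝔩' => ?_)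
    rw [hxrk] at hfinP' hfinQ'
    exact UnitaryFourOdd.eq_top hbr𝔩' hirr𝔩' hι' hι'ι' hP' hQ' hfinP' ⟨15, by omega⟩ (s := fun x y : U' => s ((x : Um) : W) y) (fun x y z => by simp only [Submodule.coe_add, hadd]) (fun x y => hsymm _ _) hP'Q' hdefP' hdefQ' hadj𝔩'
  have hkillm6 : ∀ X ∈ 𝔊, Θ * X = X → X * Θ = -X → X * ι = ι * X → Module.finrank ℂ (Um.map X) ≠ 6 := by
    intro X hX hΘX hXΘ hXc h6
    obtain ⟨hxmem, hιmx, hxιm, hxrk⟩ := UnitaryLeviSetup.restrict_mem hcm hLm hιmapply X hX hΘX hXΘ hXc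
    rw [h6] at hxrk
    refine hfullm_of (UnitaryDoubleLevi.eq_top_of_raise_of_core hbrLm hirrLm hιmmem hιmιm hPm hQm
      (s := fun v w : Um => s (v : W) w) (hsU Um) (fun v w => hsymm v w) hPmQm hdefPm hdefQm hadjLm hxmem hιmx hxιm
      (by rw [hxrk]; omega) (by omega) (by omega)
      fun U' 𝔩' ι' P' Q' hbr𝔩' hirr𝔩' hι' hι'ι' hP' hQ' hfinP' hfinQ' hP'Q' hdefP' hdefQ' hadj𝔩' => ?_)
    rw [hxrk] at hfinP' hfinQ'
    exact UnitarySix.eq_top_of_smul hbr𝔩' hirr𝔩' hι' hι'ι' hP' hQ' hfinP' ⟨14, by omega⟩ (by omega) (s := fun x y : U' => s ((x : Um) : W) y) (fun x y z => by simp only [Submodule.coe_add, hadd]) (fun c x y => by simp only [Submodule.coe_smul, hsmul]) (fun x y => hsymm _ _) hP'Q' hdefP' hdefQ' hadj𝔩'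
  have hkillm11 : ∀ X ∈ 𝔊, Θ * X = X → X * Θ = -X → X * ι = ι * X → Module.finrank ℂ (Um.map X) ≠ 11 := by
    intro X hX hΘX hXΘ hXc h11
    obtain ⟨hxmem, hιmx, hxιm, hxrk⟩ := UnitaryLeviSetup.restrict_mem hcm hLm hιmapply X hX hΘX hXΘ hXc
    rw [h11] at hxrk
    refine hfullm_of (UnitaryDoubleLevi.eq_top_of_raise_of_core hbrLm hirrLm hιmmem hιmιm hPm hQm
      (s := fun v w : Um => s (v : W) w) (hsU Um) (fun v w => hsymm v w) hPmQm hdefPm hdefQm hadjLm hxmem hιmx hxιm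
      (by rw [hxrk]; omega) (by omega) (by omega)
      fun U' 𝔩' ι' P' Q' hbr𝔩' hirr𝔩' hι' hι'ι' hP' hQ' hfinP' hfinQ' hP'Q' hdefP' hdefQ' hadj𝔩' => ?_)
    rw [hxrk] at hfinP' hfinQ'
    exact UnitaryEleven.eq_top_of_smul hbr𝔩' hirr𝔩' hι' hι'ι' hP' hQ' hfinP' (by omega) (s := fun x y : U' => s ((x : Um) : W) y) (fun x y z => by simp only [Submodule.coe_add, hadd]) (fun c x y => by simp only [Submodule.coe_smul, hsmul]) (fun x y => hsymm _ _) hP'Q' hdefP' hdefQ' hadj𝔩'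
  have hkillm13 : ∀ X ∈ 𝔊, Θ * X = X → X * Θ = -X → X * ι = ι * X → Module.finrank ℂ (Um.map X) ≠ 13 := by
    intro X hX hΘX hXΘ hXc h13
    obtain ⟨hxmem, hιmx, hxιm, hxrk⟩ := UnitaryLeviSetup.restrict_mem hcm hLm hιmapply X hX hΘX hXΘ hXc
    rw [h13] at hxrk
    refine hfullm_of (UnitaryDoubleLevi.eq_top_of_raise_of_core hbrLm hirrLm hιmmem hιmιm hPm hQm
      (s := fun v w : Um => s (v : W) w) (hsU Um) (fun v w => hsymm v w) hPmQm hdefPm hdefQm hadjLm hxmem hιmx hxιm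
      (by rw [hxrk]; omega) (by omega) (by omega)
      fun U' 𝔩' ι' P' Q' hbr𝔩' hirr𝔩' hι' hι'ι' hP' hQ' hfinP' hfinQ' hP'Q' hdefP' hdefQ' hadj𝔩' => ?_)
    rw [hxrk] at hfinP' hfinQ'
    exact UnitaryThirteen.eq_top_of_smul hbr𝔩' hirr𝔩' hι' hι'ι' hP' hQ' hfinP' (by omega) (s := fun x y : U' => s ((x : Um) : W) y) (fun x y z => by simp only [Submodule.coe_add, hadd]) (fun c x y => by simp only [Submodule.coe_smul, hsmul]) (fun x y => hsymm _ _) hP'Q' hdefP' hdefQ' hadj𝔩'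
  have hfullp_of : Lp = ⊤ → False := by
    intro hLptop
    obtain ⟨T1, hιT1, hT1ι, hT1r⟩ := UnitaryRaisingSpace.exists_raise_finrank_range_eq hιpιp hPp hQp (k := 1)
      (by omega) (by omega)
    obtain ⟨X1, hX1, hΘX1, hX1Θ, hX1c, hX1Up⟩ := UnitaryLeviSetup.exists_lift hbr hΘ hΘΘ hcp hιΘ hLp hιpapply T1
      (by rw [hLptop]; exact Submodule.mem_top) hιT1 hT1ι
    rw [hT1r] at hX1Up
    obtain ⟨hs1, hi1, hi1', hj1, hj1'⟩ := hsplit X1 hΘX1 hX1Θ hX1c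
    have hrk1 := hS X1 hX1 hΘX1 hX1Θ
    have hd1 := hdich X1 hX1 hΘX1 hX1Θ hX1c
    rw [hs1] at hrk1
    rw [hX1Up] at hrk1 hd1
    have hk_hkillm13 := hkillm13 X1 hX1 hΘX1 hX1Θ hX1c
    omega
  have hkillp7 : ∀ X ∈ 𝔊, Θ * X = X → X * Θ = -X → X * ι = ι * X → Module.finrank ℂ (Up.map X) ≠ 7 := by
    intro X hX hΘX hXΘ hXc h7
    obtain ⟨hymem, hιpy, hyιp, hyrk⟩ := UnitaryLeviSetup.restrict_mem hcp hLp hιpapply X hX hΘX hXΘ hXc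
    rw [h7] at hyrk
    refine hfullp_of (UnitaryDoubleLevi.eq_top_of_raise_of_core' hbrLp hirrLp hιpmem hιpιp hPp hQp
      (s := fun v w : Up => s (v : W) w) (hsU Up) (fun v w => hsymm v w) hPpQp hdefPp hdefQp hadjLp hymem hιpy hyιp
      (by rw [hyrk]; omega) (by omega) (by omega)
      fun U' 𝔩' ι' P' Q' hbr𝔩' hirr𝔩' hι' hι'ι' hP' hQ' hfinP' hfinQ' hP'Q' hdefP' hdefQ' hadj𝔩' => ?_)
    rw [hyrk] at hfinP' hfinQ'
    exact UnitarySeven.eq_top_of_smul hbr𝔩' hirr𝔩' hι' hι'ι' hP' hQ' hfinP' (by omega) (s := fun x y : U' => s ((x : Up) : W) y) (fun x y z => by simp only [Submodule.coe_add, hadd]) (fun c x y => by simp only [Submodule.coe_smul, hsmul]) (fun x y => hsymm _ _) hP'Q' hdefP' hdefQ' hadj𝔩'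
  have hkillp9 : ∀ X ∈ 𝔊, Θ * X = X → X * Θ = -X → X * ι = ι * X → Module.finrank ℂ (Up.map X) ≠ 9 := by
    intro X hX hΘX hXΘ hXc h9
    obtain ⟨hymem, hιpy, hyιp, hyrk⟩ := UnitaryLeviSetup.restrict_mem hcp hLp hιpapply X hX hΘX hXΘ hXc
    rw [h9] at hyrk
    refine hfullp_of (UnitaryDoubleLevi.eq_top_of_raise_of_core' hbrLp hirrLp hιpmem hιpιp hPp hQp
      (s := fun v w : Up => s (v : W) w) (hsU Up) (fun v w => hsymm v w) hPpQp hdefPp hdefQp hadjLp hymem hιpy hyιp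
      (by rw [hyrk]; omega) (by omega) (by omega)
      fun U' 𝔩' ι' P' Q' hbr𝔩' hirr𝔩' hι' hι'ι' hP' hQ' hfinP' hfinQ' hP'Q' hdefP' hdefQ' hadj𝔩' => ?_)
    rw [hyrk] at hfinP' hfinQ'
    exact UnitaryEleven.eq_top_of_smul' hbr𝔩' hirr𝔩' hι' hι'ι' hP' hQ' (by omega) (by omega) (s := fun x y : U' => s ((x : Up) : W) y) (fun x y z => by simp only [Submodule.coe_add, hadd]) (fun c x y => by simp only [Submodule.coe_smul, hsmul]) (fun x y => hsymm _ _) hP'Q' hdefP' hdefQ' hadj𝔩'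
  have hprof : ∀ X ∈ 𝔊, Θ * X = X → X * Θ = -X → X * ι = ι * X →
      (Module.finrank ℂ (Up.map X) = 0 ∧ Module.finrank ℂ (Um.map X) = 0) ∨
        (Module.finrank ℂ (Up.map X) = 0 ∧ Module.finrank ℂ (Um.map X) = 14) ∨
        (Module.finrank ℂ (Up.map X) = 2 ∧ Module.finrank ℂ (Um.map X) = 12) ∨
        (Module.finrank ℂ (Up.map X) = 4 ∧ Module.finrank ℂ (Um.map X) = 10) ∨
        (Module.finrank ℂ (Up.map X) = 5 ∧ Module.finrank ℂ (Um.map X) = 9) ∨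
        (Module.finrank ℂ (Up.map X) = 6 ∧ Module.finrank ℂ (Um.map X) = 8) ∨
        (Module.finrank ℂ (Up.map X) = 14 ∧ Module.finrank ℂ (Um.map X) = 0) ∨
        (Module.finrank ℂ (Up.map X) = 14 ∧ Module.finrank ℂ (Um.map X) = 14) := by
    intro X hX hΘX hXΘ hXc
    obtain ⟨hs, hi, hi', hj, hj'⟩ := hsplit X hΘX hXΘ hXc
    have hkillm1' := hkillm1 X hX hΘX hXΘ hXc
    have hkillm2' := hkillm2 X hX hΘX hXΘ hXc
    have hkillm3' := hkillm3 X hX hΘX hXΘ hXc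
    have hkillm4' := hkillm4 X hX hΘX hXΘ hXc
    have hkillm6' := hkillm6 X hX hΘX hXΘ hXc
    have hkillm11' := hkillm11 X hX hΘX hXΘ hXc
    have hkillm13' := hkillm13 X hX hΘX hXΘ hXc
    have hkillp7' := hkillp7 X hX hΘX hXΘ hXc
    have hkillp9' := hkillp9 X hX hΘX hXΘ hXc
    have hrk := hS X hX hΘX hXΘ
    have hd := hdich X hX hΘX hXΘ hXc
    rw [hs] at hrk
    generalize Module.finrank ℂ ↥(Submodule.map X Um) = jj at *
    have hjle : jj ≤ 14 := by omega
    interval_cases jj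
    · rcases (show Module.finrank ℂ (Up.map X) = 0 ∨ Module.finrank ℂ (Up.map X) = 14 by omega) with h | h
      · exact Or.inl ⟨h, rfl⟩
      · exact Or.inr (Or.inr (Or.inr (Or.inr (Or.inr (Or.inr (Or.inl ⟨h, rfl⟩))))))
    · exact (hkillm1' rfl).elim
    · exact (hkillm2' rfl).elim
    · exact (hkillm3' rfl).elim
    · exact (hkillm4' rfl).elim
    · exfalso; omega
    · exact (hkillm6' rfl).elim
    · exfalso; omega
    · exact Or.inr (Or.inr (Or.inr (Or.inr (Or.inr (Or.inl ⟨by omega, rfl⟩)))))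
    · exact Or.inr (Or.inr (Or.inr (Or.inr (Or.inl ⟨by omega, rfl⟩))))
    · exact Or.inr (Or.inr (Or.inr (Or.inl ⟨by omega, rfl⟩)))
    · exact (hkillm11' rfl).elim
    · exact Or.inr (Or.inr (Or.inl ⟨by omega, rfl⟩))
    · exact (hkillm13' rfl).elim
    · rcases (show Module.finrank ℂ (Up.map X) = 0 ∨ Module.finrank ℂ (Up.map X) = 14 by omega) with h | h
      · exact Or.inr (Or.inl ⟨h, rfl⟩)
      · exact Or.inr (Or.inr (Or.inr (Or.inr (Or.inr (Or.inr (Or.inr (⟨h, rfl⟩)))))))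
  obtain ⟨⟨pm₀, hpm₀⟩, hpm₀0⟩ := Module.finrank_pos_iff_exists_ne_zero.1
    (show 0 < Module.finrank ℂ (LinearMap.range B) by omega)
  obtain ⟨⟨qm₀, hqm₀⟩, hqm₀0⟩ := Module.finrank_pos_iff_exists_ne_zero.1
    (show 0 < Module.finrank ℂ ↥(Q ⊓ LinearMap.ker B) by omega)
  obtain ⟨X₁, hX₁, hΘX₁, hX₁Θ, hX₁c, c₁, hιc₁, -, hX₁c0⟩ :=
    UnitaryLeviFull.exists_raise_commute_apply_ne_zero_lower hbr hirr hΘ hΘΘ hQ hιmem hιι hιΘ hUm hUp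
      ⟨pm₀, fun h => hpm₀0 (Subtype.ext h), ((hPM pm₀).1 hpm₀).1, ((hPM pm₀).1 hpm₀).2⟩
      ⟨qm₀, fun h => hqm₀0 (Subtype.ext h), ((hQM qm₀).1 hqm₀).1, ((hQM qm₀).1 hqm₀).2⟩
  have hX₁j : Module.finrank ℂ (Um.map X₁) ≠ 0 := fun h0 => by
    have hmem : X₁ c₁ ∈ Um.map X₁ := Submodule.mem_map_of_mem ((hUm c₁).2 hιc₁)
    rw [Submodule.finrank_eq_zero.1 h0, Submodule.mem_bot] at hmem
    exact hX₁c0 hmem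
  -- the raising ranks of `L⁻` lie in {0, 8, 9, 10, 12, 14}
  have hSsub : ∀ A ∈ Lm, ιm * A = A → A * ιm = -A → Module.finrank ℂ (LinearMap.range A) = 0 ∨ Module.finrank ℂ (LinearMap.range A) = 8 ∨ Module.finrank ℂ (LinearMap.range A) = 9 ∨ Module.finrank ℂ (LinearMap.range A) = 10 ∨ Module.finrank ℂ (LinearMap.range A) = 12 ∨ Module.finrank ℂ (LinearMap.range A) = 14 := by
    intro A hA hιA hAι
    by_cases hA0 : A = 0
    · exact Or.inl (by rw [hA0, LinearMap.range_zero, finrank_bot])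
    · obtain ⟨XA, hXA, hΘXA, hXAΘ, hXAc, hXAU⟩ := UnitaryLeviSetup.exists_lift hbr hΘ hΘΘ hcm hιΘ hLm hιmapply A hA hιA hAι
      have hA0' : Module.finrank ℂ (LinearMap.range A) ≠ 0 := fun h =>
        hA0 (LinearMap.range_eq_bot.1 (Submodule.finrank_eq_zero.1 h))
      have hpA := hprof XA hXA hΘXA hXAΘ hXAc
      rw [← hXAU] at hA0' ⊢
      omega
  obtain ⟨hymem, hιy, hyι, hyrk⟩ := UnitaryLeviSetup.restrict_mem hcm hLm hιmapply X₁ hX₁ hΘX₁ hX₁Θ hX₁c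
  obtain ⟨A₀, hA₀, hιA₀, hA₀ι, hA₀0, hA₀min⟩ := UnitaryRaisingSpace.exists_minRank_raise Lm ιm
    ⟨_, hymem, hιy, hyι, fun h => by rw [h, LinearMap.range_zero, finrank_bot] at hyrk; omega⟩
  have hr0 : Module.finrank ℂ (LinearMap.range A₀) ≠ 0 := fun h =>
    hA₀0 (LinearMap.range_eq_bot.1 (Submodule.finrank_eq_zero.1 h))
  rcases hSsub A₀ hA₀ hιA₀ hA₀ι with hrA | hrA | hrA | hrA | hrA | hrA
  · exact hr0 hrA
  · refine UnitaryThirtyFourFortyNine.subFourteenThirtyFive_ranks8_9_10_12_14_min8 hbrLm hirrLm hιmmem hιmιm hPm hQm (by omega) (by omega)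
      (s := fun v w : Um => s (v : W) w) (hsU Um) (hsmU Um) (fun v w => hsymm v w) hPmQm hdefPm hdefQm hadjLm
      (fun A hA hιA hAι => ?_) hA₀ hιA₀ hA₀ι hrA
    have h1 := hSsub A hA hιA hAι
    by_cases hA0 : A = 0
    · exact Or.inl (by rw [hA0, LinearMap.range_zero, finrank_bot])
    · have h2 := hA₀min A hA hιA hAι hA0
      omega
  · refine UnitaryThirtyFourFortyNine.subFourteenThirtyFive_ranks9_10_12_14_min9 hbrLm hirrLm hιmmem hιmιm hPm hQm (by omega) (by omega)
      (s := fun v w : Um => s (v : W) w) (hsU Um) (hsmU Um) (fun v w => hsymm v w) hPmQm hdefPm hdefQm hadjLm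
      (fun A hA hιA hAι => ?_) hA₀ hιA₀ hA₀ι hrA
    have h1 := hSsub A hA hιA hAι
    by_cases hA0 : A = 0
    · exact Or.inl (by rw [hA0, LinearMap.range_zero, finrank_bot])
    · have h2 := hA₀min A hA hιA hAι hA0
      omega
  · refine UnitaryThirtyFortyNine.subFourteenThirtyFive_ranks10_12_14_min10 hbrLm hirrLm hιmmem hιmιm hPm hQm (by omega) (by omega)
      (s := fun v w : Um => s (v : W) w) (hsU Um) (hsmU Um) (fun v w => hsymm v w) hPmQm hdefPm hdefQm hadjLm
      (fun A hA hιA hAι => ?_) hA₀ hιA₀ hA₀ι hrA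
    have h1 := hSsub A hA hιA hAι
    by_cases hA0 : A = 0
    · exact Or.inl (by rw [hA0, LinearMap.range_zero, finrank_bot])
    · have h2 := hA₀min A hA hιA hAι hA0
      omega
  · refine UnitaryThirtyFortyNine.subFourteenThirtyFive_ranks12_14_min12 hbrLm hirrLm hιmmem hιmιm hPm hQm (by omega) (by omega)
      (s := fun v w : Um => s (v : W) w) (hsU Um) (hsmU Um) (fun v w => hsymm v w) hPmQm hdefPm hdefQm hadjLm
      (fun A hA hιA hAι => ?_) hA₀ hιA₀ hA₀ι hrA
    have h1 := hSsub A hA hιA hAι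
    by_cases hA0 : A = 0
    · exact Or.inl (by rw [hA0, LinearMap.range_zero, finrank_bot])
    · have h2 := hA₀min A hA hιA hAι hA0
      omega
  · refine UnitaryThirtyFortyNine.subFourteenThirtyFive_rank14 hbrLm hirrLm hιmmem hιmιm hPm hQm (by omega) (by omega)
      (s := fun v w : Um => s (v : W) w) (hsU Um) (hsmU Um) (fun v w => hsymm v w) hPmQm hdefPm hdefQm hadjLm
      (fun A hA hιA hAι => ?_) hA₀ hιA₀ hA₀ι hrA
    have h1 := hSsub A hA hιA hAι
    by_cases hA0 : A = 0
    · exact Or.inl (by rw [hA0, LinearMap.range_zero, finrank_bot])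
    · have h2 := hA₀min A hA hιA hAι hA0
      omega

/-- `(34 | 49)`, minimal rank `15`: after the Levi kills every profile has `i = 0` (profiles [(0, 0), (0, 15)]), against the non-vanishing lemma. [cite: Ribet1983, Thm. 3] [cite: Gordon1997, Thm. 6.3 (3)]
[cite: Deligne1982HodgeCycles, I §3 Prop. 3.4, 3.6] [cite: GoodmanWallachGTM255, §4.1.1] -/
theorem UnitaryThirtyFourFortyNine.no_minRank_15 [FiniteDimensional ℂ W] {𝔊 : Submodule ℂ (Module.End ℂ W)}
    (hbr : ∀ Y ∈ 𝔊, ∀ Z ∈ 𝔊, Y * Z - Z * Y ∈ 𝔊)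
    (hirr : ∀ U : Submodule ℂ W, (∀ A ∈ 𝔊, ∀ u ∈ U, A u ∈ U) → U = ⊥ ∨ U = ⊤)
    {Θ : Module.End ℂ W} (hΘ : Θ ∈ 𝔊) (hΘΘ : Θ * Θ = 1)
    {P Q : Submodule ℂ W} (hP : ∀ x, x ∈ P ↔ Θ x = x) (hQ : ∀ x, x ∈ Q ↔ Θ x = -x)
    (hP34 : Module.finrank ℂ P = 34) (hQ49 : Module.finrank ℂ Q = 49)
    {s : W → W → ℂ} (hadd : ∀ x y z, s (x + y) z = s x z + s y z)
    (hsmul : ∀ (c : ℂ) (x y : W), s (c • x) y = c * s x y) (hsymm : ∀ x y, s y x = starRingEnd ℂ (s x y))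
    (hPQ : ∀ p ∈ P, ∀ q ∈ Q, s p q = 0) (hdefP : ∀ p ∈ P, s p p = 0 → p = 0) (hdefQ : ∀ q ∈ Q, s q q = 0 → q = 0)
    (hadj : ∀ X ∈ 𝔊, ∃ Y ∈ 𝔊, ∀ x y, s (X x) y = s x (Y y))
    (hS : ∀ B' ∈ 𝔊, Θ * B' = B' → B' * Θ = -B' →
      Module.finrank ℂ (LinearMap.range B') = 0 ∨ Module.finrank ℂ (LinearMap.range B') = 15 ∨ Module.finrank ℂ (LinearMap.range B') = 16 ∨ Module.finrank ℂ (LinearMap.range B') = 17 ∨ Module.finrank ℂ (LinearMap.range B') = 18 ∨ Module.finrank ℂ (LinearMap.range B') = 19 ∨ Module.finrank ℂ (LinearMap.range B') = 20 ∨ Module.finrank ℂ (LinearMap.range B') = 21 ∨ Module.finrank ℂ (LinearMap.range B') = 22 ∨ Module.finrank ℂ (LinearMap.range B') = 23 ∨ Module.finrank ℂ (LinearMap.range B') = 24 ∨ Module.finrank ℂ (LinearMap.range B') = 25 ∨ Module.finrank ℂ (LinearMap.range B') = 26 ∨ Module.finrank ℂ (LinearMap.range B') = 27 ∨ Module.finrank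 ℂ (LinearMap.range B') = 28 ∨ Module.finrank ℂ (LinearMap.range B') = 29 ∨ Module.finrank ℂ (LinearMap.range B') = 30 ∨ Module.finrank ℂ (LinearMap.range B') = 31 ∨ Module.finrank ℂ (LinearMap.range B') = 32 ∨ Module.finrank ℂ (LinearMap.range B') = 33 ∨ Module.finrank ℂ (LinearMap.range B') = 34)
    {B : Module.End ℂ W} (hB : B ∈ 𝔊) (hΘB : Θ * B = B) (hBΘ : B * Θ = -B)
    (hr : Module.finrank ℂ (LinearMap.range B) = 15) : False := by
  classical
  have hsU : ∀ U : Submodule ℂ W, ∀ x y z : U, s ((x + y : U) : W) z = s (x : W) z + s (y : W) z :=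
    fun U x y z => by simp only [Submodule.coe_add, hadd]
  have hsmU : ∀ U : Submodule ℂ W, ∀ (c : ℂ) (x y : U), s ((c • x : U) : W) y = c * s (x : W) y :=
    fun U c x y => by simp only [Submodule.coe_smul, hsmul]
  have hno1 : ∀ B' ∈ 𝔊, Θ * B' = B' → B' * Θ = -B' → Module.finrank ℂ (LinearMap.range B') ≠ 1 := by
    intro B' hB' hΘB' hB'Θ h1
    rcases hS B' hB' hΘB' hB'Θ with h | h | h | h | h | h | h | h | h | h | h | h | h | h | h | h | h | h | h | h | h <;> omega
  have hmin : ∀ Y ∈ 𝔊, Θ * Y = Y → Y * Θ = -Y → Y ≠ 0 → 15 ≤ Module.finrank ℂ (LinearMap.range Y) := by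
    intro Y hY hΘY hYΘ hY0
    have h0 : Module.finrank ℂ (LinearMap.range Y) ≠ 0 := fun h =>
      hY0 (LinearMap.range_eq_bot.1 (Submodule.finrank_eq_zero.1 h))
    rcases hS Y hY hΘY hYΘ with h | h | h | h | h | h | h | h | h | h | h | h | h | h | h | h | h | h | h | h | h <;> omega
  have hmin' : ∀ Z ∈ 𝔊, Θ * Z = Z → Z * Θ = -Z → Z ≠ 0 → Module.finrank ℂ (LinearMap.range B) ≤ Module.finrank ℂ (LinearMap.range Z) := by
    rw [hr]; exact hmin
  obtain ⟨ι, Um, Up, PU, QU, Lm, ιm, Pm, Qm, Lp, ιp, Pp, Qp, hιmem, hιι, hιΘ, hιs, hUm, hUp, hfinUm, hfinUp,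
    hPM, hQM, hPU, hQU, hrangeP, hPUP, hQUQ, hfinQM, hfinPU, hfinQU, hLm, hLp,
    hιmapply, hPmmem, hQmmem, hbrLm, hirrLm, hιmmem, hιmιm, hPm, hQm, hfinPm, hfinQm, hPmQm, hdefPm, hdefQm, hadjLm,
    hιpapply, hPpmem, hQpmem, hbrLp, hirrLp, hιpmem, hιpιp, hPp, hQp, hfinPp, hfinQp, hPpQp, hdefPp, hdefQp, hadjLp,
    hsplit⟩ :=
    UnitaryLeviSetup.exists_levi_pair hbr hirr hΘ hΘΘ hP hQ hadd hsymm hPQ hdefP hdefQ hadj hB hΘB hBΘ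
  have hdich : ∀ X ∈ 𝔊, Θ * X = X → X * Θ = -X → X * ι = ι * X →
      Module.finrank ℂ (Up.map X) + Module.finrank ℂ (Um.map X) ≤ Module.finrank ℂ (LinearMap.range B) ∨
        (15 ≤ Module.finrank ℂ (Up.map X) ∧ 15 ≤ Module.finrank ℂ (Um.map X)) := fun X hX hΘX hXΘ hXc =>
    UnitaryLeviSetup.profile_dichotomy hbr hΘΘ hP hQ hadd hsymm hPQ hdefP hdefQ hadj hmin hB hΘB hBΘ hιι hιΘ hιs hUm hUp
      hPM hQM hQU hfinQU hrangeP hX hΘX hXΘ hXc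
  have hfinQU' := hfinQU
  rw [hr] at hfinQM hfinPU hfinQU hfinPm hfinQm hfinPp hfinQp hsplit hdich
  rw [hQ49] at hfinQM hfinQm hfinUm
  rw [hP34] at hfinPU hfinPp hfinUp
  have hcm : ∀ Z : Module.End ℂ W, Z * ι = ι * Z → ∀ x ∈ Um, Z x ∈ Um := fun Z hZ x hx =>
    (hUm _).2 (by rw [← Module.End.mul_apply, ← hZ, Module.End.mul_apply, (hUm x).1 hx, map_neg])
  have hcp : ∀ Z : Module.End ℂ W, Z * ι = ι * Z → ∀ x ∈ Up, Z x ∈ Up := fun Z hZ x hx =>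
    (hUp _).2 (by rw [← Module.End.mul_apply, ← hZ, Module.End.mul_apply, (hUp x).1 hx])
  have hfullm_of : Lm = ⊤ → False := fun h =>
    UnitaryLeviSetup.false_of_full_larger hbr hΘΘ hno1 hιι hιΘ hUm hUp (by omega) (by omega) hPM hQM (by omega)
      (by omega) hLm h
  have hkillm1 : ∀ X ∈ 𝔊, Θ * X = X → X * Θ = -X → X * ι = ι * X → Module.finrank ℂ (Um.map X) ≠ 1 := by
    intro X hX hΘX hXΘ hXc h1
    obtain ⟨hxmem, hιmx, hxιm, hxrk⟩ := UnitaryLeviSetup.restrict_mem hcm hLm hιmapply X hX hΘX hXΘ hXc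
    rw [h1] at hxrk
    exact hfullm_of (UnitaryRankOneRaise.eq_top_of_rankOne_raise hbrLm hirrLm hιmmem hιmιm hPm hQm
      (s := fun v w : Um => s (v : W) w) (hsU Um) (fun v w => hsymm v w) hPmQm hdefPm hdefQm hadjLm hxmem hιmx hxιm
      hxrk (by omega) (by omega) (by omega))
  have hkillm3 : ∀ X ∈ 𝔊, Θ * X = X → X * Θ = -X → X * ι = ι * X → Module.finrank ℂ (Um.map X) ≠ 3 := by
    intro X hX hΘX hXΘ hXc h3
    obtain ⟨hxmem, hιmx, hxιm, hxrk⟩ := UnitaryLeviSetup.restrict_mem hcm hLm hιmapply X hX hΘX hXΘ hXc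
    rw [h3] at hxrk
    refine hfullm_of (UnitaryDoubleLevi.eq_top_of_raise_of_core hbrLm hirrLm hιmmem hιmιm hPm hQm
      (s := fun v w : Um => s (v : W) w) (hsU Um) (fun v w => hsymm v w) hPmQm hdefPm hdefQm hadjLm hxmem hιmx hxιm
      (by rw [hxrk]; omega) (by omega) (by omega)
      fun U' 𝔩' ι' P' Q' hbr𝔩' hirr𝔩' hι' hι'ι' hP' hQ' hfinP' hfinQ' hP'Q' hdefP' hdefQ' hadj𝔩' => ?_)
    rw [hxrk] at hfinP' hfinQ'
    exact UnitaryThreeCoprime.eq_top hbr𝔩' hirr𝔩' hι' hι'ι' hP' hQ' hfinP' (by omega) (s := fun x y : U' => s ((x : Um) : W) y) (fun x y z => by simp only [Submodule.coe_add, hadd]) (fun x y => hsymm _ _) hP'Q' hdefP' hdefQ' hadj𝔩'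
  have hkillm5 : ∀ X ∈ 𝔊, Θ * X = X → X * Θ = -X → X * ι = ι * X → Module.finrank ℂ (Um.map X) ≠ 5 := by
    intro X hX hΘX hXΘ hXc h5
    obtain ⟨hxmem, hιmx, hxιm, hxrk⟩ := UnitaryLeviSetup.restrict_mem hcm hLm hιmapply X hX hΘX hXΘ hXc
    rw [h5] at hxrk
    refine hfullm_of (UnitaryDoubleLevi.eq_top_of_raise_of_core hbrLm hirrLm hιmmem hιmιm hPm hQm
      (s := fun v w : Um => s (v : W) w) (hsU Um) (fun v w => hsymm v w) hPmQm hdefPm hdefQm hadjLm hxmem hιmx hxιm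
      (by rw [hxrk]; omega) (by omega) (by omega)
      fun U' 𝔩' ι' P' Q' hbr𝔩' hirr𝔩' hι' hι'ι' hP' hQ' hfinP' hfinQ' hP'Q' hdefP' hdefQ' hadj𝔩' => ?_)
    rw [hxrk] at hfinP' hfinQ'
    exact UnitaryFive.eq_top_of_smul hbr𝔩' hirr𝔩' hι' hι'ι' hP' hQ' hfinP' (by omega) (s := fun x y : U' => s ((x : Um) : W) y) (fun x y z => by simp only [Submodule.coe_add, hadd]) (fun c x y => by simp only [Submodule.coe_smul, hsmul]) (fun x y => hsymm _ _) hP'Q' hdefP' hdefQ' hadj𝔩'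
  have hkillm7 : ∀ X ∈ 𝔊, Θ * X = X → X * Θ = -X → X * ι = ι * X → Module.finrank ℂ (Um.map X) ≠ 7 := by
    intro X hX hΘX hXΘ hXc h7
    obtain ⟨hxmem, hιmx, hxιm, hxrk⟩ := UnitaryLeviSetup.restrict_mem hcm hLm hιmapply X hX hΘX hXΘ hXc
    rw [h7] at hxrk
    refine hfullm_of (UnitaryDoubleLevi.eq_top_of_raise_of_core hbrLm hirrLm hιmmem hιmιm hPm hQm
      (s := fun v w : Um => s (v : W) w) (hsU Um) (fun v w => hsymm v w) hPmQm hdefPm hdefQm hadjLm hxmem hιmx hxιm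
      (by rw [hxrk]; omega) (by omega) (by omega)
      fun U' 𝔩' ι' P' Q' hbr𝔩' hirr𝔩' hι' hι'ι' hP' hQ' hfinP' hfinQ' hP'Q' hdefP' hdefQ' hadj𝔩' => ?_)
    rw [hxrk] at hfinP' hfinQ'
    exact UnitarySeven.eq_top_of_smul hbr𝔩' hirr𝔩' hι' hι'ι' hP' hQ' hfinP' (by omega) (s := fun x y : U' => s ((x : Um) : W) y) (fun x y z => by simp only [Submodule.coe_add, hadd]) (fun c x y => by simp only [Submodule.coe_smul, hsmul]) (fun x y => hsymm _ _) hP'Q' hdefP' hdefQ' hadj𝔩'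
  have hkillm11 : ∀ X ∈ 𝔊, Θ * X = X → X * Θ = -X → X * ι = ι * X → Module.finrank ℂ (Um.map X) ≠ 11 := by
    intro X hX hΘX hXΘ hXc h11
    obtain ⟨hxmem, hιmx, hxιm, hxrk⟩ := UnitaryLeviSetup.restrict_mem hcm hLm hιmapply X hX hΘX hXΘ hXc
    rw [h11] at hxrk
    refine hfullm_of (UnitaryDoubleLevi.eq_top_of_raise_of_core hbrLm hirrLm hιmmem hιmιm hPm hQm
      (s := fun v w : Um => s (v : W) w) (hsU Um) (fun v w => hsymm v w) hPmQm hdefPm hdefQm hadjLm hxmem hιmx hxιm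
      (by rw [hxrk]; omega) (by omega) (by omega)
      fun U' 𝔩' ι' P' Q' hbr𝔩' hirr𝔩' hι' hι'ι' hP' hQ' hfinP' hfinQ' hP'Q' hdefP' hdefQ' hadj𝔩' => ?_)
    rw [hxrk] at hfinP' hfinQ'
    exact UnitaryEleven.eq_top_of_smul hbr𝔩' hirr𝔩' hι' hι'ι' hP' hQ' hfinP' (by omega) (s := fun x y : U' => s ((x : Um) : W) y) (fun x y z => by simp only [Submodule.coe_add, hadd]) (fun c x y => by simp only [Submodule.coe_smul, hsmul]) (fun x y => hsymm _ _) hP'Q' hdefP' hdefQ' hadj𝔩'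
  have hkillm13 : ∀ X ∈ 𝔊, Θ * X = X → X * Θ = -X → X * ι = ι * X → Module.finrank ℂ (Um.map X) ≠ 13 := by
    intro X hX hΘX hXΘ hXc h13
    obtain ⟨hxmem, hιmx, hxιm, hxrk⟩ := UnitaryLeviSetup.restrict_mem hcm hLm hιmapply X hX hΘX hXΘ hXc
    rw [h13] at hxrk
    refine hfullm_of (UnitaryDoubleLevi.eq_top_of_raise_of_core hbrLm hirrLm hιmmem hιmιm hPm hQm
      (s := fun v w : Um => s (v : W) w) (hsU Um) (fun v w => hsymm v w) hPmQm hdefPm hdefQm hadjLm hxmem hιmx hxιm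
      (by rw [hxrk]; omega) (by omega) (by omega)
      fun U' 𝔩' ι' P' Q' hbr𝔩' hirr𝔩' hι' hι'ι' hP' hQ' hfinP' hfinQ' hP'Q' hdefP' hdefQ' hadj𝔩' => ?_)
    rw [hxrk] at hfinP' hfinQ'
    exact UnitaryThirteen.eq_top_of_smul hbr𝔩' hirr𝔩' hι' hι'ι' hP' hQ' hfinP' (by omega) (s := fun x y : U' => s ((x : Um) : W) y) (fun x y z => by simp only [Submodule.coe_add, hadd]) (fun c x y => by simp only [Submodule.coe_smul, hsmul]) (fun x y => hsymm _ _) hP'Q' hdefP' hdefQ' hadj𝔩'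
  have hfullp_of : Lp = ⊤ → False := by
    intro hLptop
    obtain ⟨T2, hιT2, hT2ι, hT2r⟩ := UnitaryRaisingSpace.exists_raise_finrank_range_eq hιpιp hPp hQp (k := 2)
      (by omega) (by omega)
    obtain ⟨X2, hX2, hΘX2, hX2Θ, hX2c, hX2Up⟩ := UnitaryLeviSetup.exists_lift hbr hΘ hΘΘ hcp hιΘ hLp hιpapply T2
      (by rw [hLptop]; exact Submodule.mem_top) hιT2 hT2ι
    rw [hT2r] at hX2Up
    obtain ⟨hs2, hi2, hi2', hj2, hj2'⟩ := hsplit X2 hΘX2 hX2Θ hX2c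
    have hrk2 := hS X2 hX2 hΘX2 hX2Θ
    have hd2 := hdich X2 hX2 hΘX2 hX2Θ hX2c
    rw [hs2] at hrk2
    rw [hX2Up] at hrk2 hd2
    have hk_hkillm13 := hkillm13 X2 hX2 hΘX2 hX2Θ hX2c
    omega
  have hkillp1 : ∀ X ∈ 𝔊, Θ * X = X → X * Θ = -X → X * ι = ι * X → Module.finrank ℂ (Up.map X) ≠ 1 := by
    intro X hX hΘX hXΘ hXc h1
    obtain ⟨hymem, hιpy, hyιp, hyrk⟩ := UnitaryLeviSetup.restrict_mem hcp hLp hιpapply X hX hΘX hXΘ hXc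
    rw [h1] at hyrk
    exact hfullp_of (UnitaryRankOneRaise.eq_top_of_rankOne_raise hbrLp hirrLp hιpmem hιpιp hPp hQp
      (s := fun v w : Up => s (v : W) w) (hsU Up) (fun v w => hsymm v w) hPpQp hdefPp hdefQp hadjLp hymem hιpy hyιp
      hyrk (by omega) (by omega) (by omega))
  have hkillp3 : ∀ X ∈ 𝔊, Θ * X = X → X * Θ = -X → X * ι = ι * X → Module.finrank ℂ (Up.map X) ≠ 3 := by
    intro X hX hΘX hXΘ hXc h3
    obtain ⟨hymem, hιpy, hyιp, hyrk⟩ := UnitaryLeviSetup.restrict_mem hcp hLp hιpapply X hX hΘX hXΘ hXc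
    rw [h3] at hyrk
    refine hfullp_of (UnitaryDoubleLevi.eq_top_of_raise_of_core' hbrLp hirrLp hιpmem hιpιp hPp hQp
      (s := fun v w : Up => s (v : W) w) (hsU Up) (fun v w => hsymm v w) hPpQp hdefPp hdefQp hadjLp hymem hιpy hyιp
      (by rw [hyrk]; omega) (by omega) (by omega)
      fun U' 𝔩' ι' P' Q' hbr𝔩' hirr𝔩' hι' hι'ι' hP' hQ' hfinP' hfinQ' hP'Q' hdefP' hdefQ' hadj𝔩' => ?_)
    rw [hyrk] at hfinP' hfinQ'
    exact UnitaryThreeCoprime.eq_top hbr𝔩' hirr𝔩' hι' hι'ι' hP' hQ' hfinP' (by omega) (s := fun x y : U' => s ((x : Up) : W) y) (fun x y z => by simp only [Submodule.coe_add, hadd]) (fun x y => hsymm _ _) hP'Q' hdefP' hdefQ' hadj𝔩'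
  have hkillp5 : ∀ X ∈ 𝔊, Θ * X = X → X * Θ = -X → X * ι = ι * X → Module.finrank ℂ (Up.map X) ≠ 5 := by
    intro X hX hΘX hXΘ hXc h5
    obtain ⟨hymem, hιpy, hyιp, hyrk⟩ := UnitaryLeviSetup.restrict_mem hcp hLp hιpapply X hX hΘX hXΘ hXc
    rw [h5] at hyrk
    refine hfullp_of (UnitaryDoubleLevi.eq_top_of_raise_of_core' hbrLp hirrLp hιpmem hιpιp hPp hQp
      (s := fun v w : Up => s (v : W) w) (hsU Up) (fun v w => hsymm v w) hPpQp hdefPp hdefQp hadjLp hymem hιpy hyιp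
      (by rw [hyrk]; omega) (by omega) (by omega)
      fun U' 𝔩' ι' P' Q' hbr𝔩' hirr𝔩' hι' hι'ι' hP' hQ' hfinP' hfinQ' hP'Q' hdefP' hdefQ' hadj𝔩' => ?_)
    rw [hyrk] at hfinP' hfinQ'
    exact UnitaryFive.eq_top_of_smul hbr𝔩' hirr𝔩' hι' hι'ι' hP' hQ' hfinP' (by omega) (s := fun x y : U' => s ((x : Up) : W) y) (fun x y z => by simp only [Submodule.coe_add, hadd]) (fun c x y => by simp only [Submodule.coe_smul, hsmul]) (fun x y => hsymm _ _) hP'Q' hdefP' hdefQ' hadj𝔩'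
  have hkillp6 : ∀ X ∈ 𝔊, Θ * X = X → X * Θ = -X → X * ι = ι * X → Module.finrank ℂ (Up.map X) ≠ 6 := by
    intro X hX hΘX hXΘ hXc h6
    obtain ⟨hymem, hιpy, hyιp, hyrk⟩ := UnitaryLeviSetup.restrict_mem hcp hLp hιpapply X hX hΘX hXΘ hXc
    rw [h6] at hyrk
    refine hfullp_of (UnitaryDoubleLevi.eq_top_of_raise_of_core' hbrLp hirrLp hιpmem hιpιp hPp hQp
      (s := fun v w : Up => s (v : W) w) (hsU Up) (fun v w => hsymm v w) hPpQp hdefPp hdefQp hadjLp hymem hιpy hyιp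
      (by rw [hyrk]; omega) (by omega) (by omega)
      fun U' 𝔩' ι' P' Q' hbr𝔩' hirr𝔩' hι' hι'ι' hP' hQ' hfinP' hfinQ' hP'Q' hdefP' hdefQ' hadj𝔩' => ?_)
    rw [hyrk] at hfinP' hfinQ'
    exact UnitarySix.eq_top_of_smul hbr𝔩' hirr𝔩' hι' hι'ι' hP' hQ' hfinP' ⟨6, by omega⟩ (by omega) (s := fun x y : U' => s ((x : Up) : W) y) (fun x y z => by simp only [Submodule.coe_add, hadd]) (fun c x y => by simp only [Submodule.coe_smul, hsmul]) (fun x y => hsymm _ _) hP'Q' hdefP' hdefQ' hadj𝔩'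
  have hkillp7 : ∀ X ∈ 𝔊, Θ * X = X → X * Θ = -X → X * ι = ι * X → Module.finrank ℂ (Up.map X) ≠ 7 := by
    intro X hX hΘX hXΘ hXc h7
    obtain ⟨hymem, hιpy, hyιp, hyrk⟩ := UnitaryLeviSetup.restrict_mem hcp hLp hιpapply X hX hΘX hXΘ hXc
    rw [h7] at hyrk
    refine hfullp_of (UnitaryDoubleLevi.eq_top_of_raise_of_core' hbrLp hirrLp hιpmem hιpιp hPp hQp
      (s := fun v w : Up => s (v : W) w) (hsU Up) (fun v w => hsymm v w) hPpQp hdefPp hdefQp hadjLp hymem hιpy hyιp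
      (by rw [hyrk]; omega) (by omega) (by omega)
      fun U' 𝔩' ι' P' Q' hbr𝔩' hirr𝔩' hι' hι'ι' hP' hQ' hfinP' hfinQ' hP'Q' hdefP' hdefQ' hadj𝔩' => ?_)
    rw [hyrk] at hfinP' hfinQ'
    exact UnitarySeven.eq_top_of_smul hbr𝔩' hirr𝔩' hι' hι'ι' hP' hQ' hfinP' (by omega) (s := fun x y : U' => s ((x : Up) : W) y) (fun x y z => by simp only [Submodule.coe_add, hadd]) (fun c x y => by simp only [Submodule.coe_smul, hsmul]) (fun x y => hsymm _ _) hP'Q' hdefP' hdefQ' hadj𝔩'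
  have hkillp9 : ∀ X ∈ 𝔊, Θ * X = X → X * Θ = -X → X * ι = ι * X → Module.finrank ℂ (Up.map X) ≠ 9 := by
    intro X hX hΘX hXΘ hXc h9
    obtain ⟨hymem, hιpy, hyιp, hyrk⟩ := UnitaryLeviSetup.restrict_mem hcp hLp hιpapply X hX hΘX hXΘ hXc
    rw [h9] at hyrk
    refine hfullp_of (UnitaryDoubleLevi.eq_top_of_raise_of_core' hbrLp hirrLp hιpmem hιpιp hPp hQp
      (s := fun v w : Up => s (v : W) w) (hsU Up) (fun v w => hsymm v w) hPpQp hdefPp hdefQp hadjLp hymem hιpy hyιp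
      (by rw [hyrk]; omega) (by omega) (by omega)
      fun U' 𝔩' ι' P' Q' hbr𝔩' hirr𝔩' hι' hι'ι' hP' hQ' hfinP' hfinQ' hP'Q' hdefP' hdefQ' hadj𝔩' => ?_)
    rw [hyrk] at hfinP' hfinQ'
    exact UnitaryNineTen.eq_top_of_smul hbr𝔩' hirr𝔩' hι' hι'ι' hP' hQ' hfinP' (by omega) (s := fun x y : U' => s ((x : Up) : W) y) (fun x y z => by simp only [Submodule.coe_add, hadd]) (fun c x y => by simp only [Submodule.coe_smul, hsmul]) (fun x y => hsymm _ _) hP'Q' hdefP' hdefQ' hadj𝔩'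
  have hkillp11 : ∀ X ∈ 𝔊, Θ * X = X → X * Θ = -X → X * ι = ι * X → Module.finrank ℂ (Up.map X) ≠ 11 := by
    intro X hX hΘX hXΘ hXc h11
    obtain ⟨hymem, hιpy, hyιp, hyrk⟩ := UnitaryLeviSetup.restrict_mem hcp hLp hιpapply X hX hΘX hXΘ hXc
    rw [h11] at hyrk
    refine hfullp_of (UnitaryDoubleLevi.eq_top_of_raise_of_core' hbrLp hirrLp hιpmem hιpιp hPp hQp
      (s := fun v w : Up => s (v : W) w) (hsU Up) (fun v w => hsymm v w) hPpQp hdefPp hdefQp hadjLp hymem hιpy hyιp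
      (by rw [hyrk]; omega) (by omega) (by omega)
      fun U' 𝔩' ι' P' Q' hbr𝔩' hirr𝔩' hι' hι'ι' hP' hQ' hfinP' hfinQ' hP'Q' hdefP' hdefQ' hadj𝔩' => ?_)
    rw [hyrk] at hfinP' hfinQ'
    exact UnitaryEleven.eq_top_of_smul hbr𝔩' hirr𝔩' hι' hι'ι' hP' hQ' hfinP' (by omega) (s := fun x y : U' => s ((x : Up) : W) y) (fun x y z => by simp only [Submodule.coe_add, hadd]) (fun c x y => by simp only [Submodule.coe_smul, hsmul]) (fun x y => hsymm _ _) hP'Q' hdefP' hdefQ' hadj𝔩'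
  have hkillp13 : ∀ X ∈ 𝔊, Θ * X = X → X * Θ = -X → X * ι = ι * X → Module.finrank ℂ (Up.map X) ≠ 13 := by
    intro X hX hΘX hXΘ hXc h13
    obtain ⟨hymem, hιpy, hyιp, hyrk⟩ := UnitaryLeviSetup.restrict_mem hcp hLp hιpapply X hX hΘX hXΘ hXc
    rw [h13] at hyrk
    refine hfullp_of (UnitaryDoubleLevi.eq_top_of_raise_of_core' hbrLp hirrLp hιpmem hιpιp hPp hQp
      (s := fun v w : Up => s (v : W) w) (hsU Up) (fun v w => hsymm v w) hPpQp hdefPp hdefQp hadjLp hymem hιpy hyιp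
      (by rw [hyrk]; omega) (by omega) (by omega)
      fun U' 𝔩' ι' P' Q' hbr𝔩' hirr𝔩' hι' hι'ι' hP' hQ' hfinP' hfinQ' hP'Q' hdefP' hdefQ' hadj𝔩' => ?_)
    rw [hyrk] at hfinP' hfinQ'
    exact UnitarySix.eq_top_of_smul' hbr𝔩' hirr𝔩' hι' hι'ι' hP' hQ' ⟨6, by omega⟩ (by omega) (by omega) (s := fun x y : U' => s ((x : Up) : W) y) (fun x y z => by simp only [Submodule.coe_add, hadd]) (fun c x y => by simp only [Submodule.coe_smul, hsmul]) (fun x y => hsymm _ _) hP'Q' hdefP' hdefQ' hadj𝔩'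
  have hkillp15 : ∀ X ∈ 𝔊, Θ * X = X → X * Θ = -X → X * ι = ι * X → Module.finrank ℂ (Up.map X) ≠ 15 := by
    intro X hX hΘX hXΘ hXc h15
    obtain ⟨hymem, hιpy, hyιp, hyrk⟩ := UnitaryLeviSetup.restrict_mem hcp hLp hιpapply X hX hΘX hXΘ hXc
    rw [h15] at hyrk
    refine hfullp_of (UnitaryDoubleLevi.eq_top_of_raise_of_core' hbrLp hirrLp hιpmem hιpιp hPp hQp
      (s := fun v w : Up => s (v : W) w) (hsU Up) (fun v w => hsymm v w) hPpQp hdefPp hdefQp hadjLp hymem hιpy hyιp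
      (by rw [hyrk]; omega) (by omega) (by omega)
      fun U' 𝔩' ι' P' Q' hbr𝔩' hirr𝔩' hι' hι'ι' hP' hQ' hfinP' hfinQ' hP'Q' hdefP' hdefQ' hadj𝔩' => ?_)
    rw [hyrk] at hfinP' hfinQ'
    exact UnitaryFourOdd.eq_top' hbr𝔩' hirr𝔩' hι' hι'ι' hP' hQ' ⟨7, by omega⟩ (by omega) (s := fun x y : U' => s ((x : Up) : W) y) (fun x y z => by simp only [Submodule.coe_add, hadd]) (fun x y => hsymm _ _) hP'Q' hdefP' hdefQ' hadj𝔩'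
  have hprof : ∀ X ∈ 𝔊, Θ * X = X → X * Θ = -X → X * ι = ι * X →
      (Module.finrank ℂ (Up.map X) = 0 ∧ Module.finrank ℂ (Um.map X) = 0) ∨
        (Module.finrank ℂ (Up.map X) = 0 ∧ Module.finrank ℂ (Um.map X) = 15) := by
    intro X hX hΘX hXΘ hXc
    obtain ⟨hs, hi, hi', hj, hj'⟩ := hsplit X hΘX hXΘ hXc
    have hkillm1' := hkillm1 X hX hΘX hXΘ hXc
    have hkillm3' := hkillm3 X hX hΘX hXΘ hXc
    have hkillm5' := hkillm5 X hX hΘX hXΘ hXc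
    have hkillm7' := hkillm7 X hX hΘX hXΘ hXc
    have hkillm11' := hkillm11 X hX hΘX hXΘ hXc
    have hkillm13' := hkillm13 X hX hΘX hXΘ hXc
    have hkillp1' := hkillp1 X hX hΘX hXΘ hXc
    have hkillp3' := hkillp3 X hX hΘX hXΘ hXc
    have hkillp5' := hkillp5 X hX hΘX hXΘ hXc
    have hkillp6' := hkillp6 X hX hΘX hXΘ hXc
    have hkillp7' := hkillp7 X hX hΘX hXΘ hXc
    have hkillp9' := hkillp9 X hX hΘX hXΘ hXc
    have hkillp11' := hkillp11 X hX hΘX hXΘ hXc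
    have hkillp13' := hkillp13 X hX hΘX hXΘ hXc
    have hkillp15' := hkillp15 X hX hΘX hXΘ hXc
    have hrk := hS X hX hΘX hXΘ
    have hd := hdich X hX hΘX hXΘ hXc
    rw [hs] at hrk
    generalize Module.finrank ℂ ↥(Submodule.map X Um) = jj at *
    have hjle : jj ≤ 15 := by omega
    interval_cases jj
    · exact Or.inl ⟨by omega, rfl⟩
    · exact (hkillm1' rfl).elim
    · exfalso; omega
    · exact (hkillm3' rfl).elim
    · exfalso; omega
    · exact (hkillm5' rfl).elim
    · exfalso; omega
    · exact (hkillm7' rfl).elim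
    · exfalso; omega
    · exfalso; omega
    · exfalso; omega
    · exact (hkillm11' rfl).elim
    · exfalso; omega
    · exact (hkillm13' rfl).elim
    · exfalso; omega
    · exact Or.inr (⟨by omega, rfl⟩)
  obtain ⟨⟨p, hp⟩, hp0⟩ := Module.finrank_pos_iff_exists_ne_zero.1 (show 0 < Module.finrank ℂ PU by omega)
  obtain ⟨⟨q, hq⟩, hq0⟩ := Module.finrank_pos_iff_exists_ne_zero.1 (show 0 < Module.finrank ℂ QU by omega)
  obtain ⟨X₀, hX₀, hΘX₀, hX₀Θ, hX₀c, c₀, hιc₀, -, hX₀c0⟩ :=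
    UnitaryLeviFull.exists_raise_commute_apply_ne_zero hbr hirr hΘ hΘΘ hQ hιmem hιι hιΘ hUm hUp
      ⟨p, fun h => hp0 (Subtype.ext h), ((hPU p).1 hp).1, ((hPU p).1 hp).2⟩
      ⟨q, fun h => hq0 (Subtype.ext h), ((hQU q).1 hq).1, ((hQU q).1 hq).2⟩
  have hX₀i : Module.finrank ℂ (Up.map X₀) ≠ 0 := fun h0 => by
    have hmem : X₀ c₀ ∈ Up.map X₀ := Submodule.mem_map_of_mem ((hUp c₀).2 hιc₀)
    rw [Submodule.finrank_eq_zero.1 h0, Submodule.mem_bot] at hmem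
    exact hX₀c0 hmem
  have hp0 := hprof X₀ hX₀ hΘX₀ hX₀Θ hX₀c
  omega

/-- `(34 | 49)`, minimal rank `16`: the non-zero profiles [(2, 14), (4, 12), (6, 10), (8, 8), (10, 6), (16, 0)] are pairwise exclusive, so constant; `(2, 14)`: TOOL C on `L⁺`; `(4, 12)`: `L⁺` (type `(18 | 16)`) has constant rank `4`; `(6, 10)`: `L⁺` (type `(18 | 16)`) has constant rank `6`; `(8, 8)`: `L⁻` (type `(16 | 33)`) has constant rank `8`; `(10, 6)`: `L⁺` (type `(18 | 16)`) has constant rank `10`; `(16, 0)`: `L⁻` would kill `Q ∩ ker B`. [cite: Ribet1983, Thm. 3] [cite: Gordon1997, Thm. 6.3 (3)]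
[cite: Deligne1982HodgeCycles, I §3 Prop. 3.4, 3.6] [cite: GoodmanWallachGTM255, §4.1.1] -/
theorem UnitaryThirtyFourFortyNine.no_minRank_16 [FiniteDimensional ℂ W] {𝔊 : Submodule ℂ (Module.End ℂ W)}
    (hbr : ∀ Y ∈ 𝔊, ∀ Z ∈ 𝔊, Y * Z - Z * Y ∈ 𝔊)
    (hirr : ∀ U : Submodule ℂ W, (∀ A ∈ 𝔊, ∀ u ∈ U, A u ∈ U) → U = ⊥ ∨ U = ⊤)
    {Θ : Module.End ℂ W} (hΘ : Θ ∈ 𝔊) (hΘΘ : Θ * Θ = 1)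
    {P Q : Submodule ℂ W} (hP : ∀ x, x ∈ P ↔ Θ x = x) (hQ : ∀ x, x ∈ Q ↔ Θ x = -x)
    (hP34 : Module.finrank ℂ P = 34) (hQ49 : Module.finrank ℂ Q = 49)
    {s : W → W → ℂ} (hadd : ∀ x y z, s (x + y) z = s x z + s y z)
    (hsmul : ∀ (c : ℂ) (x y : W), s (c • x) y = c * s x y) (hsymm : ∀ x y, s y x = starRingEnd ℂ (s x y))
    (hPQ : ∀ p ∈ P, ∀ q ∈ Q, s p q = 0) (hdefP : ∀ p ∈ P, s p p = 0 → p = 0) (hdefQ : ∀ q ∈ Q, s q q = 0 → q = 0)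
    (hadj : ∀ X ∈ 𝔊, ∃ Y ∈ 𝔊, ∀ x y, s (X x) y = s x (Y y))
    (hS : ∀ B' ∈ 𝔊, Θ * B' = B' → B' * Θ = -B' →
      Module.finrank ℂ (LinearMap.range B') = 0 ∨ Module.finrank ℂ (LinearMap.range B') = 16 ∨ Module.finrank ℂ (LinearMap.range B') = 17 ∨ Module.finrank ℂ (LinearMap.range B') = 18 ∨ Module.finrank ℂ (LinearMap.range B') = 19 ∨ Module.finrank ℂ (LinearMap.range B') = 20 ∨ Module.finrank ℂ (LinearMap.range B') = 21 ∨ Module.finrank ℂ (LinearMap.range B') = 22 ∨ Module.finrank ℂ (LinearMap.range B') = 23 ∨ Module.finrank ℂ (LinearMap.range B') = 24 ∨ Module.finrank ℂ (LinearMap.range B') = 25 ∨ Module.finrank ℂ (LinearMap.range B') = 26 ∨ Module.finrank ℂ (LinearMap.range B') = 27 ∨ Module.finrank ℂ (LinearMap.range B') = 28 ∨ Module.finrank ℂ (LinearMap.range B') = 29 ∨ Module.finrank ℂ (LinearMap.range B') = 30 ∨ Module.finrank ℂ (LinearMap.range B') = 31 ∨ Module.finrank ℂ (LinearMap.range B')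 = 32 ∨ Module.finrank ℂ (LinearMap.range B') = 33 ∨ Module.finrank ℂ (LinearMap.range B') = 34)
    {B : Module.End ℂ W} (hB : B ∈ 𝔊) (hΘB : Θ * B = B) (hBΘ : B * Θ = -B)
    (hr : Module.finrank ℂ (LinearMap.range B) = 16) : False := by
  classical
  have hsU : ∀ U : Submodule ℂ W, ∀ x y z : U, s ((x + y : U) : W) z = s (x : W) z + s (y : W) z :=
    fun U x y z => by simp only [Submodule.coe_add, hadd]
  have hsmU : ∀ U : Submodule ℂ W, ∀ (c : ℂ) (x y : U), s ((c • x : U) : W) y = c * s (x : W) y :=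
    fun U c x y => by simp only [Submodule.coe_smul, hsmul]
  have hno1 : ∀ B' ∈ 𝔊, Θ * B' = B' → B' * Θ = -B' → Module.finrank ℂ (LinearMap.range B') ≠ 1 := by
    intro B' hB' hΘB' hB'Θ h1
    rcases hS B' hB' hΘB' hB'Θ with h | h | h | h | h | h | h | h | h | h | h | h | h | h | h | h | h | h | h | h <;> omega
  have hmin : ∀ Y ∈ 𝔊, Θ * Y = Y → Y * Θ = -Y → Y ≠ 0 → 16 ≤ Module.finrank ℂ (LinearMap.range Y) := by
    intro Y hY hΘY hYΘ hY0
    have h0 : Module.finrank ℂ (LinearMap.range Y) ≠ 0 := fun h =>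
      hY0 (LinearMap.range_eq_bot.1 (Submodule.finrank_eq_zero.1 h))
    rcases hS Y hY hΘY hYΘ with h | h | h | h | h | h | h | h | h | h | h | h | h | h | h | h | h | h | h | h <;> omega
  have hmin' : ∀ Z ∈ 𝔊, Θ * Z = Z → Z * Θ = -Z → Z ≠ 0 → Module.finrank ℂ (LinearMap.range B) ≤ Module.finrank ℂ (LinearMap.range Z) := by
    rw [hr]; exact hmin
  obtain ⟨ι, Um, Up, PU, QU, Lm, ιm, Pm, Qm, Lp, ιp, Pp, Qp, hιmem, hιι, hιΘ, hιs, hUm, hUp, hfinUm, hfinUp,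
    hPM, hQM, hPU, hQU, hrangeP, hPUP, hQUQ, hfinQM, hfinPU, hfinQU, hLm, hLp,
    hιmapply, hPmmem, hQmmem, hbrLm, hirrLm, hιmmem, hιmιm, hPm, hQm, hfinPm, hfinQm, hPmQm, hdefPm, hdefQm, hadjLm,
    hιpapply, hPpmem, hQpmem, hbrLp, hirrLp, hιpmem, hιpιp, hPp, hQp, hfinPp, hfinQp, hPpQp, hdefPp, hdefQp, hadjLp,
    hsplit⟩ :=
    UnitaryLeviSetup.exists_levi_pair hbr hirr hΘ hΘΘ hP hQ hadd hsymm hPQ hdefP hdefQ hadj hB hΘB hBΘ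
  have hdich : ∀ X ∈ 𝔊, Θ * X = X → X * Θ = -X → X * ι = ι * X →
      Module.finrank ℂ (Up.map X) + Module.finrank ℂ (Um.map X) ≤ Module.finrank ℂ (LinearMap.range B) ∨
        (16 ≤ Module.finrank ℂ (Up.map X) ∧ 16 ≤ Module.finrank ℂ (Um.map X)) := fun X hX hΘX hXΘ hXc =>
    UnitaryLeviSetup.profile_dichotomy hbr hΘΘ hP hQ hadd hsymm hPQ hdefP hdefQ hadj hmin hB hΘB hBΘ hιι hιΘ hιs hUm hUp
      hPM hQM hQU hfinQU hrangeP hX hΘX hXΘ hXc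
  have hfinQU' := hfinQU
  rw [hr] at hfinQM hfinPU hfinQU hfinPm hfinQm hfinPp hfinQp hsplit hdich
  rw [hQ49] at hfinQM hfinQm hfinUm
  rw [hP34] at hfinPU hfinPp hfinUp
  have hcm : ∀ Z : Module.End ℂ W, Z * ι = ι * Z → ∀ x ∈ Um, Z x ∈ Um := fun Z hZ x hx =>
    (hUm _).2 (by rw [← Module.End.mul_apply, ← hZ, Module.End.mul_apply, (hUm x).1 hx, map_neg])
  have hcp : ∀ Z : Module.End ℂ W, Z * ι = ι * Z → ∀ x ∈ Up, Z x ∈ Up := fun Z hZ x hx =>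
    (hUp _).2 (by rw [← Module.End.mul_apply, ← hZ, Module.End.mul_apply, (hUp x).1 hx])
  have hfullm_of : Lm = ⊤ → False := fun h =>
    UnitaryLeviSetup.false_of_full_larger hbr hΘΘ hno1 hιι hιΘ hUm hUp (by omega) (by omega) hPM hQM (by omega)
      (by omega) hLm h
  have hkillm1 : ∀ X ∈ 𝔊, Θ * X = X → X * Θ = -X → X * ι = ι * X → Module.finrank ℂ (Um.map X) ≠ 1 := by
    intro X hX hΘX hXΘ hXc h1
    obtain ⟨hxmem, hιmx, hxιm, hxrk⟩ := UnitaryLeviSetup.restrict_mem hcm hLm hιmapply X hX hΘX hXΘ hXc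
    rw [h1] at hxrk
    exact hfullm_of (UnitaryRankOneRaise.eq_top_of_rankOne_raise hbrLm hirrLm hιmmem hιmιm hPm hQm
      (s := fun v w : Um => s (v : W) w) (hsU Um) (fun v w => hsymm v w) hPmQm hdefPm hdefQm hadjLm hxmem hιmx hxιm
      hxrk (by omega) (by omega) (by omega))
  have hkillm2 : ∀ X ∈ 𝔊, Θ * X = X → X * Θ = -X → X * ι = ι * X → Module.finrank ℂ (Um.map X) ≠ 2 := by
    intro X hX hΘX hXΘ hXc h2
    obtain ⟨hxmem, hιmx, hxιm, hxrk⟩ := UnitaryLeviSetup.restrict_mem hcm hLm hιmapply X hX hΘX hXΘ hXc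
    rw [h2] at hxrk
    refine hfullm_of (UnitaryDoubleLevi.eq_top_of_raise_of_core hbrLm hirrLm hιmmem hιmιm hPm hQm
      (s := fun v w : Um => s (v : W) w) (hsU Um) (fun v w => hsymm v w) hPmQm hdefPm hdefQm hadjLm hxmem hιmx hxιm
      (by rw [hxrk]; omega) (by omega) (by omega)
      fun U' 𝔩' ι' P' Q' hbr𝔩' hirr𝔩' hι' hι'ι' hP' hQ' hfinP' hfinQ' hP'Q' hdefP' hdefQ' hadj𝔩' => ?_)
    rw [hxrk] at hfinP' hfinQ'
    exact UnitaryTwoOdd.eq_top hbr𝔩' hirr𝔩' hι' hι'ι' hP' hQ' hfinP' ⟨15, by omega⟩ (s := fun x y : U' => s ((x : Um) : W) y) (fun x y z => by simp only [Submodule.coe_add, hadd]) (fun x y => hsymm _ _) hP'Q' hdefP' hdefQ' hadj𝔩'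
  have hkillm4 : ∀ X ∈ 𝔊, Θ * X = X → X * Θ = -X → X * ι = ι * X → Module.finrank ℂ (Um.map X) ≠ 4 := by
    intro X hX hΘX hXΘ hXc h4
    obtain ⟨hxmem, hιmx, hxιm, hxrk⟩ := UnitaryLeviSetup.restrict_mem hcm hLm hιmapply X hX hΘX hXΘ hXc
    rw [h4] at hxrk
    refine hfullm_of (UnitaryDoubleLevi.eq_top_of_raise_of_core hbrLm hirrLm hιmmem hιmιm hPm hQm
      (s := fun v w : Um => s (v : W) w) (hsU Um) (fun v w => hsymm v w) hPmQm hdefPm hdefQm hadjLm hxmem hιmx hxιm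
      (by rw [hxrk]; omega) (by omega) (by omega)
      fun U' 𝔩' ι' P' Q' hbr𝔩' hirr𝔩' hι' hι'ι' hP' hQ' hfinP' hfinQ' hP'Q' hdefP' hdefQ' hadj𝔩' => ?_)
    rw [hxrk] at hfinP' hfinQ'
    exact UnitaryFourOdd.eq_top hbr𝔩' hirr𝔩' hι' hι'ι' hP' hQ' hfinP' ⟨14, by omega⟩ (s := fun x y : U' => s ((x : Um) : W) y) (fun x y z => by simp only [Submodule.coe_add, hadd]) (fun x y => hsymm _ _) hP'Q' hdefP' hdefQ' hadj𝔩'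
  have hkillm5 : ∀ X ∈ 𝔊, Θ * X = X → X * Θ = -X → X * ι = ι * X → Module.finrank ℂ (Um.map X) ≠ 5 := by
    intro X hX hΘX hXΘ hXc h5
    obtain ⟨hxmem, hιmx, hxιm, hxrk⟩ := UnitaryLeviSetup.restrict_mem hcm hLm hιmapply X hX hΘX hXΘ hXc
    rw [h5] at hxrk
    refine hfullm_of (UnitaryDoubleLevi.eq_top_of_raise_of_core hbrLm hirrLm hιmmem hιmιm hPm hQm
      (s := fun v w : Um => s (v : W) w) (hsU Um) (fun v w => hsymm v w) hPmQm hdefPm hdefQm hadjLm hxmem hιmx hxιm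
      (by rw [hxrk]; omega) (by omega) (by omega)
      fun U' 𝔩' ι' P' Q' hbr𝔩' hirr𝔩' hι' hι'ι' hP' hQ' hfinP' hfinQ' hP'Q' hdefP' hdefQ' hadj𝔩' => ?_)
    rw [hxrk] at hfinP' hfinQ'
    exact UnitaryFive.eq_top_of_smul hbr𝔩' hirr𝔩' hι' hι'ι' hP' hQ' hfinP' (by omega) (s := fun x y : U' => s ((x : Um) : W) y) (fun x y z => by simp only [Submodule.coe_add, hadd]) (fun c x y => by simp only [Submodule.coe_smul, hsmul]) (fun x y => hsymm _ _) hP'Q' hdefP' hdefQ' hadj𝔩'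
  have hkillm7 : ∀ X ∈ 𝔊, Θ * X = X → X * Θ = -X → X * ι = ι * X → Module.finrank ℂ (Um.map X) ≠ 7 := by
    intro X hX hΘX hXΘ hXc h7
    obtain ⟨hxmem, hιmx, hxιm, hxrk⟩ := UnitaryLeviSetup.restrict_mem hcm hLm hιmapply X hX hΘX hXΘ hXc
    rw [h7] at hxrk
    refine hfullm_of (UnitaryDoubleLevi.eq_top_of_raise_of_core hbrLm hirrLm hιmmem hιmιm hPm hQm
      (s := fun v w : Um => s (v : W) w) (hsU Um) (fun v w => hsymm v w) hPmQm hdefPm hdefQm hadjLm hxmem hιmx hxιm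
      (by rw [hxrk]; omega) (by omega) (by omega)
      fun U' 𝔩' ι' P' Q' hbr𝔩' hirr𝔩' hι' hι'ι' hP' hQ' hfinP' hfinQ' hP'Q' hdefP' hdefQ' hadj𝔩' => ?_)
    rw [hxrk] at hfinP' hfinQ'
    exact UnitarySeven.eq_top_of_smul hbr𝔩' hirr𝔩' hι' hι'ι' hP' hQ' hfinP' (by omega) (s := fun x y : U' => s ((x : Um) : W) y) (fun x y z => by simp only [Submodule.coe_add, hadd]) (fun c x y => by simp only [Submodule.coe_smul, hsmul]) (fun x y => hsymm _ _) hP'Q' hdefP' hdefQ' hadj𝔩'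
  have hkillm13 : ∀ X ∈ 𝔊, Θ * X = X → X * Θ = -X → X * ι = ι * X → Module.finrank ℂ (Um.map X) ≠ 13 := by
    intro X hX hΘX hXΘ hXc h13
    obtain ⟨hxmem, hιmx, hxιm, hxrk⟩ := UnitaryLeviSetup.restrict_mem hcm hLm hιmapply X hX hΘX hXΘ hXc
    rw [h13] at hxrk
    refine hfullm_of (UnitaryDoubleLevi.eq_top_of_raise_of_core hbrLm hirrLm hιmmem hιmιm hPm hQm
      (s := fun v w : Um => s (v : W) w) (hsU Um) (fun v w => hsymm v w) hPmQm hdefPm hdefQm hadjLm hxmem hιmx hxιm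
      (by rw [hxrk]; omega) (by omega) (by omega)
      fun U' 𝔩' ι' P' Q' hbr𝔩' hirr𝔩' hι' hι'ι' hP' hQ' hfinP' hfinQ' hP'Q' hdefP' hdefQ' hadj𝔩' => ?_)
    rw [hxrk] at hfinP' hfinQ'
    exact UnitaryThirteen.eq_top_of_smul hbr𝔩' hirr𝔩' hι' hι'ι' hP' hQ' hfinP' (by omega) (s := fun x y : U' => s ((x : Um) : W) y) (fun x y z => by simp only [Submodule.coe_add, hadd]) (fun c x y => by simp only [Submodule.coe_smul, hsmul]) (fun x y => hsymm _ _) hP'Q' hdefP' hdefQ' hadj𝔩'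
  have hkillm16 : ∀ X ∈ 𝔊, Θ * X = X → X * Θ = -X → X * ι = ι * X → Module.finrank ℂ (Um.map X) ≠ 16 := by
    intro X hX hΘX hXΘ hXc h16
    obtain ⟨hxmem, hιmx, hxιm, hxrk⟩ := UnitaryLeviSetup.restrict_mem hcm hLm hιmapply X hX hΘX hXΘ hXc
    rw [h16] at hxrk
    refine hfullm_of (UnitaryDoubleLevi.eq_top_of_raise_of_core hbrLm hirrLm hιmmem hιmιm hPm hQm
      (s := fun v w : Um => s (v : W) w) (hsU Um) (fun v w => hsymm v w) hPmQm hdefPm hdefQm hadjLm hxmem hιmx hxιm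
      (by rw [hxrk]; omega) (by omega) (by omega)
      fun U' 𝔩' ι' P' Q' hbr𝔩' hirr𝔩' hι' hι'ι' hP' hQ' hfinP' hfinQ' hP'Q' hdefP' hdefQ' hadj𝔩' => ?_)
    rw [hxrk] at hfinP' hfinQ'
    exact UnitarySeventeen.eq_top_of_smul hbr𝔩' hirr𝔩' hι' hι'ι' hP' hQ' (by omega) (by omega) (by omega) (s := fun x y : U' => s ((x : Um) : W) y) (fun x y z => by simp only [Submodule.coe_add, hadd]) (fun c x y => by simp only [Submodule.coe_smul, hsmul]) (fun x y => hsymm _ _) hP'Q' hdefP' hdefQ' hadj𝔩'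
  have hfullp_of : Lp = ⊤ → False := by
    intro hLptop
    obtain ⟨T3, hιT3, hT3ι, hT3r⟩ := UnitaryRaisingSpace.exists_raise_finrank_range_eq hιpιp hPp hQp (k := 3)
      (by omega) (by omega)
    obtain ⟨X3, hX3, hΘX3, hX3Θ, hX3c, hX3Up⟩ := UnitaryLeviSetup.exists_lift hbr hΘ hΘΘ hcp hιΘ hLp hιpapply T3
      (by rw [hLptop]; exact Submodule.mem_top) hιT3 hT3ι
    rw [hT3r] at hX3Up
    obtain ⟨hs3, hi3, hi3', hj3, hj3'⟩ := hsplit X3 hΘX3 hX3Θ hX3c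
    have hrk3 := hS X3 hX3 hΘX3 hX3Θ
    have hd3 := hdich X3 hX3 hΘX3 hX3Θ hX3c
    rw [hs3] at hrk3
    rw [hX3Up] at hrk3 hd3
    have hk_hkillm13 := hkillm13 X3 hX3 hΘX3 hX3Θ hX3c
    omega
  have hkillp1 : ∀ X ∈ 𝔊, Θ * X = X → X * Θ = -X → X * ι = ι * X → Module.finrank ℂ (Up.map X) ≠ 1 := by
    intro X hX hΘX hXΘ hXc h1
    obtain ⟨hymem, hιpy, hyιp, hyrk⟩ := UnitaryLeviSetup.restrict_mem hcp hLp hιpapply X hX hΘX hXΘ hXc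
    rw [h1] at hyrk
    exact hfullp_of (UnitaryRankOneRaise.eq_top_of_rankOne_raise hbrLp hirrLp hιpmem hιpιp hPp hQp
      (s := fun v w : Up => s (v : W) w) (hsU Up) (fun v w => hsymm v w) hPpQp hdefPp hdefQp hadjLp hymem hιpy hyιp
      hyrk (by omega) (by omega) (by omega))
  have hkillp5 : ∀ X ∈ 𝔊, Θ * X = X → X * Θ = -X → X * ι = ι * X → Module.finrank ℂ (Up.map X) ≠ 5 := by
    intro X hX hΘX hXΘ hXc h5
    obtain ⟨hymem, hιpy, hyιp, hyrk⟩ := UnitaryLeviSetup.restrict_mem hcp hLp hιpapply X hX hΘX hXΘ hXc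
    rw [h5] at hyrk
    refine hfullp_of (UnitaryDoubleLevi.eq_top_of_raise_of_core' hbrLp hirrLp hιpmem hιpιp hPp hQp
      (s := fun v w : Up => s (v : W) w) (hsU Up) (fun v w => hsymm v w) hPpQp hdefPp hdefQp hadjLp hymem hιpy hyιp
      (by rw [hyrk]; omega) (by omega) (by omega)
      fun U' 𝔩' ι' P' Q' hbr𝔩' hirr𝔩' hι' hι'ι' hP' hQ' hfinP' hfinQ' hP'Q' hdefP' hdefQ' hadj𝔩' => ?_)
    rw [hyrk] at hfinP' hfinQ'
    exact UnitaryFive.eq_top_of_smul hbr𝔩' hirr𝔩' hι' hι'ι' hP' hQ' hfinP' (by omega) (s := fun x y : U' => s ((x : Up) : W) y) (fun x y z => by simp only [Submodule.coe_add, hadd]) (fun c x y => by simp only [Submodule.coe_smul, hsmul]) (fun x y => hsymm _ _) hP'Q' hdefP' hdefQ' hadj𝔩'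
  have hkillp7 : ∀ X ∈ 𝔊, Θ * X = X → X * Θ = -X → X * ι = ι * X → Module.finrank ℂ (Up.map X) ≠ 7 := by
    intro X hX hΘX hXΘ hXc h7
    obtain ⟨hymem, hιpy, hyιp, hyrk⟩ := UnitaryLeviSetup.restrict_mem hcp hLp hιpapply X hX hΘX hXΘ hXc
    rw [h7] at hyrk
    refine hfullp_of (UnitaryDoubleLevi.eq_top_of_raise_of_core' hbrLp hirrLp hιpmem hιpιp hPp hQp
      (s := fun v w : Up => s (v : W) w) (hsU Up) (fun v w => hsymm v w) hPpQp hdefPp hdefQp hadjLp hymem hιpy hyιp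
      (by rw [hyrk]; omega) (by omega) (by omega)
      fun U' 𝔩' ι' P' Q' hbr𝔩' hirr𝔩' hι' hι'ι' hP' hQ' hfinP' hfinQ' hP'Q' hdefP' hdefQ' hadj𝔩' => ?_)
    rw [hyrk] at hfinP' hfinQ'
    exact UnitarySeven.eq_top_of_smul hbr𝔩' hirr𝔩' hι' hι'ι' hP' hQ' hfinP' (by omega) (s := fun x y : U' => s ((x : Up) : W) y) (fun x y z => by simp only [Submodule.coe_add, hadd]) (fun c x y => by simp only [Submodule.coe_smul, hsmul]) (fun x y => hsymm _ _) hP'Q' hdefP' hdefQ' hadj𝔩'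
  have hkillp13 : ∀ X ∈ 𝔊, Θ * X = X → X * Θ = -X → X * ι = ι * X → Module.finrank ℂ (Up.map X) ≠ 13 := by
    intro X hX hΘX hXΘ hXc h13
    obtain ⟨hymem, hιpy, hyιp, hyrk⟩ := UnitaryLeviSetup.restrict_mem hcp hLp hιpapply X hX hΘX hXΘ hXc
    rw [h13] at hyrk
    refine hfullp_of (UnitaryDoubleLevi.eq_top_of_raise_of_core' hbrLp hirrLp hιpmem hιpιp hPp hQp
      (s := fun v w : Up => s (v : W) w) (hsU Up) (fun v w => hsymm v w) hPpQp hdefPp hdefQp hadjLp hymem hιpy hyιp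
      (by rw [hyrk]; omega) (by omega) (by omega)
      fun U' 𝔩' ι' P' Q' hbr𝔩' hirr𝔩' hι' hι'ι' hP' hQ' hfinP' hfinQ' hP'Q' hdefP' hdefQ' hadj𝔩' => ?_)
    rw [hyrk] at hfinP' hfinQ'
    exact UnitaryFive.eq_top_of_smul' hbr𝔩' hirr𝔩' hι' hι'ι' hP' hQ' (by omega) (by omega) (s := fun x y : U' => s ((x : Up) : W) y) (fun x y z => by simp only [Submodule.coe_add, hadd]) (fun c x y => by simp only [Submodule.coe_smul, hsmul]) (fun x y => hsymm _ _) hP'Q' hdefP' hdefQ' hadj𝔩'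
  have hprof : ∀ X ∈ 𝔊, Θ * X = X → X * Θ = -X → X * ι = ι * X →
      (Module.finrank ℂ (Up.map X) = 0 ∧ Module.finrank ℂ (Um.map X) = 0) ∨
        (Module.finrank ℂ (Up.map X) = 2 ∧ Module.finrank ℂ (Um.map X) = 14) ∨
        (Module.finrank ℂ (Up.map X) = 4 ∧ Module.finrank ℂ (Um.map X) = 12) ∨
        (Module.finrank ℂ (Up.map X) = 6 ∧ Module.finrank ℂ (Um.map X) = 10) ∨
        (Module.finrank ℂ (Up.map X) = 8 ∧ Module.finrank ℂ (Um.map X) = 8) ∨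
        (Module.finrank ℂ (Up.map X) = 10 ∧ Module.finrank ℂ (Um.map X) = 6) ∨
        (Module.finrank ℂ (Up.map X) = 16 ∧ Module.finrank ℂ (Um.map X) = 0) := by
    intro X hX hΘX hXΘ hXc
    obtain ⟨hs, hi, hi', hj, hj'⟩ := hsplit X hΘX hXΘ hXc
    have hkillm1' := hkillm1 X hX hΘX hXΘ hXc
    have hkillm2' := hkillm2 X hX hΘX hXΘ hXc
    have hkillm4' := hkillm4 X hX hΘX hXΘ hXc
    have hkillm5' := hkillm5 X hX hΘX hXΘ hXc
    have hkillm7' := hkillm7 X hX hΘX hXΘ hXc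
    have hkillm13' := hkillm13 X hX hΘX hXΘ hXc
    have hkillm16' := hkillm16 X hX hΘX hXΘ hXc
    have hkillp1' := hkillp1 X hX hΘX hXΘ hXc
    have hkillp5' := hkillp5 X hX hΘX hXΘ hXc
    have hkillp7' := hkillp7 X hX hΘX hXΘ hXc
    have hkillp13' := hkillp13 X hX hΘX hXΘ hXc
    have hrk := hS X hX hΘX hXΘ
    have hd := hdich X hX hΘX hXΘ hXc
    rw [hs] at hrk
    generalize Module.finrank ℂ ↥(Submodule.map X Um) = jj at *
    have hjle : jj ≤ 16 := by omega
    interval_cases jj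
    · rcases (show Module.finrank ℂ (Up.map X) = 0 ∨ Module.finrank ℂ (Up.map X) = 16 by omega) with h | h
      · exact Or.inl ⟨h, rfl⟩
      · exact Or.inr (Or.inr (Or.inr (Or.inr (Or.inr (Or.inr (⟨h, rfl⟩))))))
    · exact (hkillm1' rfl).elim
    · exact (hkillm2' rfl).elim
    · exfalso; omega
    · exact (hkillm4' rfl).elim
    · exact (hkillm5' rfl).elim
    · exact Or.inr (Or.inr (Or.inr (Or.inr (Or.inr (Or.inl ⟨by omega, rfl⟩)))))
    · exact (hkillm7' rfl).elim
    · exact Or.inr (Or.inr (Or.inr (Or.inr (Or.inl ⟨by omega, rfl⟩))))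
    · exfalso; omega
    · exact Or.inr (Or.inr (Or.inr (Or.inl ⟨by omega, rfl⟩)))
    · exfalso; omega
    · exact Or.inr (Or.inr (Or.inl ⟨by omega, rfl⟩))
    · exact (hkillm13' rfl).elim
    · exact Or.inr (Or.inl ⟨by omega, rfl⟩)
    · exfalso; omega
    · exact (hkillm16' rfl).elim
  obtain ⟨⟨p, hp⟩, hp0⟩ := Module.finrank_pos_iff_exists_ne_zero.1 (show 0 < Module.finrank ℂ PU by omega)
  obtain ⟨⟨q, hq⟩, hq0⟩ := Module.finrank_pos_iff_exists_ne_zero.1 (show 0 < Module.finrank ℂ QU by omega)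
  obtain ⟨X₀, hX₀, hΘX₀, hX₀Θ, hX₀c, c₀, hιc₀, -, hX₀c0⟩ :=
    UnitaryLeviFull.exists_raise_commute_apply_ne_zero hbr hirr hΘ hΘΘ hQ hιmem hιι hιΘ hUm hUp
      ⟨p, fun h => hp0 (Subtype.ext h), ((hPU p).1 hp).1, ((hPU p).1 hp).2⟩
      ⟨q, fun h => hq0 (Subtype.ext h), ((hQU q).1 hq).1, ((hQU q).1 hq).2⟩
  have hX₀i : Module.finrank ℂ (Up.map X₀) ≠ 0 := fun h0 => by
    have hmem : X₀ c₀ ∈ Up.map X₀ := Submodule.mem_map_of_mem ((hUp c₀).2 hιc₀)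
    rw [Submodule.finrank_eq_zero.1 h0, Submodule.mem_bot] at hmem
    exact hX₀c0 hmem
  have hnotboth : ∀ X ∈ 𝔊, Θ * X = X → X * Θ = -X → X * ι = ι * X → ∀ X' ∈ 𝔊, Θ * X' = X' → X' * Θ = -X' →
      X' * ι = ι * X' → 16 < Module.finrank ℂ (Up.map X') + Module.finrank ℂ (Um.map X) → False := by
    intro X hX hΘX hXΘ hXc X' hX' hΘX' hX'Θ hX'c hgt
    obtain ⟨c, hc1, hc2⟩ := UnitaryGenericRank.exists_finrank_le_and_finrank_le (X'.restrict (hcp X' hX'c))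
      (X.restrict (hcp X hXc)) (X.restrict (hcm X hXc)) (X'.restrict (hcm X' hX'c))
    obtain ⟨hX₁, hΘX₁, hX₁Θ, hX₁c⟩ := UnitaryLeviSetup.add_smul_raise X hX hΘX hXΘ hXc X' hX' hΘX' hX'Θ hX'c c
    have hi₁ := UnitaryLeviSetup.finrank_map_add_smul hcp X X' hXc hX'c c hX₁c
    have hj₁ := UnitaryLeviSetup.finrank_map_add_smul hcm X X' hXc hX'c c hX₁c
    rw [UnitaryLeviRank.finrank_range_restrict] at hc1 hc2
    have hp := hprof (X + c • X') hX₁ hΘX₁ hX₁Θ hX₁c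
    rw [hi₁, hj₁] at hp
    omega
  have hzero : ∀ X ∈ 𝔊, Θ * X = X → X * Θ = -X → X * ι = ι * X → Module.finrank ℂ (Up.map X) = 0 → Module.finrank ℂ (Um.map X) = 0 → X = 0 := by
    intro X hX hΘX hXΘ hXc hi hj
    obtain ⟨hs, -, -, -, -⟩ := hsplit X hΘX hXΘ hXc
    rw [hi, hj, add_zero] at hs
    exact LinearMap.range_eq_bot.1 (Submodule.finrank_eq_zero.1 hs)
  have hjoint : ∀ v ∈ Q ⊓ LinearMap.ker B,
      (∀ X ∈ 𝔊, Θ * X = X → X * Θ = -X → X * ι = ι * X → X v = 0) → v = 0 := by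
    intro v hv hkill
    obtain ⟨hιv, -⟩ := (hQM v).1 hv
    have hvUm : v ∈ Um := (hUm v).2 hιv
    obtain ⟨⟨p₁, hp₁⟩, hp₁0⟩ := Module.finrank_pos_iff_exists_ne_zero.1 (show 0 < Module.finrank ℂ Pm by omega)
    have hq : ιm ⟨v, hvUm⟩ = -⟨v, hvUm⟩ := (hQm _).1 ((hQmmem _).2 hv)
    have h0 := UnitaryThetaCore.eq_zero_of_forall_raise_apply_eq_zero hbrLm hirrLm hιmmem hιmιm
      ⟨p₁, fun h => hp₁0 (Subtype.ext h), (hPm p₁).1 hp₁⟩ hq fun T hT hιT hTι => ?_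
    · exact congrArg Subtype.val h0
    obtain ⟨X, hX, hΘX, hXΘ, hXc, hXT⟩ := UnitaryLeviSetup.exists_lift_eq hbr hΘ hΘΘ hιΘ hLm hιmapply T hT hιT hTι
    exact Subtype.ext (by rw [← hXT]; exact hkill X hX hΘX hXΘ hXc)
  rcases hprof X₀ hX₀ hΘX₀ hX₀Θ hX₀c with ⟨h0i, h0j⟩ | ⟨h0i, h0j⟩ | ⟨h0i, h0j⟩ | ⟨h0i, h0j⟩ | ⟨h0i, h0j⟩ | ⟨h0i, h0j⟩ | ⟨h0i, h0j⟩
  · exact hX₀i h0i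
  · -- constant profile `(2, 14)`
    have hprofc : ∀ X ∈ 𝔊, Θ * X = X → X * Θ = -X → X * ι = ι * X → X ≠ 0 →
        Module.finrank ℂ (Up.map X) = 2 ∧ Module.finrank ℂ (Um.map X) = 14 := by
      intro X hX hΘX hXΘ hXc hX0
      rcases hprof X hX hΘX hXΘ hXc with ⟨hi, hj⟩ | ⟨hi, hj⟩ | ⟨hi, hj⟩ | ⟨hi, hj⟩ | ⟨hi, hj⟩ | ⟨hi, hj⟩ | ⟨hi, hj⟩
      · exact (hX0 (hzero X hX hΘX hXΘ hXc hi hj)).elim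
      · exact ⟨hi, hj⟩
      · exact (hnotboth X₀ hX₀ hΘX₀ hX₀Θ hX₀c X hX hΘX hXΘ hXc (by omega)).elim
      · exact (hnotboth X₀ hX₀ hΘX₀ hX₀Θ hX₀c X hX hΘX hXΘ hXc (by omega)).elim
      · exact (hnotboth X₀ hX₀ hΘX₀ hX₀Θ hX₀c X hX hΘX hXΘ hXc (by omega)).elim
      · exact (hnotboth X₀ hX₀ hΘX₀ hX₀Θ hX₀c X hX hΘX hXΘ hXc (by omega)).elim
      · exact (hnotboth X₀ hX₀ hΘX₀ hX₀Θ hX₀c X hX hΘX hXΘ hXc (by omega)).elim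
    obtain ⟨A, hA, hιpA, hAιp, hAne, hA2⟩ :=
      UnitaryConstantRank.exists_raise_rank_ne_two' hbrLp hirrLp hιpmem hιpιp hPp hQp (by omega) (by omega) (by omega)
        (s := fun v w : Up => s (v : W) w) (hsU Up) (fun v w => hsymm v w) hPpQp hdefPp hdefQp hadjLp
    obtain ⟨XA, hXA, hΘXA, hXAΘ, hXAc, hXAUp⟩ := UnitaryLeviSetup.exists_lift hbr hΘ hΘΘ hcp hιΘ hLp hιpapply A hA hιpA hAιp
    have hA0 : Module.finrank ℂ (LinearMap.range A) ≠ 0 := fun h =>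
      hAne (LinearMap.range_eq_bot.1 (Submodule.finrank_eq_zero.1 h))
    have hXA0 : XA ≠ 0 := fun h0 => hA0 (by rw [← hXAUp, h0, Submodule.map_zero, finrank_bot])
    have hpA := hprofc XA hXA hΘXA hXAΘ hXAc hXA0
    rw [← hXAUp] at hA2
    omega
  · -- constant profile `(4, 12)`
    have hprofc : ∀ X ∈ 𝔊, Θ * X = X → X * Θ = -X → X * ι = ι * X → X ≠ 0 →
        Module.finrank ℂ (Up.map X) = 4 ∧ Module.finrank ℂ (Um.map X) = 12 := by
      intro X hX hΘX hXΘ hXc hX0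
      rcases hprof X hX hΘX hXΘ hXc with ⟨hi, hj⟩ | ⟨hi, hj⟩ | ⟨hi, hj⟩ | ⟨hi, hj⟩ | ⟨hi, hj⟩ | ⟨hi, hj⟩ | ⟨hi, hj⟩
      · exact (hX0 (hzero X hX hΘX hXΘ hXc hi hj)).elim
      · exact (hnotboth X hX hΘX hXΘ hXc X₀ hX₀ hΘX₀ hX₀Θ hX₀c (by omega)).elim
      · exact ⟨hi, hj⟩
      · exact (hnotboth X₀ hX₀ hΘX₀ hX₀Θ hX₀c X hX hΘX hXΘ hXc (by omega)).elim
      · exact (hnotboth X₀ hX₀ hΘX₀ hX₀Θ hX₀c X hX hΘX hXΘ hXc (by omega)).elim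
      · exact (hnotboth X₀ hX₀ hΘX₀ hX₀Θ hX₀c X hX hΘX hXΘ hXc (by omega)).elim
      · exact (hnotboth X₀ hX₀ hΘX₀ hX₀Θ hX₀c X hX hΘX hXΘ hXc (by omega)).elim
    obtain ⟨hymem, hιpy, hyιp, hyrk⟩ := UnitaryLeviSetup.restrict_mem hcp hLp hιpapply X₀ hX₀ hΘX₀ hX₀Θ hX₀c
    have hSp : ∀ A ∈ Lp, ιp * A = A → A * ιp = -A →
        Module.finrank ℂ (LinearMap.range A) = 0 ∨ Module.finrank ℂ (LinearMap.range A) = 4 := by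
      intro A hA hιA hAι
      by_cases hA0 : A = 0
      · left; rw [hA0, LinearMap.range_zero, finrank_bot]
      · obtain ⟨XA, hXA, hΘXA, hXAΘ, hXAc, hXAUp⟩ :=
          UnitaryLeviSetup.exists_lift hbr hΘ hΘΘ hcp hιΘ hLp hιpapply A hA hιA hAι
        have hXA0 : XA ≠ 0 := fun h0 => hA0 (LinearMap.range_eq_bot.1 (Submodule.finrank_eq_zero.1
          (by rw [← hXAUp, h0, Submodule.map_zero, finrank_bot])))
        right; rw [← hXAUp]; exact (hprofc XA hXA hΘXA hXAΘ hXAc hXA0).1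
    exact UnitaryThirtyFourFortyNine.subEighteenSixteen_rank4 hbrLp hirrLp hιpmem hιpιp hPp hQp (by omega) (by omega)
      (s := fun v w : Up => s (v : W) w) (hsU Up) (hsmU Up) (fun v w => hsymm v w) hPpQp hdefPp hdefQp hadjLp hSp
      hymem hιpy hyιp (by rw [hyrk, h0i])
  · -- constant profile `(6, 10)`
    have hprofc : ∀ X ∈ 𝔊, Θ * X = X → X * Θ = -X → X * ι = ι * X → X ≠ 0 →
        Module.finrank ℂ (Up.map X) = 6 ∧ Module.finrank ℂ (Um.map X) = 10 := by
      intro X hX hΘX hXΘ hXc hX0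
      rcases hprof X hX hΘX hXΘ hXc with ⟨hi, hj⟩ | ⟨hi, hj⟩ | ⟨hi, hj⟩ | ⟨hi, hj⟩ | ⟨hi, hj⟩ | ⟨hi, hj⟩ | ⟨hi, hj⟩
      · exact (hX0 (hzero X hX hΘX hXΘ hXc hi hj)).elim
      · exact (hnotboth X hX hΘX hXΘ hXc X₀ hX₀ hΘX₀ hX₀Θ hX₀c (by omega)).elim
      · exact (hnotboth X hX hΘX hXΘ hXc X₀ hX₀ hΘX₀ hX₀Θ hX₀c (by omega)).elim
      · exact ⟨hi, hj⟩
      · exact (hnotboth X₀ hX₀ hΘX₀ hX₀Θ hX₀c X hX hΘX hXΘ hXc (by omega)).elim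
      · exact (hnotboth X₀ hX₀ hΘX₀ hX₀Θ hX₀c X hX hΘX hXΘ hXc (by omega)).elim
      · exact (hnotboth X₀ hX₀ hΘX₀ hX₀Θ hX₀c X hX hΘX hXΘ hXc (by omega)).elim
    obtain ⟨hymem, hιpy, hyιp, hyrk⟩ := UnitaryLeviSetup.restrict_mem hcp hLp hιpapply X₀ hX₀ hΘX₀ hX₀Θ hX₀c
    have hSp : ∀ A ∈ Lp, ιp * A = A → A * ιp = -A →
        Module.finrank ℂ (LinearMap.range A) = 0 ∨ Module.finrank ℂ (LinearMap.range A) = 6 := by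
      intro A hA hιA hAι
      by_cases hA0 : A = 0
      · left; rw [hA0, LinearMap.range_zero, finrank_bot]
      · obtain ⟨XA, hXA, hΘXA, hXAΘ, hXAc, hXAUp⟩ :=
          UnitaryLeviSetup.exists_lift hbr hΘ hΘΘ hcp hιΘ hLp hιpapply A hA hιA hAι
        have hXA0 : XA ≠ 0 := fun h0 => hA0 (LinearMap.range_eq_bot.1 (Submodule.finrank_eq_zero.1
          (by rw [← hXAUp, h0, Submodule.map_zero, finrank_bot])))
        right; rw [← hXAUp]; exact (hprofc XA hXA hΘXA hXAΘ hXAc hXA0).1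
    exact UnitaryThirtyFourFortyNine.subEighteenSixteen_rank6 hbrLp hirrLp hιpmem hιpιp hPp hQp (by omega) (by omega)
      (s := fun v w : Up => s (v : W) w) (hsU Up) (hsmU Up) (fun v w => hsymm v w) hPpQp hdefPp hdefQp hadjLp hSp
      hymem hιpy hyιp (by rw [hyrk, h0i])
  · -- constant profile `(8, 8)`
    have hprofc : ∀ X ∈ 𝔊, Θ * X = X → X * Θ = -X → X * ι = ι * X → X ≠ 0 →
        Module.finrank ℂ (Up.map X) = 8 ∧ Module.finrank ℂ (Um.map X) = 8 := by
      intro X hX hΘX hXΘ hXc hX0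
      rcases hprof X hX hΘX hXΘ hXc with ⟨hi, hj⟩ | ⟨hi, hj⟩ | ⟨hi, hj⟩ | ⟨hi, hj⟩ | ⟨hi, hj⟩ | ⟨hi, hj⟩ | ⟨hi, hj⟩
      · exact (hX0 (hzero X hX hΘX hXΘ hXc hi hj)).elim
      · exact (hnotboth X hX hΘX hXΘ hXc X₀ hX₀ hΘX₀ hX₀Θ hX₀c (by omega)).elim
      · exact (hnotboth X hX hΘX hXΘ hXc X₀ hX₀ hΘX₀ hX₀Θ hX₀c (by omega)).elim
      · exact (hnotboth X hX hΘX hXΘ hXc X₀ hX₀ hΘX₀ hX₀Θ hX₀c (by omega)).elim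
      · exact ⟨hi, hj⟩
      · exact (hnotboth X₀ hX₀ hΘX₀ hX₀Θ hX₀c X hX hΘX hXΘ hXc (by omega)).elim
      · exact (hnotboth X₀ hX₀ hΘX₀ hX₀Θ hX₀c X hX hΘX hXΘ hXc (by omega)).elim
    obtain ⟨hxmem, hιmx, hxιm, hxrk⟩ := UnitaryLeviSetup.restrict_mem hcm hLm hιmapply X₀ hX₀ hΘX₀ hX₀Θ hX₀c
    have hSm : ∀ A ∈ Lm, ιm * A = A → A * ιm = -A →
        Module.finrank ℂ (LinearMap.range A) = 0 ∨ Module.finrank ℂ (LinearMap.range A) = 8 := by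
      intro A hA hιA hAι
      by_cases hA0 : A = 0
      · left; rw [hA0, LinearMap.range_zero, finrank_bot]
      · obtain ⟨XA, hXA, hΘXA, hXAΘ, hXAc, hXAUm⟩ :=
          UnitaryLeviSetup.exists_lift hbr hΘ hΘΘ hcm hιΘ hLm hιmapply A hA hιA hAι
        have hXA0 : XA ≠ 0 := fun h0 => hA0 (LinearMap.range_eq_bot.1 (Submodule.finrank_eq_zero.1
          (by rw [← hXAUm, h0, Submodule.map_zero, finrank_bot])))
        right; rw [← hXAUm]; exact (hprofc XA hXA hΘXA hXAΘ hXAc hXA0).2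
    exact UnitaryThirtyFourFortyNine.subSixteenThirtyThree_rank8 hbrLm hirrLm hιmmem hιmιm hPm hQm (by omega) (by omega)
      (s := fun v w : Um => s (v : W) w) (hsU Um) (hsmU Um) (fun v w => hsymm v w) hPmQm hdefPm hdefQm hadjLm hSm
      hxmem hιmx hxιm (by rw [hxrk, h0j])
  · -- constant profile `(10, 6)`
    have hprofc : ∀ X ∈ 𝔊, Θ * X = X → X * Θ = -X → X * ι = ι * X → X ≠ 0 →
        Module.finrank ℂ (Up.map X) = 10 ∧ Module.finrank ℂ (Um.map X) = 6 := by
      intro X hX hΘX hXΘ hXc hX0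
      rcases hprof X hX hΘX hXΘ hXc with ⟨hi, hj⟩ | ⟨hi, hj⟩ | ⟨hi, hj⟩ | ⟨hi, hj⟩ | ⟨hi, hj⟩ | ⟨hi, hj⟩ | ⟨hi, hj⟩
      · exact (hX0 (hzero X hX hΘX hXΘ hXc hi hj)).elim
      · exact (hnotboth X hX hΘX hXΘ hXc X₀ hX₀ hΘX₀ hX₀Θ hX₀c (by omega)).elim
      · exact (hnotboth X hX hΘX hXΘ hXc X₀ hX₀ hΘX₀ hX₀Θ hX₀c (by omega)).elim
      · exact (hnotboth X hX hΘX hXΘ hXc X₀ hX₀ hΘX₀ hX₀Θ hX₀c (by omega)).elim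
      · exact (hnotboth X hX hΘX hXΘ hXc X₀ hX₀ hΘX₀ hX₀Θ hX₀c (by omega)).elim
      · exact ⟨hi, hj⟩
      · exact (hnotboth X₀ hX₀ hΘX₀ hX₀Θ hX₀c X hX hΘX hXΘ hXc (by omega)).elim
    obtain ⟨hymem, hιpy, hyιp, hyrk⟩ := UnitaryLeviSetup.restrict_mem hcp hLp hιpapply X₀ hX₀ hΘX₀ hX₀Θ hX₀c
    have hSp : ∀ A ∈ Lp, ιp * A = A → A * ιp = -A →
        Module.finrank ℂ (LinearMap.range A) = 0 ∨ Module.finrank ℂ (LinearMap.range A) = 10 := by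
      intro A hA hιA hAι
      by_cases hA0 : A = 0
      · left; rw [hA0, LinearMap.range_zero, finrank_bot]
      · obtain ⟨XA, hXA, hΘXA, hXAΘ, hXAc, hXAUp⟩ :=
          UnitaryLeviSetup.exists_lift hbr hΘ hΘΘ hcp hιΘ hLp hιpapply A hA hιA hAι
        have hXA0 : XA ≠ 0 := fun h0 => hA0 (LinearMap.range_eq_bot.1 (Submodule.finrank_eq_zero.1
          (by rw [← hXAUp, h0, Submodule.map_zero, finrank_bot])))
        right; rw [← hXAUp]; exact (hprofc XA hXA hΘXA hXAΘ hXAc hXA0).1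
    exact UnitaryThirtyFourFortyNine.subEighteenSixteen_rank10 hbrLp hirrLp hιpmem hιpιp hPp hQp (by omega) (by omega)
      (s := fun v w : Up => s (v : W) w) (hsU Up) (hsmU Up) (fun v w => hsymm v w) hPpQp hdefPp hdefQp hadjLp hSp
      hymem hιpy hyιp (by rw [hyrk, h0i])
  · -- constant profile `(16, 0)`
    have hprofc : ∀ X ∈ 𝔊, Θ * X = X → X * Θ = -X → X * ι = ι * X → X ≠ 0 →
        Module.finrank ℂ (Up.map X) = 16 ∧ Module.finrank ℂ (Um.map X) = 0 := by
      intro X hX hΘX hXΘ hXc hX0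
      rcases hprof X hX hΘX hXΘ hXc with ⟨hi, hj⟩ | ⟨hi, hj⟩ | ⟨hi, hj⟩ | ⟨hi, hj⟩ | ⟨hi, hj⟩ | ⟨hi, hj⟩ | ⟨hi, hj⟩
      · exact (hX0 (hzero X hX hΘX hXΘ hXc hi hj)).elim
      · exact (hnotboth X hX hΘX hXΘ hXc X₀ hX₀ hΘX₀ hX₀Θ hX₀c (by omega)).elim
      · exact (hnotboth X hX hΘX hXΘ hXc X₀ hX₀ hΘX₀ hX₀Θ hX₀c (by omega)).elim
      · exact (hnotboth X hX hΘX hXΘ hXc X₀ hX₀ hΘX₀ hX₀Θ hX₀c (by omega)).elim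
      · exact (hnotboth X hX hΘX hXΘ hXc X₀ hX₀ hΘX₀ hX₀Θ hX₀c (by omega)).elim
      · exact (hnotboth X hX hΘX hXΘ hXc X₀ hX₀ hΘX₀ hX₀Θ hX₀c (by omega)).elim
      · exact ⟨hi, hj⟩
    obtain ⟨⟨v, hv⟩, hv0⟩ := Module.finrank_pos_iff_exists_ne_zero.1
      (show 0 < Module.finrank ℂ ↥(Q ⊓ LinearMap.ker B) by omega)
    refine hv0 (Subtype.ext (hjoint v hv fun X hX hΘX hXΘ hXc => ?_))
    by_cases hX0 : X = 0
    · rw [hX0, LinearMap.zero_apply]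
    · have hj := (hprofc X hX hΘX hXΘ hXc hX0).2
      have hvUm : v ∈ Um := (hUm v).2 ((hQM v).1 hv).1
      have hXv : X v ∈ Um.map X := Submodule.mem_map_of_mem hvUm
      rw [Submodule.finrank_eq_zero.1 hj, Submodule.mem_bot] at hXv
      exact hXv

/-- `(34 | 49)`, minimal rank `17`: the non-zero profiles [(1, 16), (3, 14), (5, 12), (7, 10), (8, 9), (9, 8), (11, 6), (13, 4), (15, 2), (17, 0)] are pairwise exclusive, so constant; `(1, 16)`: `L⁻` (type `(17 | 32)`) has constant rank `16`; `(3, 14)`: `L⁻` (type `(17 | 32)`) has constant rank `14`; `(5, 12)`: `L⁻` (type `(17 | 32)`) has constant rank `12`; `(7, 10)`: `L⁻` (type `(17 | 32)`) has constant rank `10`; `(8, 9)`: `L⁻` (type `(17 | 32)`) has constant rank `9`; `(9, 8)`: `L⁻` (type `(17 | 32)`) has constant rank `8`; `(11, 6)`: `L⁻` (type `(17 | 32)`) has constant rank `6`; `(13, 4)`: TOOL G; `(15, 2)`: TOOL C on `L⁻`; `(17, 0)`: `L⁻` would kill `Q ∩ ker B`. [cite: Ribet1983, Thm. 3] [cite: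 Gordon1997, Thm. 6.3 (3)]
[cite: Deligne1982HodgeCycles, I §3 Prop. 3.4, 3.6] [cite: GoodmanWallachGTM255, §4.1.1] -/
theorem UnitaryThirtyFourFortyNine.no_minRank_17 [FiniteDimensional ℂ W] {𝔊 : Submodule ℂ (Module.End ℂ W)}
    (hbr : ∀ Y ∈ 𝔊, ∀ Z ∈ 𝔊, Y * Z - Z * Y ∈ 𝔊)
    (hirr : ∀ U : Submodule ℂ W, (∀ A ∈ 𝔊, ∀ u ∈ U, A u ∈ U) → U = ⊥ ∨ U = ⊤)
    {Θ : Module.End ℂ W} (hΘ : Θ ∈ 𝔊) (hΘΘ : Θ * Θ = 1)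
    {P Q : Submodule ℂ W} (hP : ∀ x, x ∈ P ↔ Θ x = x) (hQ : ∀ x, x ∈ Q ↔ Θ x = -x)
    (hP34 : Module.finrank ℂ P = 34) (hQ49 : Module.finrank ℂ Q = 49)
    {s : W → W → ℂ} (hadd : ∀ x y z, s (x + y) z = s x z + s y z)
    (hsmul : ∀ (c : ℂ) (x y : W), s (c • x) y = c * s x y) (hsymm : ∀ x y, s y x = starRingEnd ℂ (s x y))
    (hPQ : ∀ p ∈ P, ∀ q ∈ Q, s p q = 0) (hdefP : ∀ p ∈ P, s p p = 0 → p = 0) (hdefQ : ∀ q ∈ Q, s q q = 0 → q = 0)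
    (hadj : ∀ X ∈ 𝔊, ∃ Y ∈ 𝔊, ∀ x y, s (X x) y = s x (Y y))
    (hS : ∀ B' ∈ 𝔊, Θ * B' = B' → B' * Θ = -B' →
      Module.finrank ℂ (LinearMap.range B') = 0 ∨ Module.finrank ℂ (LinearMap.range B') = 17 ∨ Module.finrank ℂ (LinearMap.range B') = 18 ∨ Module.finrank ℂ (LinearMap.range B') = 19 ∨ Module.finrank ℂ (LinearMap.range B') = 20 ∨ Module.finrank ℂ (LinearMap.range B') = 21 ∨ Module.finrank ℂ (LinearMap.range B') = 22 ∨ Module.finrank ℂ (LinearMap.range B') = 23 ∨ Module.finrank ℂ (LinearMap.range B') = 24 ∨ Module.finrank ℂ (LinearMap.range B') = 25 ∨ Module.finrank ℂ (LinearMap.range B') = 26 ∨ Module.finrank ℂ (LinearMap.range B') = 27 ∨ Module.finrank ℂ (LinearMap.range B') = 28 ∨ Module.finrank ℂ (LinearMap.range B') = 29 ∨ Module.finrank ℂ (LinearMap.range B') = 30 ∨ Module.finrank ℂ (LinearMap.range B') = 31 ∨ Module.finrank ℂ (LinearMap.range B') = 32 ∨ Module.finrank ℂ (LinearMap.range B')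 = 33 ∨ Module.finrank ℂ (LinearMap.range B') = 34)
    {B : Module.End ℂ W} (hB : B ∈ 𝔊) (hΘB : Θ * B = B) (hBΘ : B * Θ = -B)
    (hr : Module.finrank ℂ (LinearMap.range B) = 17) : False := by
  classical
  have hsU : ∀ U : Submodule ℂ W, ∀ x y z : U, s ((x + y : U) : W) z = s (x : W) z + s (y : W) z :=
    fun U x y z => by simp only [Submodule.coe_add, hadd]
  have hsmU : ∀ U : Submodule ℂ W, ∀ (c : ℂ) (x y : U), s ((c • x : U) : W) y = c * s (x : W) y :=
    fun U c x y => by simp only [Submodule.coe_smul, hsmul]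
  have hno1 : ∀ B' ∈ 𝔊, Θ * B' = B' → B' * Θ = -B' → Module.finrank ℂ (LinearMap.range B') ≠ 1 := by
    intro B' hB' hΘB' hB'Θ h1
    rcases hS B' hB' hΘB' hB'Θ with h | h | h | h | h | h | h | h | h | h | h | h | h | h | h | h | h | h | h <;> omega
  have hmin : ∀ Y ∈ 𝔊, Θ * Y = Y → Y * Θ = -Y → Y ≠ 0 → 17 ≤ Module.finrank ℂ (LinearMap.range Y) := by
    intro Y hY hΘY hYΘ hY0
    have h0 : Module.finrank ℂ (LinearMap.range Y) ≠ 0 := fun h =>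
      hY0 (LinearMap.range_eq_bot.1 (Submodule.finrank_eq_zero.1 h))
    rcases hS Y hY hΘY hYΘ with h | h | h | h | h | h | h | h | h | h | h | h | h | h | h | h | h | h | h <;> omega
  have hmin' : ∀ Z ∈ 𝔊, Θ * Z = Z → Z * Θ = -Z → Z ≠ 0 → Module.finrank ℂ (LinearMap.range B) ≤ Module.finrank ℂ (LinearMap.range Z) := by
    rw [hr]; exact hmin
  obtain ⟨ι, Um, Up, PU, QU, Lm, ιm, Pm, Qm, Lp, ιp, Pp, Qp, hιmem, hιι, hιΘ, hιs, hUm, hUp, hfinUm, hfinUp,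
    hPM, hQM, hPU, hQU, hrangeP, hPUP, hQUQ, hfinQM, hfinPU, hfinQU, hLm, hLp,
    hιmapply, hPmmem, hQmmem, hbrLm, hirrLm, hιmmem, hιmιm, hPm, hQm, hfinPm, hfinQm, hPmQm, hdefPm, hdefQm, hadjLm,
    hιpapply, hPpmem, hQpmem, hbrLp, hirrLp, hιpmem, hιpιp, hPp, hQp, hfinPp, hfinQp, hPpQp, hdefPp, hdefQp, hadjLp,
    hsplit⟩ :=
    UnitaryLeviSetup.exists_levi_pair hbr hirr hΘ hΘΘ hP hQ hadd hsymm hPQ hdefP hdefQ hadj hB hΘB hBΘ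
  have hdich : ∀ X ∈ 𝔊, Θ * X = X → X * Θ = -X → X * ι = ι * X →
      Module.finrank ℂ (Up.map X) + Module.finrank ℂ (Um.map X) ≤ Module.finrank ℂ (LinearMap.range B) ∨
        (17 ≤ Module.finrank ℂ (Up.map X) ∧ 17 ≤ Module.finrank ℂ (Um.map X)) := fun X hX hΘX hXΘ hXc =>
    UnitaryLeviSetup.profile_dichotomy hbr hΘΘ hP hQ hadd hsymm hPQ hdefP hdefQ hadj hmin hB hΘB hBΘ hιι hιΘ hιs hUm hUp
      hPM hQM hQU hfinQU hrangeP hX hΘX hXΘ hXc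
  have hfinQU' := hfinQU
  rw [hr] at hfinQM hfinPU hfinQU hfinPm hfinQm hfinPp hfinQp hsplit hdich
  rw [hQ49] at hfinQM hfinQm hfinUm
  rw [hP34] at hfinPU hfinPp hfinUp
  have hcm : ∀ Z : Module.End ℂ W, Z * ι = ι * Z → ∀ x ∈ Um, Z x ∈ Um := fun Z hZ x hx =>
    (hUm _).2 (by rw [← Module.End.mul_apply, ← hZ, Module.End.mul_apply, (hUm x).1 hx, map_neg])
  have hcp : ∀ Z : Module.End ℂ W, Z * ι = ι * Z → ∀ x ∈ Up, Z x ∈ Up := fun Z hZ x hx =>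
    (hUp _).2 (by rw [← Module.End.mul_apply, ← hZ, Module.End.mul_apply, (hUp x).1 hx])
  have hfullm_of : Lm = ⊤ → False := fun h =>
    UnitaryLeviSetup.false_of_full_larger hbr hΘΘ hno1 hιι hιΘ hUm hUp (by omega) (by omega) hPM hQM (by omega)
      (by omega) hLm h
  have hkillm1 : ∀ X ∈ 𝔊, Θ * X = X → X * Θ = -X → X * ι = ι * X → Module.finrank ℂ (Um.map X) ≠ 1 := by
    intro X hX hΘX hXΘ hXc h1
    obtain ⟨hxmem, hιmx, hxιm, hxrk⟩ := UnitaryLeviSetup.restrict_mem hcm hLm hιmapply X hX hΘX hXΘ hXc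
    rw [h1] at hxrk
    exact hfullm_of (UnitaryRankOneRaise.eq_top_of_rankOne_raise hbrLm hirrLm hιmmem hιmιm hPm hQm
      (s := fun v w : Um => s (v : W) w) (hsU Um) (fun v w => hsymm v w) hPmQm hdefPm hdefQm hadjLm hxmem hιmx hxιm
      hxrk (by omega) (by omega) (by omega))
  have hkillm3 : ∀ X ∈ 𝔊, Θ * X = X → X * Θ = -X → X * ι = ι * X → Module.finrank ℂ (Um.map X) ≠ 3 := by
    intro X hX hΘX hXΘ hXc h3
    obtain ⟨hxmem, hιmx, hxιm, hxrk⟩ := UnitaryLeviSetup.restrict_mem hcm hLm hιmapply X hX hΘX hXΘ hXc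
    rw [h3] at hxrk
    refine hfullm_of (UnitaryDoubleLevi.eq_top_of_raise_of_core hbrLm hirrLm hιmmem hιmιm hPm hQm
      (s := fun v w : Um => s (v : W) w) (hsU Um) (fun v w => hsymm v w) hPmQm hdefPm hdefQm hadjLm hxmem hιmx hxιm
      (by rw [hxrk]; omega) (by omega) (by omega)
      fun U' 𝔩' ι' P' Q' hbr𝔩' hirr𝔩' hι' hι'ι' hP' hQ' hfinP' hfinQ' hP'Q' hdefP' hdefQ' hadj𝔩' => ?_)
    rw [hxrk] at hfinP' hfinQ'
    exact UnitaryThreeCoprime.eq_top hbr𝔩' hirr𝔩' hι' hι'ι' hP' hQ' hfinP' (by omega) (s := fun x y : U' => s ((x : Um) : W) y) (fun x y z => by simp only [Submodule.coe_add, hadd]) (fun x y => hsymm _ _) hP'Q' hdefP' hdefQ' hadj𝔩'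
  have hkillm5 : ∀ X ∈ 𝔊, Θ * X = X → X * Θ = -X → X * ι = ι * X → Module.finrank ℂ (Um.map X) ≠ 5 := by
    intro X hX hΘX hXΘ hXc h5
    obtain ⟨hxmem, hιmx, hxιm, hxrk⟩ := UnitaryLeviSetup.restrict_mem hcm hLm hιmapply X hX hΘX hXΘ hXc
    rw [h5] at hxrk
    refine hfullm_of (UnitaryDoubleLevi.eq_top_of_raise_of_core hbrLm hirrLm hιmmem hιmιm hPm hQm
      (s := fun v w : Um => s (v : W) w) (hsU Um) (fun v w => hsymm v w) hPmQm hdefPm hdefQm hadjLm hxmem hιmx hxιm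
      (by rw [hxrk]; omega) (by omega) (by omega)
      fun U' 𝔩' ι' P' Q' hbr𝔩' hirr𝔩' hι' hι'ι' hP' hQ' hfinP' hfinQ' hP'Q' hdefP' hdefQ' hadj𝔩' => ?_)
    rw [hxrk] at hfinP' hfinQ'
    exact UnitaryFive.eq_top_of_smul hbr𝔩' hirr𝔩' hι' hι'ι' hP' hQ' hfinP' (by omega) (s := fun x y : U' => s ((x : Um) : W) y) (fun x y z => by simp only [Submodule.coe_add, hadd]) (fun c x y => by simp only [Submodule.coe_smul, hsmul]) (fun x y => hsymm _ _) hP'Q' hdefP' hdefQ' hadj𝔩'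
  have hkillm7 : ∀ X ∈ 𝔊, Θ * X = X → X * Θ = -X → X * ι = ι * X → Module.finrank ℂ (Um.map X) ≠ 7 := by
    intro X hX hΘX hXΘ hXc h7
    obtain ⟨hxmem, hιmx, hxιm, hxrk⟩ := UnitaryLeviSetup.restrict_mem hcm hLm hιmapply X hX hΘX hXΘ hXc
    rw [h7] at hxrk
    refine hfullm_of (UnitaryDoubleLevi.eq_top_of_raise_of_core hbrLm hirrLm hιmmem hιmιm hPm hQm
      (s := fun v w : Um => s (v : W) w) (hsU Um) (fun v w => hsymm v w) hPmQm hdefPm hdefQm hadjLm hxmem hιmx hxιm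
      (by rw [hxrk]; omega) (by omega) (by omega)
      fun U' 𝔩' ι' P' Q' hbr𝔩' hirr𝔩' hι' hι'ι' hP' hQ' hfinP' hfinQ' hP'Q' hdefP' hdefQ' hadj𝔩' => ?_)
    rw [hxrk] at hfinP' hfinQ'
    exact UnitarySeven.eq_top_of_smul hbr𝔩' hirr𝔩' hι' hι'ι' hP' hQ' hfinP' (by omega) (s := fun x y : U' => s ((x : Um) : W) y) (fun x y z => by simp only [Submodule.coe_add, hadd]) (fun c x y => by simp only [Submodule.coe_smul, hsmul]) (fun x y => hsymm _ _) hP'Q' hdefP' hdefQ' hadj𝔩'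
  have hkillm11 : ∀ X ∈ 𝔊, Θ * X = X → X * Θ = -X → X * ι = ι * X → Module.finrank ℂ (Um.map X) ≠ 11 := by
    intro X hX hΘX hXΘ hXc h11
    obtain ⟨hxmem, hιmx, hxιm, hxrk⟩ := UnitaryLeviSetup.restrict_mem hcm hLm hιmapply X hX hΘX hXΘ hXc
    rw [h11] at hxrk
    refine hfullm_of (UnitaryDoubleLevi.eq_top_of_raise_of_core hbrLm hirrLm hιmmem hιmιm hPm hQm
      (s := fun v w : Um => s (v : W) w) (hsU Um) (fun v w => hsymm v w) hPmQm hdefPm hdefQm hadjLm hxmem hιmx hxιm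
      (by rw [hxrk]; omega) (by omega) (by omega)
      fun U' 𝔩' ι' P' Q' hbr𝔩' hirr𝔩' hι' hι'ι' hP' hQ' hfinP' hfinQ' hP'Q' hdefP' hdefQ' hadj𝔩' => ?_)
    rw [hxrk] at hfinP' hfinQ'
    exact UnitaryEleven.eq_top_of_smul hbr𝔩' hirr𝔩' hι' hι'ι' hP' hQ' hfinP' (by omega) (s := fun x y : U' => s ((x : Um) : W) y) (fun x y z => by simp only [Submodule.coe_add, hadd]) (fun c x y => by simp only [Submodule.coe_smul, hsmul]) (fun x y => hsymm _ _) hP'Q' hdefP' hdefQ' hadj𝔩'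
  have hkillm13 : ∀ X ∈ 𝔊, Θ * X = X → X * Θ = -X → X * ι = ι * X → Module.finrank ℂ (Um.map X) ≠ 13 := by
    intro X hX hΘX hXΘ hXc h13
    obtain ⟨hxmem, hιmx, hxιm, hxrk⟩ := UnitaryLeviSetup.restrict_mem hcm hLm hιmapply X hX hΘX hXΘ hXc
    rw [h13] at hxrk
    refine hfullm_of (UnitaryDoubleLevi.eq_top_of_raise_of_core hbrLm hirrLm hιmmem hιmιm hPm hQm
      (s := fun v w : Um => s (v : W) w) (hsU Um) (fun v w => hsymm v w) hPmQm hdefPm hdefQm hadjLm hxmem hιmx hxιm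
      (by rw [hxrk]; omega) (by omega) (by omega)
      fun U' 𝔩' ι' P' Q' hbr𝔩' hirr𝔩' hι' hι'ι' hP' hQ' hfinP' hfinQ' hP'Q' hdefP' hdefQ' hadj𝔩' => ?_)
    rw [hxrk] at hfinP' hfinQ'
    exact UnitaryThirteen.eq_top_of_smul hbr𝔩' hirr𝔩' hι' hι'ι' hP' hQ' hfinP' (by omega) (s := fun x y : U' => s ((x : Um) : W) y) (fun x y z => by simp only [Submodule.coe_add, hadd]) (fun c x y => by simp only [Submodule.coe_smul, hsmul]) (fun x y => hsymm _ _) hP'Q' hdefP' hdefQ' hadj𝔩'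
  have hkillm15 : ∀ X ∈ 𝔊, Θ * X = X → X * Θ = -X → X * ι = ι * X → Module.finrank ℂ (Um.map X) ≠ 15 := by
    intro X hX hΘX hXΘ hXc h15
    obtain ⟨hxmem, hιmx, hxιm, hxrk⟩ := UnitaryLeviSetup.restrict_mem hcm hLm hιmapply X hX hΘX hXΘ hXc
    rw [h15] at hxrk
    refine hfullm_of (UnitaryDoubleLevi.eq_top_of_raise_of_core hbrLm hirrLm hιmmem hιmιm hPm hQm
      (s := fun v w : Um => s (v : W) w) (hsU Um) (fun v w => hsymm v w) hPmQm hdefPm hdefQm hadjLm hxmem hιmx hxιm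
      (by rw [hxrk]; omega) (by omega) (by omega)
      fun U' 𝔩' ι' P' Q' hbr𝔩' hirr𝔩' hι' hι'ι' hP' hQ' hfinP' hfinQ' hP'Q' hdefP' hdefQ' hadj𝔩' => ?_)
    rw [hxrk] at hfinP' hfinQ'
    exact UnitarySeventeen.eq_top_of_smul hbr𝔩' hirr𝔩' hι' hι'ι' hP' hQ' (by omega) (by omega) (by omega) (s := fun x y : U' => s ((x : Um) : W) y) (fun x y z => by simp only [Submodule.coe_add, hadd]) (fun c x y => by simp only [Submodule.coe_smul, hsmul]) (fun x y => hsymm _ _) hP'Q' hdefP' hdefQ' hadj𝔩'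
  have hkillm17 : ∀ X ∈ 𝔊, Θ * X = X → X * Θ = -X → X * ι = ι * X → Module.finrank ℂ (Um.map X) ≠ 17 := by
    intro X hX hΘX hXΘ hXc h17
    obtain ⟨hxmem, hιmx, hxιm, hxrk⟩ := UnitaryLeviSetup.restrict_mem hcm hLm hιmapply X hX hΘX hXΘ hXc
    rw [h17] at hxrk
    refine hfullm_of (UnitaryDoubleLevi.eq_top_of_raise_of_core hbrLm hirrLm hιmmem hιmιm hPm hQm
      (s := fun v w : Um => s (v : W) w) (hsU Um) (fun v w => hsymm v w) hPmQm hdefPm hdefQm hadjLm hxmem hιmx hxιm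
      (by rw [hxrk]; omega) (by omega) (by omega)
      fun U' 𝔩' ι' P' Q' hbr𝔩' hirr𝔩' hι' hι'ι' hP' hQ' hfinP' hfinQ' hP'Q' hdefP' hdefQ' hadj𝔩' => ?_)
    rw [hxrk] at hfinP' hfinQ'
    exact UnitarySeventeen.eq_top_of_smul' hbr𝔩' hirr𝔩' hι' hι'ι' hP' hQ' hfinP' (by omega) (by omega) (s := fun x y : U' => s ((x : Um) : W) y) (fun x y z => by simp only [Submodule.coe_add, hadd]) (fun c x y => by simp only [Submodule.coe_smul, hsmul]) (fun x y => hsymm _ _) hP'Q' hdefP' hdefQ' hadj𝔩'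
  have hfullp_of : Lp = ⊤ → False := by
    intro hLptop
    obtain ⟨T2, hιT2, hT2ι, hT2r⟩ := UnitaryRaisingSpace.exists_raise_finrank_range_eq hιpιp hPp hQp (k := 2)
      (by omega) (by omega)
    obtain ⟨X2, hX2, hΘX2, hX2Θ, hX2c, hX2Up⟩ := UnitaryLeviSetup.exists_lift hbr hΘ hΘΘ hcp hιΘ hLp hιpapply T2
      (by rw [hLptop]; exact Submodule.mem_top) hιT2 hT2ι
    rw [hT2r] at hX2Up
    obtain ⟨hs2, hi2, hi2', hj2, hj2'⟩ := hsplit X2 hΘX2 hX2Θ hX2c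
    have hrk2 := hS X2 hX2 hΘX2 hX2Θ
    have hd2 := hdich X2 hX2 hΘX2 hX2Θ hX2c
    rw [hs2] at hrk2
    rw [hX2Up] at hrk2 hd2
    have hk_hkillm15 := hkillm15 X2 hX2 hΘX2 hX2Θ hX2c
    omega
  have hprof : ∀ X ∈ 𝔊, Θ * X = X → X * Θ = -X → X * ι = ι * X →
      (Module.finrank ℂ (Up.map X) = 0 ∧ Module.finrank ℂ (Um.map X) = 0) ∨
        (Module.finrank ℂ (Up.map X) = 1 ∧ Module.finrank ℂ (Um.map X) = 16) ∨
        (Module.finrank ℂ (Up.map X) = 3 ∧ Module.finrank ℂ (Um.map X) = 14) ∨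
        (Module.finrank ℂ (Up.map X) = 5 ∧ Module.finrank ℂ (Um.map X) = 12) ∨
        (Module.finrank ℂ (Up.map X) = 7 ∧ Module.finrank ℂ (Um.map X) = 10) ∨
        (Module.finrank ℂ (Up.map X) = 8 ∧ Module.finrank ℂ (Um.map X) = 9) ∨
        (Module.finrank ℂ (Up.map X) = 9 ∧ Module.finrank ℂ (Um.map X) = 8) ∨
        (Module.finrank ℂ (Up.map X) = 11 ∧ Module.finrank ℂ (Um.map X) = 6) ∨
        (Module.finrank ℂ (Up.map X) = 13 ∧ Module.finrank ℂ (Um.map X) = 4) ∨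
        (Module.finrank ℂ (Up.map X) = 15 ∧ Module.finrank ℂ (Um.map X) = 2) ∨
        (Module.finrank ℂ (Up.map X) = 17 ∧ Module.finrank ℂ (Um.map X) = 0) := by
    intro X hX hΘX hXΘ hXc
    obtain ⟨hs, hi, hi', hj, hj'⟩ := hsplit X hΘX hXΘ hXc
    have hkillm1' := hkillm1 X hX hΘX hXΘ hXc
    have hkillm3' := hkillm3 X hX hΘX hXΘ hXc
    have hkillm5' := hkillm5 X hX hΘX hXΘ hXc
    have hkillm7' := hkillm7 X hX hΘX hXΘ hXc
    have hkillm11' := hkillm11 X hX hΘX hXΘ hXc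
    have hkillm13' := hkillm13 X hX hΘX hXΘ hXc
    have hkillm15' := hkillm15 X hX hΘX hXΘ hXc
    have hkillm17' := hkillm17 X hX hΘX hXΘ hXc
    have hrk := hS X hX hΘX hXΘ
    have hd := hdich X hX hΘX hXΘ hXc
    rw [hs] at hrk
    generalize Module.finrank ℂ ↥(Submodule.map X Um) = jj at *
    have hjle : jj ≤ 17 := by omega
    interval_cases jj
    · rcases (show Module.finrank ℂ (Up.map X) = 0 ∨ Module.finrank ℂ (Up.map X) = 17 by omega) with h | h
      · exact Or.inl ⟨h, rfl⟩
      · exact Or.inr (Or.inr (Or.inr (Or.inr (Or.inr (Or.inr (Or.inr (Or.inr (Or.inr (Or.inr (⟨h, rfl⟩))))))))))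
    · exact (hkillm1' rfl).elim
    · exact Or.inr (Or.inr (Or.inr (Or.inr (Or.inr (Or.inr (Or.inr (Or.inr (Or.inr (Or.inl ⟨by omega, rfl⟩)))))))))
    · exact (hkillm3' rfl).elim
    · exact Or.inr (Or.inr (Or.inr (Or.inr (Or.inr (Or.inr (Or.inr (Or.inr (Or.inl ⟨by omega, rfl⟩))))))))
    · exact (hkillm5' rfl).elim
    · exact Or.inr (Or.inr (Or.inr (Or.inr (Or.inr (Or.inr (Or.inr (Or.inl ⟨by omega, rfl⟩)))))))
    · exact (hkillm7' rfl).elim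
    · exact Or.inr (Or.inr (Or.inr (Or.inr (Or.inr (Or.inr (Or.inl ⟨by omega, rfl⟩))))))
    · exact Or.inr (Or.inr (Or.inr (Or.inr (Or.inr (Or.inl ⟨by omega, rfl⟩)))))
    · exact Or.inr (Or.inr (Or.inr (Or.inr (Or.inl ⟨by omega, rfl⟩))))
    · exact (hkillm11' rfl).elim
    · exact Or.inr (Or.inr (Or.inr (Or.inl ⟨by omega, rfl⟩)))
    · exact (hkillm13' rfl).elim
    · exact Or.inr (Or.inr (Or.inl ⟨by omega, rfl⟩))
    · exact (hkillm15' rfl).elim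
    · exact Or.inr (Or.inl ⟨by omega, rfl⟩)
    · exact (hkillm17' rfl).elim
  obtain ⟨⟨p, hp⟩, hp0⟩ := Module.finrank_pos_iff_exists_ne_zero.1 (show 0 < Module.finrank ℂ PU by omega)
  obtain ⟨⟨q, hq⟩, hq0⟩ := Module.finrank_pos_iff_exists_ne_zero.1 (show 0 < Module.finrank ℂ QU by omega)
  obtain ⟨X₀, hX₀, hΘX₀, hX₀Θ, hX₀c, c₀, hιc₀, -, hX₀c0⟩ :=
    UnitaryLeviFull.exists_raise_commute_apply_ne_zero hbr hirr hΘ hΘΘ hQ hιmem hιι hιΘ hUm hUp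
      ⟨p, fun h => hp0 (Subtype.ext h), ((hPU p).1 hp).1, ((hPU p).1 hp).2⟩
      ⟨q, fun h => hq0 (Subtype.ext h), ((hQU q).1 hq).1, ((hQU q).1 hq).2⟩
  have hX₀i : Module.finrank ℂ (Up.map X₀) ≠ 0 := fun h0 => by
    have hmem : X₀ c₀ ∈ Up.map X₀ := Submodule.mem_map_of_mem ((hUp c₀).2 hιc₀)
    rw [Submodule.finrank_eq_zero.1 h0, Submodule.mem_bot] at hmem
    exact hX₀c0 hmem
  have hnotboth : ∀ X ∈ 𝔊, Θ * X = X → X * Θ = -X → X * ι = ι * X → ∀ X' ∈ 𝔊, Θ * X' = X' → X' * Θ = -X' →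
      X' * ι = ι * X' → 17 < Module.finrank ℂ (Up.map X') + Module.finrank ℂ (Um.map X) → False := by
    intro X hX hΘX hXΘ hXc X' hX' hΘX' hX'Θ hX'c hgt
    obtain ⟨c, hc1, hc2⟩ := UnitaryGenericRank.exists_finrank_le_and_finrank_le (X'.restrict (hcp X' hX'c))
      (X.restrict (hcp X hXc)) (X.restrict (hcm X hXc)) (X'.restrict (hcm X' hX'c))
    obtain ⟨hX₁, hΘX₁, hX₁Θ, hX₁c⟩ := UnitaryLeviSetup.add_smul_raise X hX hΘX hXΘ hXc X' hX' hΘX' hX'Θ hX'c c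
    have hi₁ := UnitaryLeviSetup.finrank_map_add_smul hcp X X' hXc hX'c c hX₁c
    have hj₁ := UnitaryLeviSetup.finrank_map_add_smul hcm X X' hXc hX'c c hX₁c
    rw [UnitaryLeviRank.finrank_range_restrict] at hc1 hc2
    have hp := hprof (X + c • X') hX₁ hΘX₁ hX₁Θ hX₁c
    rw [hi₁, hj₁] at hp
    omega
  have hzero : ∀ X ∈ 𝔊, Θ * X = X → X * Θ = -X → X * ι = ι * X → Module.finrank ℂ (Up.map X) = 0 → Module.finrank ℂ (Um.map X) = 0 → X = 0 := by
    intro X hX hΘX hXΘ hXc hi hj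
    obtain ⟨hs, -, -, -, -⟩ := hsplit X hΘX hXΘ hXc
    rw [hi, hj, add_zero] at hs
    exact LinearMap.range_eq_bot.1 (Submodule.finrank_eq_zero.1 hs)
  have hjoint : ∀ v ∈ Q ⊓ LinearMap.ker B,
      (∀ X ∈ 𝔊, Θ * X = X → X * Θ = -X → X * ι = ι * X → X v = 0) → v = 0 := by
    intro v hv hkill
    obtain ⟨hιv, -⟩ := (hQM v).1 hv
    have hvUm : v ∈ Um := (hUm v).2 hιv
    obtain ⟨⟨p₁, hp₁⟩, hp₁0⟩ := Module.finrank_pos_iff_exists_ne_zero.1 (show 0 < Module.finrank ℂ Pm by omega)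
    have hq : ιm ⟨v, hvUm⟩ = -⟨v, hvUm⟩ := (hQm _).1 ((hQmmem _).2 hv)
    have h0 := UnitaryThetaCore.eq_zero_of_forall_raise_apply_eq_zero hbrLm hirrLm hιmmem hιmιm
      ⟨p₁, fun h => hp₁0 (Subtype.ext h), (hPm p₁).1 hp₁⟩ hq fun T hT hιT hTι => ?_
    · exact congrArg Subtype.val h0
    obtain ⟨X, hX, hΘX, hXΘ, hXc, hXT⟩ := UnitaryLeviSetup.exists_lift_eq hbr hΘ hΘΘ hιΘ hLm hιmapply T hT hιT hTι
    exact Subtype.ext (by rw [← hXT]; exact hkill X hX hΘX hXΘ hXc)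
  rcases hprof X₀ hX₀ hΘX₀ hX₀Θ hX₀c with ⟨h0i, h0j⟩ | ⟨h0i, h0j⟩ | ⟨h0i, h0j⟩ | ⟨h0i, h0j⟩ | ⟨h0i, h0j⟩ | ⟨h0i, h0j⟩ | ⟨h0i, h0j⟩ | ⟨h0i, h0j⟩ | ⟨h0i, h0j⟩ | ⟨h0i, h0j⟩ | ⟨h0i, h0j⟩
  · exact hX₀i h0i
  · -- constant profile `(1, 16)`
    have hprofc : ∀ X ∈ 𝔊, Θ * X = X → X * Θ = -X → X * ι = ι * X → X ≠ 0 →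
        Module.finrank ℂ (Up.map X) = 1 ∧ Module.finrank ℂ (Um.map X) = 16 := by
      intro X hX hΘX hXΘ hXc hX0
      rcases hprof X hX hΘX hXΘ hXc with ⟨hi, hj⟩ | ⟨hi, hj⟩ | ⟨hi, hj⟩ | ⟨hi, hj⟩ | ⟨hi, hj⟩ | ⟨hi, hj⟩ | ⟨hi, hj⟩ | ⟨hi, hj⟩ | ⟨hi, hj⟩ | ⟨hi, hj⟩ | ⟨hi, hj⟩
      · exact (hX0 (hzero X hX hΘX hXΘ hXc hi hj)).elim
      · exact ⟨hi, hj⟩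
      · exact (hnotboth X₀ hX₀ hΘX₀ hX₀Θ hX₀c X hX hΘX hXΘ hXc (by omega)).elim
      · exact (hnotboth X₀ hX₀ hΘX₀ hX₀Θ hX₀c X hX hΘX hXΘ hXc (by omega)).elim
      · exact (hnotboth X₀ hX₀ hΘX₀ hX₀Θ hX₀c X hX hΘX hXΘ hXc (by omega)).elim
      · exact (hnotboth X₀ hX₀ hΘX₀ hX₀Θ hX₀c X hX hΘX hXΘ hXc (by omega)).elim
      · exact (hnotboth X₀ hX₀ hΘX₀ hX₀Θ hX₀c X hX hΘX hXΘ hXc (by omega)).elim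
      · exact (hnotboth X₀ hX₀ hΘX₀ hX₀Θ hX₀c X hX hΘX hXΘ hXc (by omega)).elim
      · exact (hnotboth X₀ hX₀ hΘX₀ hX₀Θ hX₀c X hX hΘX hXΘ hXc (by omega)).elim
      · exact (hnotboth X₀ hX₀ hΘX₀ hX₀Θ hX₀c X hX hΘX hXΘ hXc (by omega)).elim
      · exact (hnotboth X₀ hX₀ hΘX₀ hX₀Θ hX₀c X hX hΘX hXΘ hXc (by omega)).elim
    obtain ⟨hxmem, hιmx, hxιm, hxrk⟩ := UnitaryLeviSetup.restrict_mem hcm hLm hιmapply X₀ hX₀ hΘX₀ hX₀Θ hX₀c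
    have hSm : ∀ A ∈ Lm, ιm * A = A → A * ιm = -A →
        Module.finrank ℂ (LinearMap.range A) = 0 ∨ Module.finrank ℂ (LinearMap.range A) = 16 := by
      intro A hA hιA hAι
      by_cases hA0 : A = 0
      · left; rw [hA0, LinearMap.range_zero, finrank_bot]
      · obtain ⟨XA, hXA, hΘXA, hXAΘ, hXAc, hXAUm⟩ :=
          UnitaryLeviSetup.exists_lift hbr hΘ hΘΘ hcm hιΘ hLm hιmapply A hA hιA hAι
        have hXA0 : XA ≠ 0 := fun h0 => hA0 (LinearMap.range_eq_bot.1 (Submodule.finrank_eq_zero.1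
          (by rw [← hXAUm, h0, Submodule.map_zero, finrank_bot])))
        right; rw [← hXAUm]; exact (hprofc XA hXA hΘXA hXAΘ hXAc hXA0).2
    exact UnitaryEighteenFortyNine.subSeventeenThirtyTwo_rank16 hbrLm hirrLm hιmmem hιmιm hPm hQm (by omega) (by omega)
      (s := fun v w : Um => s (v : W) w) (hsU Um) (hsmU Um) (fun v w => hsymm v w) hPmQm hdefPm hdefQm hadjLm hSm
      hxmem hιmx hxιm (by rw [hxrk, h0j])
  · -- constant profile `(3, 14)`
    have hprofc : ∀ X ∈ 𝔊, Θ * X = X → X * Θ = -X → X * ι = ι * X → X ≠ 0 →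
        Module.finrank ℂ (Up.map X) = 3 ∧ Module.finrank ℂ (Um.map X) = 14 := by
      intro X hX hΘX hXΘ hXc hX0
      rcases hprof X hX hΘX hXΘ hXc with ⟨hi, hj⟩ | ⟨hi, hj⟩ | ⟨hi, hj⟩ | ⟨hi, hj⟩ | ⟨hi, hj⟩ | ⟨hi, hj⟩ | ⟨hi, hj⟩ | ⟨hi, hj⟩ | ⟨hi, hj⟩ | ⟨hi, hj⟩ | ⟨hi, hj⟩
      · exact (hX0 (hzero X hX hΘX hXΘ hXc hi hj)).elim
      · exact (hnotboth X hX hΘX hXΘ hXc X₀ hX₀ hΘX₀ hX₀Θ hX₀c (by omega)).elim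
      · exact ⟨hi, hj⟩
      · exact (hnotboth X₀ hX₀ hΘX₀ hX₀Θ hX₀c X hX hΘX hXΘ hXc (by omega)).elim
      · exact (hnotboth X₀ hX₀ hΘX₀ hX₀Θ hX₀c X hX hΘX hXΘ hXc (by omega)).elim
      · exact (hnotboth X₀ hX₀ hΘX₀ hX₀Θ hX₀c X hX hΘX hXΘ hXc (by omega)).elim
      · exact (hnotboth X₀ hX₀ hΘX₀ hX₀Θ hX₀c X hX hΘX hXΘ hXc (by omega)).elim
      · exact (hnotboth X₀ hX₀ hΘX₀ hX₀Θ hX₀c X hX hΘX hXΘ hXc (by omega)).elim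
      · exact (hnotboth X₀ hX₀ hΘX₀ hX₀Θ hX₀c X hX hΘX hXΘ hXc (by omega)).elim
      · exact (hnotboth X₀ hX₀ hΘX₀ hX₀Θ hX₀c X hX hΘX hXΘ hXc (by omega)).elim
      · exact (hnotboth X₀ hX₀ hΘX₀ hX₀Θ hX₀c X hX hΘX hXΘ hXc (by omega)).elim
    obtain ⟨hxmem, hιmx, hxιm, hxrk⟩ := UnitaryLeviSetup.restrict_mem hcm hLm hιmapply X₀ hX₀ hΘX₀ hX₀Θ hX₀c
    have hSm : ∀ A ∈ Lm, ιm * A = A → A * ιm = -A →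
        Module.finrank ℂ (LinearMap.range A) = 0 ∨ Module.finrank ℂ (LinearMap.range A) = 14 := by
      intro A hA hιA hAι
      by_cases hA0 : A = 0
      · left; rw [hA0, LinearMap.range_zero, finrank_bot]
      · obtain ⟨XA, hXA, hΘXA, hXAΘ, hXAc, hXAUm⟩ :=
          UnitaryLeviSetup.exists_lift hbr hΘ hΘΘ hcm hιΘ hLm hιmapply A hA hιA hAι
        have hXA0 : XA ≠ 0 := fun h0 => hA0 (LinearMap.range_eq_bot.1 (Submodule.finrank_eq_zero.1
          (by rw [← hXAUm, h0, Submodule.map_zero, finrank_bot])))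
        right; rw [← hXAUm]; exact (hprofc XA hXA hΘXA hXAΘ hXAc hXA0).2
    exact UnitaryThirtyFourFortyNine.subSeventeenThirtyTwo_rank14 hbrLm hirrLm hιmmem hιmιm hPm hQm (by omega) (by omega)
      (s := fun v w : Um => s (v : W) w) (hsU Um) (hsmU Um) (fun v w => hsymm v w) hPmQm hdefPm hdefQm hadjLm hSm
      hxmem hιmx hxιm (by rw [hxrk, h0j])
  · -- constant profile `(5, 12)`
    have hprofc : ∀ X ∈ 𝔊, Θ * X = X → X * Θ = -X → X * ι = ι * X → X ≠ 0 →
        Module.finrank ℂ (Up.map X) = 5 ∧ Module.finrank ℂ (Um.map X) = 12 := by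
      intro X hX hΘX hXΘ hXc hX0
      rcases hprof X hX hΘX hXΘ hXc with ⟨hi, hj⟩ | ⟨hi, hj⟩ | ⟨hi, hj⟩ | ⟨hi, hj⟩ | ⟨hi, hj⟩ | ⟨hi, hj⟩ | ⟨hi, hj⟩ | ⟨hi, hj⟩ | ⟨hi, hj⟩ | ⟨hi, hj⟩ | ⟨hi, hj⟩
      · exact (hX0 (hzero X hX hΘX hXΘ hXc hi hj)).elim
      · exact (hnotboth X hX hΘX hXΘ hXc X₀ hX₀ hΘX₀ hX₀Θ hX₀c (by omega)).elim
      · exact (hnotboth X hX hΘX hXΘ hXc X₀ hX₀ hΘX₀ hX₀Θ hX₀c (by omega)).elim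
      · exact ⟨hi, hj⟩
      · exact (hnotboth X₀ hX₀ hΘX₀ hX₀Θ hX₀c X hX hΘX hXΘ hXc (by omega)).elim
      · exact (hnotboth X₀ hX₀ hΘX₀ hX₀Θ hX₀c X hX hΘX hXΘ hXc (by omega)).elim
      · exact (hnotboth X₀ hX₀ hΘX₀ hX₀Θ hX₀c X hX hΘX hXΘ hXc (by omega)).elim
      · exact (hnotboth X₀ hX₀ hΘX₀ hX₀Θ hX₀c X hX hΘX hXΘ hXc (by omega)).elim
      · exact (hnotboth X₀ hX₀ hΘX₀ hX₀Θ hX₀c X hX hΘX hXΘ hXc (by omega)).elim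
      · exact (hnotboth X₀ hX₀ hΘX₀ hX₀Θ hX₀c X hX hΘX hXΘ hXc (by omega)).elim
      · exact (hnotboth X₀ hX₀ hΘX₀ hX₀Θ hX₀c X hX hΘX hXΘ hXc (by omega)).elim
    obtain ⟨hxmem, hιmx, hxιm, hxrk⟩ := UnitaryLeviSetup.restrict_mem hcm hLm hιmapply X₀ hX₀ hΘX₀ hX₀Θ hX₀c
    have hSm : ∀ A ∈ Lm, ιm * A = A → A * ιm = -A →
        Module.finrank ℂ (LinearMap.range A) = 0 ∨ Module.finrank ℂ (LinearMap.range A) = 12 := by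
      intro A hA hιA hAι
      by_cases hA0 : A = 0
      · left; rw [hA0, LinearMap.range_zero, finrank_bot]
      · obtain ⟨XA, hXA, hΘXA, hXAΘ, hXAc, hXAUm⟩ :=
          UnitaryLeviSetup.exists_lift hbr hΘ hΘΘ hcm hιΘ hLm hιmapply A hA hιA hAι
        have hXA0 : XA ≠ 0 := fun h0 => hA0 (LinearMap.range_eq_bot.1 (Submodule.finrank_eq_zero.1
          (by rw [← hXAUm, h0, Submodule.map_zero, finrank_bot])))
        right; rw [← hXAUm]; exact (hprofc XA hXA hΘXA hXAΘ hXAc hXA0).2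
    exact UnitaryThirtyFourFortyNine.subSeventeenThirtyTwo_rank12 hbrLm hirrLm hιmmem hιmιm hPm hQm (by omega) (by omega)
      (s := fun v w : Um => s (v : W) w) (hsU Um) (hsmU Um) (fun v w => hsymm v w) hPmQm hdefPm hdefQm hadjLm hSm
      hxmem hιmx hxιm (by rw [hxrk, h0j])
  · -- constant profile `(7, 10)`
    have hprofc : ∀ X ∈ 𝔊, Θ * X = X → X * Θ = -X → X * ι = ι * X → X ≠ 0 →
        Module.finrank ℂ (Up.map X) = 7 ∧ Module.finrank ℂ (Um.map X) = 10 := by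
      intro X hX hΘX hXΘ hXc hX0
      rcases hprof X hX hΘX hXΘ hXc with ⟨hi, hj⟩ | ⟨hi, hj⟩ | ⟨hi, hj⟩ | ⟨hi, hj⟩ | ⟨hi, hj⟩ | ⟨hi, hj⟩ | ⟨hi, hj⟩ | ⟨hi, hj⟩ | ⟨hi, hj⟩ | ⟨hi, hj⟩ | ⟨hi, hj⟩
      · exact (hX0 (hzero X hX hΘX hXΘ hXc hi hj)).elim
      · exact (hnotboth X hX hΘX hXΘ hXc X₀ hX₀ hΘX₀ hX₀Θ hX₀c (by omega)).elim
      · exact (hnotboth X hX hΘX hXΘ hXc X₀ hX₀ hΘX₀ hX₀Θ hX₀c (by omega)).elim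
      · exact (hnotboth X hX hΘX hXΘ hXc X₀ hX₀ hΘX₀ hX₀Θ hX₀c (by omega)).elim
      · exact ⟨hi, hj⟩
      · exact (hnotboth X₀ hX₀ hΘX₀ hX₀Θ hX₀c X hX hΘX hXΘ hXc (by omega)).elim
      · exact (hnotboth X₀ hX₀ hΘX₀ hX₀Θ hX₀c X hX hΘX hXΘ hXc (by omega)).elim
      · exact (hnotboth X₀ hX₀ hΘX₀ hX₀Θ hX₀c X hX hΘX hXΘ hXc (by omega)).elim
      · exact (hnotboth X₀ hX₀ hΘX₀ hX₀Θ hX₀c X hX hΘX hXΘ hXc (by omega)).elim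
      · exact (hnotboth X₀ hX₀ hΘX₀ hX₀Θ hX₀c X hX hΘX hXΘ hXc (by omega)).elim
      · exact (hnotboth X₀ hX₀ hΘX₀ hX₀Θ hX₀c X hX hΘX hXΘ hXc (by omega)).elim
    obtain ⟨hxmem, hιmx, hxιm, hxrk⟩ := UnitaryLeviSetup.restrict_mem hcm hLm hιmapply X₀ hX₀ hΘX₀ hX₀Θ hX₀c
    have hSm : ∀ A ∈ Lm, ιm * A = A → A * ιm = -A →
        Module.finrank ℂ (LinearMap.range A) = 0 ∨ Module.finrank ℂ (LinearMap.range A) = 10 := by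
      intro A hA hιA hAι
      by_cases hA0 : A = 0
      · left; rw [hA0, LinearMap.range_zero, finrank_bot]
      · obtain ⟨XA, hXA, hΘXA, hXAΘ, hXAc, hXAUm⟩ :=
          UnitaryLeviSetup.exists_lift hbr hΘ hΘΘ hcm hιΘ hLm hιmapply A hA hιA hAι
        have hXA0 : XA ≠ 0 := fun h0 => hA0 (LinearMap.range_eq_bot.1 (Submodule.finrank_eq_zero.1
          (by rw [← hXAUm, h0, Submodule.map_zero, finrank_bot])))
        right; rw [← hXAUm]; exact (hprofc XA hXA hΘXA hXAΘ hXAc hXA0).2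
    exact UnitaryThirtyFourFortyNine.subSeventeenThirtyTwo_rank10 hbrLm hirrLm hιmmem hιmιm hPm hQm (by omega) (by omega)
      (s := fun v w : Um => s (v : W) w) (hsU Um) (hsmU Um) (fun v w => hsymm v w) hPmQm hdefPm hdefQm hadjLm hSm
      hxmem hιmx hxιm (by rw [hxrk, h0j])
  · -- constant profile `(8, 9)`
    have hprofc : ∀ X ∈ 𝔊, Θ * X = X → X * Θ = -X → X * ι = ι * X → X ≠ 0 →
        Module.finrank ℂ (Up.map X) = 8 ∧ Module.finrank ℂ (Um.map X) = 9 := by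
      intro X hX hΘX hXΘ hXc hX0
      rcases hprof X hX hΘX hXΘ hXc with ⟨hi, hj⟩ | ⟨hi, hj⟩ | ⟨hi, hj⟩ | ⟨hi, hj⟩ | ⟨hi, hj⟩ | ⟨hi, hj⟩ | ⟨hi, hj⟩ | ⟨hi, hj⟩ | ⟨hi, hj⟩ | ⟨hi, hj⟩ | ⟨hi, hj⟩
      · exact (hX0 (hzero X hX hΘX hXΘ hXc hi hj)).elim
      · exact (hnotboth X hX hΘX hXΘ hXc X₀ hX₀ hΘX₀ hX₀Θ hX₀c (by omega)).elim
      · exact (hnotboth X hX hΘX hXΘ hXc X₀ hX₀ hΘX₀ hX₀Θ hX₀c (by omega)).elim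
      · exact (hnotboth X hX hΘX hXΘ hXc X₀ hX₀ hΘX₀ hX₀Θ hX₀c (by omega)).elim
      · exact (hnotboth X hX hΘX hXΘ hXc X₀ hX₀ hΘX₀ hX₀Θ hX₀c (by omega)).elim
      · exact ⟨hi, hj⟩
      · exact (hnotboth X₀ hX₀ hΘX₀ hX₀Θ hX₀c X hX hΘX hXΘ hXc (by omega)).elim
      · exact (hnotboth X₀ hX₀ hΘX₀ hX₀Θ hX₀c X hX hΘX hXΘ hXc (by omega)).elim
      · exact (hnotboth X₀ hX₀ hΘX₀ hX₀Θ hX₀c X hX hΘX hXΘ hXc (by omega)).elim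
      · exact (hnotboth X₀ hX₀ hΘX₀ hX₀Θ hX₀c X hX hΘX hXΘ hXc (by omega)).elim
      · exact (hnotboth X₀ hX₀ hΘX₀ hX₀Θ hX₀c X hX hΘX hXΘ hXc (by omega)).elim
    obtain ⟨hxmem, hιmx, hxιm, hxrk⟩ := UnitaryLeviSetup.restrict_mem hcm hLm hιmapply X₀ hX₀ hΘX₀ hX₀Θ hX₀c
    have hSm : ∀ A ∈ Lm, ιm * A = A → A * ιm = -A →
        Module.finrank ℂ (LinearMap.range A) = 0 ∨ Module.finrank ℂ (LinearMap.range A) = 9 := by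
      intro A hA hιA hAι
      by_cases hA0 : A = 0
      · left; rw [hA0, LinearMap.range_zero, finrank_bot]
      · obtain ⟨XA, hXA, hΘXA, hXAΘ, hXAc, hXAUm⟩ :=
          UnitaryLeviSetup.exists_lift hbr hΘ hΘΘ hcm hιΘ hLm hιmapply A hA hιA hAι
        have hXA0 : XA ≠ 0 := fun h0 => hA0 (LinearMap.range_eq_bot.1 (Submodule.finrank_eq_zero.1
          (by rw [← hXAUm, h0, Submodule.map_zero, finrank_bot])))
        right; rw [← hXAUm]; exact (hprofc XA hXA hΘXA hXAΘ hXAc hXA0).2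
    exact UnitaryThirtyFourFortyNine.subSeventeenThirtyTwo_rank9 hbrLm hirrLm hιmmem hιmιm hPm hQm (by omega) (by omega)
      (s := fun v w : Um => s (v : W) w) (hsU Um) (hsmU Um) (fun v w => hsymm v w) hPmQm hdefPm hdefQm hadjLm hSm
      hxmem hιmx hxιm (by rw [hxrk, h0j])
  · -- constant profile `(9, 8)`
    have hprofc : ∀ X ∈ 𝔊, Θ * X = X → X * Θ = -X → X * ι = ι * X → X ≠ 0 →
        Module.finrank ℂ (Up.map X) = 9 ∧ Module.finrank ℂ (Um.map X) = 8 := by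
      intro X hX hΘX hXΘ hXc hX0
      rcases hprof X hX hΘX hXΘ hXc with ⟨hi, hj⟩ | ⟨hi, hj⟩ | ⟨hi, hj⟩ | ⟨hi, hj⟩ | ⟨hi, hj⟩ | ⟨hi, hj⟩ | ⟨hi, hj⟩ | ⟨hi, hj⟩ | ⟨hi, hj⟩ | ⟨hi, hj⟩ | ⟨hi, hj⟩
      · exact (hX0 (hzero X hX hΘX hXΘ hXc hi hj)).elim
      · exact (hnotboth X hX hΘX hXΘ hXc X₀ hX₀ hΘX₀ hX₀Θ hX₀c (by omega)).elim
      · exact (hnotboth X hX hΘX hXΘ hXc X₀ hX₀ hΘX₀ hX₀Θ hX₀c (by omega)).elim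
      · exact (hnotboth X hX hΘX hXΘ hXc X₀ hX₀ hΘX₀ hX₀Θ hX₀c (by omega)).elim
      · exact (hnotboth X hX hΘX hXΘ hXc X₀ hX₀ hΘX₀ hX₀Θ hX₀c (by omega)).elim
      · exact (hnotboth X hX hΘX hXΘ hXc X₀ hX₀ hΘX₀ hX₀Θ hX₀c (by omega)).elim
      · exact ⟨hi, hj⟩
      · exact (hnotboth X₀ hX₀ hΘX₀ hX₀Θ hX₀c X hX hΘX hXΘ hXc (by omega)).elim
      · exact (hnotboth X₀ hX₀ hΘX₀ hX₀Θ hX₀c X hX hΘX hXΘ hXc (by omega)).elim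
      · exact (hnotboth X₀ hX₀ hΘX₀ hX₀Θ hX₀c X hX hΘX hXΘ hXc (by omega)).elim
      · exact (hnotboth X₀ hX₀ hΘX₀ hX₀Θ hX₀c X hX hΘX hXΘ hXc (by omega)).elim
    obtain ⟨hxmem, hιmx, hxιm, hxrk⟩ := UnitaryLeviSetup.restrict_mem hcm hLm hιmapply X₀ hX₀ hΘX₀ hX₀Θ hX₀c
    have hSm : ∀ A ∈ Lm, ιm * A = A → A * ιm = -A →
        Module.finrank ℂ (LinearMap.range A) = 0 ∨ Module.finrank ℂ (LinearMap.range A) = 8 := by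
      intro A hA hιA hAι
      by_cases hA0 : A = 0
      · left; rw [hA0, LinearMap.range_zero, finrank_bot]
      · obtain ⟨XA, hXA, hΘXA, hXAΘ, hXAc, hXAUm⟩ :=
          UnitaryLeviSetup.exists_lift hbr hΘ hΘΘ hcm hιΘ hLm hιmapply A hA hιA hAι
        have hXA0 : XA ≠ 0 := fun h0 => hA0 (LinearMap.range_eq_bot.1 (Submodule.finrank_eq_zero.1
          (by rw [← hXAUm, h0, Submodule.map_zero, finrank_bot])))
        right; rw [← hXAUm]; exact (hprofc XA hXA hΘXA hXAΘ hXAc hXA0).2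
    exact UnitaryThirtyFourFortyNine.subSeventeenThirtyTwo_rank8 hbrLm hirrLm hιmmem hιmιm hPm hQm (by omega) (by omega)
      (s := fun v w : Um => s (v : W) w) (hsU Um) (hsmU Um) (fun v w => hsymm v w) hPmQm hdefPm hdefQm hadjLm hSm
      hxmem hιmx hxιm (by rw [hxrk, h0j])
  · -- constant profile `(11, 6)`
    have hprofc : ∀ X ∈ 𝔊, Θ * X = X → X * Θ = -X → X * ι = ι * X → X ≠ 0 →
        Module.finrank ℂ (Up.map X) = 11 ∧ Module.finrank ℂ (Um.map X) = 6 := by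
      intro X hX hΘX hXΘ hXc hX0
      rcases hprof X hX hΘX hXΘ hXc with ⟨hi, hj⟩ | ⟨hi, hj⟩ | ⟨hi, hj⟩ | ⟨hi, hj⟩ | ⟨hi, hj⟩ | ⟨hi, hj⟩ | ⟨hi, hj⟩ | ⟨hi, hj⟩ | ⟨hi, hj⟩ | ⟨hi, hj⟩ | ⟨hi, hj⟩
      · exact (hX0 (hzero X hX hΘX hXΘ hXc hi hj)).elim
      · exact (hnotboth X hX hΘX hXΘ hXc X₀ hX₀ hΘX₀ hX₀Θ hX₀c (by omega)).elim
      · exact (hnotboth X hX hΘX hXΘ hXc X₀ hX₀ hΘX₀ hX₀Θ hX₀c (by omega)).elim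
      · exact (hnotboth X hX hΘX hXΘ hXc X₀ hX₀ hΘX₀ hX₀Θ hX₀c (by omega)).elim
      · exact (hnotboth X hX hΘX hXΘ hXc X₀ hX₀ hΘX₀ hX₀Θ hX₀c (by omega)).elim
      · exact (hnotboth X hX hΘX hXΘ hXc X₀ hX₀ hΘX₀ hX₀Θ hX₀c (by omega)).elim
      · exact (hnotboth X hX hΘX hXΘ hXc X₀ hX₀ hΘX₀ hX₀Θ hX₀c (by omega)).elim
      · exact ⟨hi, hj⟩
      · exact (hnotboth X₀ hX₀ hΘX₀ hX₀Θ hX₀c X hX hΘX hXΘ hXc (by omega)).elim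
      · exact (hnotboth X₀ hX₀ hΘX₀ hX₀Θ hX₀c X hX hΘX hXΘ hXc (by omega)).elim
      · exact (hnotboth X₀ hX₀ hΘX₀ hX₀Θ hX₀c X hX hΘX hXΘ hXc (by omega)).elim
    obtain ⟨hxmem, hιmx, hxιm, hxrk⟩ := UnitaryLeviSetup.restrict_mem hcm hLm hιmapply X₀ hX₀ hΘX₀ hX₀Θ hX₀c
    have hSm : ∀ A ∈ Lm, ιm * A = A → A * ιm = -A →
        Module.finrank ℂ (LinearMap.range A) = 0 ∨ Module.finrank ℂ (LinearMap.range A) = 6 := by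
      intro A hA hιA hAι
      by_cases hA0 : A = 0
      · left; rw [hA0, LinearMap.range_zero, finrank_bot]
      · obtain ⟨XA, hXA, hΘXA, hXAΘ, hXAc, hXAUm⟩ :=
          UnitaryLeviSetup.exists_lift hbr hΘ hΘΘ hcm hιΘ hLm hιmapply A hA hιA hAι
        have hXA0 : XA ≠ 0 := fun h0 => hA0 (LinearMap.range_eq_bot.1 (Submodule.finrank_eq_zero.1
          (by rw [← hXAUm, h0, Submodule.map_zero, finrank_bot])))
        right; rw [← hXAUm]; exact (hprofc XA hXA hΘXA hXAΘ hXAc hXA0).2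
    exact UnitaryThirtyFourFortyNine.subSeventeenThirtyTwo_rank6 hbrLm hirrLm hιmmem hιmιm hPm hQm (by omega) (by omega)
      (s := fun v w : Um => s (v : W) w) (hsU Um) (hsmU Um) (fun v w => hsymm v w) hPmQm hdefPm hdefQm hadjLm hSm
      hxmem hιmx hxιm (by rw [hxrk, h0j])
  · -- constant profile `(13, 4)`
    have hprofc : ∀ X ∈ 𝔊, Θ * X = X → X * Θ = -X → X * ι = ι * X → X ≠ 0 →
        Module.finrank ℂ (Up.map X) = 13 ∧ Module.finrank ℂ (Um.map X) = 4 := by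
      intro X hX hΘX hXΘ hXc hX0
      rcases hprof X hX hΘX hXΘ hXc with ⟨hi, hj⟩ | ⟨hi, hj⟩ | ⟨hi, hj⟩ | ⟨hi, hj⟩ | ⟨hi, hj⟩ | ⟨hi, hj⟩ | ⟨hi, hj⟩ | ⟨hi, hj⟩ | ⟨hi, hj⟩ | ⟨hi, hj⟩ | ⟨hi, hj⟩
      · exact (hX0 (hzero X hX hΘX hXΘ hXc hi hj)).elim
      · exact (hnotboth X hX hΘX hXΘ hXc X₀ hX₀ hΘX₀ hX₀Θ hX₀c (by omega)).elim
      · exact (hnotboth X hX hΘX hXΘ hXc X₀ hX₀ hΘX₀ hX₀Θ hX₀c (by omega)).elim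
      · exact (hnotboth X hX hΘX hXΘ hXc X₀ hX₀ hΘX₀ hX₀Θ hX₀c (by omega)).elim
      · exact (hnotboth X hX hΘX hXΘ hXc X₀ hX₀ hΘX₀ hX₀Θ hX₀c (by omega)).elim
      · exact (hnotboth X hX hΘX hXΘ hXc X₀ hX₀ hΘX₀ hX₀Θ hX₀c (by omega)).elim
      · exact (hnotboth X hX hΘX hXΘ hXc X₀ hX₀ hΘX₀ hX₀Θ hX₀c (by omega)).elim
      · exact (hnotboth X hX hΘX hXΘ hXc X₀ hX₀ hΘX₀ hX₀Θ hX₀c (by omega)).elim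
      · exact ⟨hi, hj⟩
      · exact (hnotboth X₀ hX₀ hΘX₀ hX₀Θ hX₀c X hX hΘX hXΘ hXc (by omega)).elim
      · exact (hnotboth X₀ hX₀ hΘX₀ hX₀Θ hX₀c X hX hΘX hXΘ hXc (by omega)).elim
    have hnum0 : Module.finrank ℂ QU ≤ (fun t : ℕ => (max (17 - 13 * t) (8 - 4 * t))) 0 := by beta_reduce; omega
    have hnum1 : (fun t : ℕ => (min (4 * t) 4)) 0 = 0 := by beta_reduce; omega
    have hnum2 : ∀ t : ℕ, (fun t : ℕ => (max (17 - 13 * t) (8 - 4 * t))) t ≤ (fun t : ℕ => (max (17 - 13 * t) (8 - 4 * t))) (t + 1) + (Module.finrank ℂ PU - (t + 1) * 4) := by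
      intro t; beta_reduce; omega
    have hnum3 : ∀ t : ℕ, (fun t : ℕ => (min (4 * t) 4)) t + (fun t : ℕ => (max (17 - 13 * t) (8 - 4 * t))) (t + 1) ≤ (fun t : ℕ => (min (4 * t) 4)) (t + 1) := by
      intro t; beta_reduce; omega
    have hnum4 : ∀ t : ℕ, (fun t : ℕ => (min (4 * t) 4)) t < Module.finrank ℂ ↥(Q ⊓ LinearMap.ker B) := by
      intro t; beta_reduce; omega
    exact UnitaryOrthogonalChain.false_of_constProfile_pos hbr hΘΘ hP hQ hadd hsmul hsymm hPQ hdefP hdefQ hadj hB hΘB hBΘ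
      hmin' hιι hιΘ hιs hUm hUp hPM hQM hPU hQU hfinQU' (i := 13) (j := 4) (c := 4) hprofc (by omega) (by omega)
      (by omega) (fun t : ℕ => (max (17 - 13 * t) (8 - 4 * t))) (fun t : ℕ => (min (4 * t) 4)) hnum0 hnum1 hnum2 hnum3 hnum4 hjoint
  · -- constant profile `(15, 2)`
    have hprofc : ∀ X ∈ 𝔊, Θ * X = X → X * Θ = -X → X * ι = ι * X → X ≠ 0 →
        Module.finrank ℂ (Up.map X) = 15 ∧ Module.finrank ℂ (Um.map X) = 2 := by
      intro X hX hΘX hXΘ hXc hX0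
      rcases hprof X hX hΘX hXΘ hXc with ⟨hi, hj⟩ | ⟨hi, hj⟩ | ⟨hi, hj⟩ | ⟨hi, hj⟩ | ⟨hi, hj⟩ | ⟨hi, hj⟩ | ⟨hi, hj⟩ | ⟨hi, hj⟩ | ⟨hi, hj⟩ | ⟨hi, hj⟩ | ⟨hi, hj⟩
      · exact (hX0 (hzero X hX hΘX hXΘ hXc hi hj)).elim
      · exact (hnotboth X hX hΘX hXΘ hXc X₀ hX₀ hΘX₀ hX₀Θ hX₀c (by omega)).elim
      · exact (hnotboth X hX hΘX hXΘ hXc X₀ hX₀ hΘX₀ hX₀Θ hX₀c (by omega)).elim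
      · exact (hnotboth X hX hΘX hXΘ hXc X₀ hX₀ hΘX₀ hX₀Θ hX₀c (by omega)).elim
      · exact (hnotboth X hX hΘX hXΘ hXc X₀ hX₀ hΘX₀ hX₀Θ hX₀c (by omega)).elim
      · exact (hnotboth X hX hΘX hXΘ hXc X₀ hX₀ hΘX₀ hX₀Θ hX₀c (by omega)).elim
      · exact (hnotboth X hX hΘX hXΘ hXc X₀ hX₀ hΘX₀ hX₀Θ hX₀c (by omega)).elim
      · exact (hnotboth X hX hΘX hXΘ hXc X₀ hX₀ hΘX₀ hX₀Θ hX₀c (by omega)).elim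
      · exact (hnotboth X hX hΘX hXΘ hXc X₀ hX₀ hΘX₀ hX₀Θ hX₀c (by omega)).elim
      · exact ⟨hi, hj⟩
      · exact (hnotboth X₀ hX₀ hΘX₀ hX₀Θ hX₀c X hX hΘX hXΘ hXc (by omega)).elim
    obtain ⟨A, hA, hιmA, hAιm, hAne, hA2⟩ :=
      UnitaryConstantRank.exists_raise_rank_ne_two hbrLm hirrLm hιmmem hιmιm hPm hQm (by omega) (by omega) (by omega)
        (s := fun v w : Um => s (v : W) w) (hsU Um) (fun v w => hsymm v w) hPmQm hdefPm hdefQm hadjLm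
    obtain ⟨XA, hXA, hΘXA, hXAΘ, hXAc, hXAUm⟩ := UnitaryLeviSetup.exists_lift hbr hΘ hΘΘ hcm hιΘ hLm hιmapply A hA hιmA hAιm
    have hA0 : Module.finrank ℂ (LinearMap.range A) ≠ 0 := fun h =>
      hAne (LinearMap.range_eq_bot.1 (Submodule.finrank_eq_zero.1 h))
    have hXA0 : XA ≠ 0 := fun h0 => hA0 (by rw [← hXAUm, h0, Submodule.map_zero, finrank_bot])
    have hpA := hprofc XA hXA hΘXA hXAΘ hXAc hXA0
    rw [← hXAUm] at hA2
    omega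
  · -- constant profile `(17, 0)`
    have hprofc : ∀ X ∈ 𝔊, Θ * X = X → X * Θ = -X → X * ι = ι * X → X ≠ 0 →
        Module.finrank ℂ (Up.map X) = 17 ∧ Module.finrank ℂ (Um.map X) = 0 := by
      intro X hX hΘX hXΘ hXc hX0
      rcases hprof X hX hΘX hXΘ hXc with ⟨hi, hj⟩ | ⟨hi, hj⟩ | ⟨hi, hj⟩ | ⟨hi, hj⟩ | ⟨hi, hj⟩ | ⟨hi, hj⟩ | ⟨hi, hj⟩ | ⟨hi, hj⟩ | ⟨hi, hj⟩ | ⟨hi, hj⟩ | ⟨hi, hj⟩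
      · exact (hX0 (hzero X hX hΘX hXΘ hXc hi hj)).elim
      · exact (hnotboth X hX hΘX hXΘ hXc X₀ hX₀ hΘX₀ hX₀Θ hX₀c (by omega)).elim
      · exact (hnotboth X hX hΘX hXΘ hXc X₀ hX₀ hΘX₀ hX₀Θ hX₀c (by omega)).elim
      · exact (hnotboth X hX hΘX hXΘ hXc X₀ hX₀ hΘX₀ hX₀Θ hX₀c (by omega)).elim
      · exact (hnotboth X hX hΘX hXΘ hXc X₀ hX₀ hΘX₀ hX₀Θ hX₀c (by omega)).elim
      · exact (hnotboth X hX hΘX hXΘ hXc X₀ hX₀ hΘX₀ hX₀Θ hX₀c (by omega)).elim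
      · exact (hnotboth X hX hΘX hXΘ hXc X₀ hX₀ hΘX₀ hX₀Θ hX₀c (by omega)).elim
      · exact (hnotboth X hX hΘX hXΘ hXc X₀ hX₀ hΘX₀ hX₀Θ hX₀c (by omega)).elim
      · exact (hnotboth X hX hΘX hXΘ hXc X₀ hX₀ hΘX₀ hX₀Θ hX₀c (by omega)).elim
      · exact (hnotboth X hX hΘX hXΘ hXc X₀ hX₀ hΘX₀ hX₀Θ hX₀c (by omega)).elim
      · exact ⟨hi, hj⟩
    obtain ⟨⟨v, hv⟩, hv0⟩ := Module.finrank_pos_iff_exists_ne_zero.1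
      (show 0 < Module.finrank ℂ ↥(Q ⊓ LinearMap.ker B) by omega)
    refine hv0 (Subtype.ext (hjoint v hv fun X hX hΘX hXΘ hXc => ?_))
    by_cases hX0 : X = 0
    · rw [hX0, LinearMap.zero_apply]
    · have hj := (hprofc X hX hΘX hXΘ hXc hX0).2
      have hvUm : v ∈ Um := (hUm v).2 ((hQM v).1 hv).1
      have hXv : X v ∈ Um.map X := Submodule.mem_map_of_mem hvUm
      rw [Submodule.finrank_eq_zero.1 hj, Submodule.mem_bot] at hXv
      exact hXv


end HodgeStructure

end Literature.AlgebraicGeometry.Motives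

end
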